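import Summits.KontsevichZagierPeriods.KontsevichZagierPeriods.Theses.TerasomaMultiplication
import Literature.NumberTheory.Transcendental.KZProductIdeal
import Literature.NumberTheory.Transcendental.KZKernelConjectureForms
import Literature.NumberTheory.Transcendental.KZLogCalculusProofs
import Literature.NumberTheory.Transcendental.KZMellinFibres
import Literature.NumberTheory.Transcendental.KZDominatedFamilyRelations
import Literature.NumberTheory.Transcendental.KZRegCalculusProofs
import Literature.NumberTheory.Transcendental.KZSubcalculusInvariants
import Literature.NumberTheory.Transcendental.GammaMonomialsProofs

/-!
# Disproof of `BetaCancellation` (stmt-KontsevichZagierPeriods-13633) — standing adversary, gen 1 + gen 2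

Work file of the crux disprover (route TerasomaMultiplication, crux #4 `BetaCancellation`:
"Beta classes are non-zero-divisors modulo the moves", two-term pinned form: for `0 < a, b ∈ ℚ`,
`q = [t^{a-1}(1-t)^{b-1}] × r`, `q' = [t^{a-1}(1-t)^{b-1}] × r'` pinned, `q ∼ q' → r ∼ r'`).

**Verdict so far: the crux RESISTS every cheap attack, for the strongest possible reason — it is
a CONSEQUENCE OF THE SUMMIT** (`betaCancellation_of_summit`, §3): a counterexample would be a
disproof of the formalised Kontsevich–Zagier period conjecture. All theorems below are
sorry-free; axioms ⊆ {propext, Classical.choice, Quot.sound}.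

Findings (section numbers):

1. `betaCancellation_iff` — the crux is `∀ a b > 0, KernelCancellation (betaKernel a b)` where
   `KernelCancellation k` is the same statement for an arbitrary kernel `k` on `(0,1)` and
   `IsPinned k r q` packages the two pinning hypotheses (`pinDomain`, `pinFun`: Beta variable
   FIRST, the `KZ.IntegralRep.prod` convention). Signature elaborates (rc 0); no coercion or junk
   issue (`^` = `Real.rpow` with bases in `(0,1)` on the domain; casts `ℚ → ℝ` only).
2. `value_of_isPinned` — Fubini for pinned reps, UNCONDITIONAL (Bochner conventions):
   `value q = (∫_{(0,1)} k) · value r`; `integrableOn_betaKernel_and_integral_eq`,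
   `integral_betaKernel_pos`: `∫₀¹ t^{a-1}(1-t)^{b-1} = B(a,b) > 0` (Mathlib's Beta density).
   Hence `value_eq_of_isPinned_of_equivalent`: `q ∼ q' → value r = value r'` — NO value-level
   counterexample exists; a kill needs a non-`eval` invariant of `KZ.relations`.
3. WHY IT RESISTS, I: `kernelCancellation_of_kzKernelConjecture` (any kernel with `∫₀¹ k ≠ 0`),
   `betaCancellation_of_kzKernelConjecture`, `betaCancellation_of_summit`,
   `not_summit_of_not_betaCancellation`. With §9 the crux is SANDWICHED between two open
   statements of the tree: `KZ.PiCancellation ≤ BetaCancellation ≤ KZKernelConjecture (= summit)`.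
4. Witnesses: `unitIoo`, `polyKernelRep p = [(0,1), p]`, `isPinned_prod` (the crux's hypotheses
   are satisfiable over EVERY `r`: no vacuity), `not_equivalent_piRep_neg` (`[π] ≁ −[π]`).
5. LOAD-BEARING HYPOTHESES: `betaCancellation_false_without_pin'`, `_without_pin`,
   `_without_equiv` — the pinning of `q`, of `q'`, and `q ∼ q'` are each necessary (witness
   `a = b = 1`, `r = [π]`, `r' = −[π]`).
   NOT LOAD-BEARING (§7): `0 < a`, `0 < b` — `kernelCancellation_betaKernel_iff :
   (∀ a b : ℚ, KernelCancellation (betaKernel a b)) ↔ BetaCancellation`; indeed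
   `kernelCancellation_of_not_integrableOn`: for ANY kernel with `|k| ∉ L¹(0,1)` cancellation holds
   vacuously (Tonelli, `integrableOn_abs_of_isPinned`: a pinned `q` exists only over an a.e.-null
   `r`, and such `r` are relations, `of_mem_relations_of_ae_eq_zero`), and the Beta kernel with
   `a ≤ 0` or `b ≤ 0` is not integrable (`not_integrableOn_abs_betaKernel_of_nonpos_left/right`,
   comparison with `t⁻¹` and `intervalIntegrable_inv_iff`). The positivity guards exclude only
   degenerate-TRUE instances; no proof can use them.
6. REFUTED STRENGTHENING: `not_kernelCancellation_of_odd`, `not_kernelCancellation_two_mul_sub_one`,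
   `not_polynomialKernelCancellation` — cancellation by a NON-ZERO kernel of integral ZERO fails
   (`k = 2t − 1`: `κ × r ∼ κ × (−r)` by ONE rule-(2) move reflecting the kernel coordinate,
   `equivalent_prod_neg_of_odd`). So a proof of the crux must see the VALUE `B(a,b) ≠ 0`; no
   value-blind descent of move certificates from `q ∼ q'` to `r ∼ r'` can exist.
7. Targets: none handed over (no stuck stubs). Near-misses: none.
8. PROVABLE CASES: `betaCancellation_one_one` (§8, `a = b = 1`: slab move, coordinate rotation
   `finAddFlip`, null boundary, transitivity) and, §10, ALL POSITIVE INTEGER EXPONENTS: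
   `kernelCancellation_betaKernel_natCast_succ (A B : ℕ) : KernelCancellation (betaKernel (A+1) (B+1))`,
   `betaCancellation_of_int` (literal shape). Mechanism: polynomial primitive `P = antideriv
   (X^A(1−X)^B)` ⇒ ONE Newton–Leibniz move `[[0,1]×σ, P'f] − [σ, P(1)f]`
   (`polySlab_sub_scaledBase_mem`); `P(1) = B(A+1,B+1) = A!B!/(A+B+1)! = 1/N`
   (`aeval_one_antideriv_kerPoly_eq_inv`, FTC + Beta + `Real.Gamma_nat_eq_factorial`); and
   `[r] − N•[σ, f/N] ∈ relations` by integrand additivity ALONE (`of_sub_nsmul_scaledBase_mem`) —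
   the factor `1/N` rides inside the integrand, so no division by `N` is ever needed. THE OPEN
   CONTENT OF THE CRUX IS EXACTLY THE NON-INTEGER REGIME, where `t^{a-1}(1-t)^{b-1}` has no
   semialgebraic primitive and `1/B(a,b)` is not expected to be an effective period.
9. WHY IT RESISTS, II: `piCancellation_of_betaCancellation : BetaCancellation → KZ.PiCancellation`
   via `equivalent_betaHalfRep_piRep : [β(1/2,1/2)] ∼ [π]`, a FOUR-MOVE chain formalised here
   (rule 2: `t = (1+x)/2`; rule 3 with primitive `−x√(1−x²)` from the point; rule 1; rule 3 along
   `y` onto the disc) — incidentally `betaHalfRep_value : B(1/2,1/2) = π` by soundness. So a PROOF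
   of the crux proves the open `π`-cancellation crux stmt-0540 of route AyoubSpecialisation
   (Huber–Wüstholz 2022 App. A: injectivity of effective into localised formal periods is open).

LANDED in the tree (importable; namespace
`Summit.KontsevichZagierPeriods.KontsevichZagierPeriods.BetaCancellationNegative`, directory
`Summits/…/Theorems/BetaCancellation/Negative/`, all accepted): `KernelForm.lean` (p73487: §1–§4
and §8), `LoadBearing.lean` (p74380: §5–§7), `IntegerExponents.lean` (p74383: §10), and the
`π`-link of §9 as `PiLinkReps.lean` (p74630) → `PiLinkMoves.lean` (p74758) → `PiLink.lean`
(p75059). Ideators / planners / leads may `import` them.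

PROVER BRIEFING. The only inputs that distinguish the Beta kernel from the refuted odd kernel are
analytic (`∫₀¹ k ≠ 0`); the only known way to USE `∫₀¹ k ≠ 0` inside the rules is to produce the
constant `B(a,b)` by a Newton–Leibniz move, which needs a SEMIALGEBRAIC primitive of the kernel —
available iff… (integer `a, b`: polynomial primitive, `B(a,b) = 1/N`, and then `N · [q] ∼ [r]`
makes the instance PROVABLE; general rational `a, b`: the incomplete Beta function is
transcendental, and `1/B(a,b)` is not expected to be an effective period, e.g. `B(1/2,1/2) = π`).
So the honest content of the crux is exactly `PiCancellation`-type injectivity on the effective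
period ring (Huber–Wüstholz 2022, App. A: open even motivically). Remark (not formalised):
contiguity `[β(a,b)] = [β(a+1,b)] + [β(a,b+1)]` (one rule-1 move) and integration by parts
`a·[β(a,b+1)] ≍ b·[β(a+1,b)]` (one rule-3 move, after clearing denominators) relate the Beta
classes at `(a,b) + ℤ²` only through INTEGER MULTIPLES, so cancellation at `(a,b)` and at
`(a+m, b+n)` agree modulo the (summit-implied, open) torsion-freeness of `FormalRep ⧸ relations`
("no division by integers is a rule"): modulo torsion the crux has parameters `(a mod 1, b mod 1)`,
and the lattice point `a, b ∈ ℤ` is the PROVED case.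
GEN 2 FINDINGS (2026-08-16, refuter-cdisprove-…-13633-g2-0; §11–§18 at the end of the file; all
sorry-free, axioms ⊆ {propext, Classical.choice, Quot.sound}; landing as
`Theorems/BetaCancellation/Negative/{Torsion, PrimitiveCriterion, CriterionApplications, Translation,
DirichletLinear, DirichletPolar, LineStubs, Verdict}.lean`, p-ids in the disprover's NOTES):
11. TORSION IS NOT AN ESCAPE (corrects the briefing's last remark): `FormalRep ⧸ relations` is
    torsion-free and divisible — `nsmul_mem_relations_iff` (`k•x ≡ scale k x`; `scale k⁻¹` preserves
    relations), `equivalent_of_nsmul_sub_mem` (the route's "only N·(pair)" worries are moot),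
    `equivalent_of_equivalent_constMul`.
12. PRIMITIVE CRITERION `kernelCancellation_iff_of_primitive`: kernel `k` with a ℚ-semialgebraic
    primitive `K ∈ C[0,1]`: `KernelCancellation k ↔ K 1 ≠ K 0` (= ∫₀¹k); (→) ONE Newton–Leibniz move
    over an arbitrary base (`prod_iccRep_sub_constMul_mem_newtonLeibnizRel`) + scalar cancellation,
    (←) pinned reps become relations, `[π] ≁ −[π]`. Cancellation is DECIDED inside the calculus
    exactly where a closed-form primitive exists.
13. APPLICATIONS: polynomial kernels completely (`↔ P(1) ≠ P(0)`); refuted NON-odd kernels `3t²−1`,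
    the EVEN `6t²−6t+1`, the algebraic `(3/2)√t−1` (§6's reflection was incidental); `2t` cancels;
    `β(a,1)`, `β(1,b)` cancel for EVERY rational `a,b>0` (first non-integer instances; primitive `t^a/a`).
14. `betaTranslation` ((a+b)[β(a,b+1)] ∼ b[β(a,b)], one NL move from the point + one additivity
    move; = the lead's stub) ⇒ `succ_right(_iff)`, `_add_nat`, `betaCancellation_iff_unitSquare`
    (crux ↔ its instances on ((0,1]∩ℚ)², unconditionally), `kernelCancellation_betaKernel_of_int_or_int`
    / `betaCancellation_of_int_or_int`: ONE INTEGER EXPONENT SUFFICES. OPEN CORE = `a∉ℤ ∧ b∉ℤ`.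
15. The two Dirichlet charts PROVED as single rule-(2) moves: `dirichletLinear` (|det| = 1−x),
    `dirichletPolar` (|det| = u; simplex rep constructed by Euler–Mellin + Jacobian criterion).
16. TARGETS (skeleton ce846a0b): 0/6 broken, 4/6 PROVED in registered signatures
    (`stub_betaTranslation_holds`, `stub_integrateOut_holds` (`integrateOut`), `stub_dirichletLinear_holds`,
    `stub_dirichletPolar_holds`); `stub_piCancellation` = 0540 (open, NECESSARY §9), `stub_eulerReflection`
    = 3383 (open). The line is reduced to exactly 3383 + 0540.
17. Anti-diagonal: `EulerReflectionAt b → (KernelCancellation (β(b,1−b)) ↔ KZ.PiCancellation)` for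
    every rational `b ∈ (0,1)` (§9 is b = 1/2): no anti-diagonal instance is easier than 0540.
18. THE VERDICT `betaCancellation_iff_piCancellation : EulerReflectionRational → (BetaCancellation ↔
    KZ.PiCancellation)`; the lead's line assembled in full (`companion_collapse`,
    `betaCancellation_of_piCancellation`). THE CRUX CARRIES NO CONTENT BEYOND ITEMS 3383 AND 0540.
LITERATURE (gen 2): Huber–Müller-Stach, Periods and Nori Motives, Part III draft (2015) p. 32,
Rem. 12.2.2: "injectivity is the true issue. Equivalently … P̃(k) is an integral domain"; Prop. 12.2.8
(converse only under Hodge, pure M); Cresson–Viu-Sos, JTNB 2019 = arXiv:1912.01751 p. 2: "no strategy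
of proof"; rules conjecture = generalised Hilbert 3rd problem for compact semialgebraic sets, "a
negative answer will be also interesting" (p. 5) — no counterexample or finer-than-volume invariant in
print; Ayoub 2015 (+ erratum Rem. 1.3): relative version only with 2πi inverted. Effective
cancellation before inverting [π] = the open fullness question of Huber–Wüstholz 2022 App. A.
WHY IT STILL RESISTS: every kill of the crux kills `KontsevichZagierPeriods` (§3) and 0540 (§18);
counterexamples could only live at `(a,b) ∈ (0,1)²`, where no closed-form primitive exists inside the
calculus; no invariant of `KZ.relations` finer than `eval` is known (route Neg).

-/

noncomputable section

set_option linter.dupNamespace false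

namespace Summit.KontsevichZagierPeriods.KontsevichZagierPeriods.Cruxes.BetaCancellation.Disproof

open MeasureTheory Set
open Literature.NumberTheory.Transcendental
open Literature.NumberTheory.Transcendental.KZ
open Literature.ModelTheory.ExponentialFields (IsSemialgebraic isSemialgebraic_univ)
open MvPolynomial (aeval X C)
open Summit.KontsevichZagierPeriods.KontsevichZagierPeriods.Theses.TerasomaMultiplication
  (BetaCancellation)
open Literature.NumberTheory.Transcendental.KZreg (unitIoo isSemialgebraic_unitIoo volume_unitIoo)

/-! ## §1 Vocabulary: pinned products and the kernel form of the crux -/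

/-- The crux-shaped domain `(0,1) × σ ⊆ ℝ^{1+n}` (Beta variable FIRST, as in
`KZ.IntegralRep.prod`). [folklore] -/
def pinDomain {n : ℕ} (σ : Set (Fin n → ℝ)) : Set (Fin (1 + n) → ℝ) :=
  {z | z (Fin.castAdd n 0) ∈ Ioo (0:ℝ) 1 ∧ (fun j => z (Fin.natAdd 1 j)) ∈ σ}

/-- The crux-shaped integrand `k(z₀) · f(z₁, …, zₙ)`. [folklore] -/
def pinFun {n : ℕ} (k : ℝ → ℝ) (f : (Fin n → ℝ) → ℝ) : (Fin (1 + n) → ℝ) → ℝ :=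
  fun z => k (z (Fin.castAdd n 0)) * f (fun j => z (Fin.natAdd 1 j))

/-- `q` is PINNED over `r` with kernel `k`: domain `(0,1) × σ`, integrand `k ⊗ f` on it (the two
hypotheses on `q`, resp. `q'`, in the crux). [folklore] -/
def IsPinned {n : ℕ} (k : ℝ → ℝ) (r : IntegralRep n) (q : IntegralRep (1 + n)) : Prop :=
  q.domain = pinDomain r.domain ∧ EqOn q.integrand (pinFun k r.integrand) q.domain

/-- CANCELLATION BY THE KERNEL `k`: the crux with the Beta kernel replaced by an arbitrary
kernel `k : ℝ → ℝ` on `(0,1)`. [folklore] -/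
def KernelCancellation (k : ℝ → ℝ) : Prop :=
  ∀ ⦃n m : ℕ⦄ (r : IntegralRep n) (r' : IntegralRep m) (q : IntegralRep (1 + n))
    (q' : IntegralRep (1 + m)),
    IsPinned k r q → IsPinned k r' q' → Equivalent q q' → Equivalent r r'

/-- The Beta kernel `t^{a-1} (1-t)^{b-1}` of the crux. [folklore] -/
def betaKernel (a b : ℚ) : ℝ → ℝ := fun t => t ^ ((a:ℝ) - 1) * (1 - t) ^ ((b:ℝ) - 1)

/-- **The crux unfolded**: `BetaCancellation` is `KernelCancellation (betaKernel a b)` for all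
positive rationals `a, b`. [folklore] -/
theorem betaCancellation_iff :
    BetaCancellation ↔ ∀ a b : ℚ, 0 < a → 0 < b → KernelCancellation (betaKernel a b) := by
  constructor
  · intro h a b ha hb n m r r' q q' hq hq' hqq'
    exact h a b ha hb r r' q q' hq.1 hq.2 hq'.1 hq'.2 hqq'
  · intro h a b ha hb n m r r' q q' hd hi hd' hi' hqq'
    exact h a b ha hb r r' q q' ⟨hd, hi⟩ ⟨hd', hi'⟩ hqq'

/-! ## §2 Values: `value q = (∫₀¹ k) · value r` for a pinned `q` (Fubini, unconditional) -/

/-- **Fubini for pinned representations**: if `q` is pinned over `r` with kernel `k`, then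
`value q = (∫_{(0,1)} k) · value r` — with Bochner conventions this needs NO integrability
(`MeasureTheory.setIntegral_prod_mul`). [folklore] -/
theorem value_of_isPinned {n : ℕ} {k : ℝ → ℝ} {r : IntegralRep n} {q : IntegralRep (1 + n)}
    (h : IsPinned k r q) : q.value = (∫ t in Ioo (0:ℝ) 1, k t) * r.value := by
  obtain ⟨hd, hi⟩ := h
  have hmeas : MeasurableSet q.domain := IntegralRep.measurableSet_domain_holds q
  rw [IntegralRep.value, setIntegral_congr_fun hmeas hi, hd]
  rw [← (volume_preserving_appendMeasurableEquiv (n := 1) (m := n)).setIntegral_preimage_emb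
    (appendMeasurableEquiv 1 n).measurableEmbedding]
  have hpre : appendMeasurableEquiv 1 n ⁻¹' pinDomain r.domain =
      {x : Fin 1 → ℝ | x 0 ∈ Ioo (0:ℝ) 1} ×ˢ r.domain := by
    ext p
    simp only [mem_preimage, appendMeasurableEquiv_apply, pinDomain, mem_setOf_eq,
      Fin.append_left, Fin.append_right, mem_prod]
  have hfun : ∀ p : (Fin 1 → ℝ) × (Fin n → ℝ),
      pinFun k r.integrand (appendMeasurableEquiv 1 n p) = k (p.1 0) * r.integrand p.2 := by
    intro p
    simp only [appendMeasurableEquiv_apply, pinFun, Fin.append_left, Fin.append_right]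
  simp_rw [hfun]
  rw [hpre, Measure.volume_eq_prod,
    setIntegral_prod_mul (fun x : Fin 1 → ℝ => k (x 0)) r.integrand]
  congr 1
  have h1 := (volume_preserving_funUnique (Fin 1) ℝ).setIntegral_preimage_emb
    (MeasurableEquiv.funUnique (Fin 1) ℝ).measurableEmbedding k (Ioo (0:ℝ) 1)
  rw [← h1]
  rfl

/-- **The Beta integral** on `(0,1)`: for `0 < a`, `0 < b` the Beta kernel is integrable on
`(0,1)` with integral `B(a,b) = Γ(a)Γ(b)/Γ(a+b)` (read off from Mathlib's normalised Beta
density `ProbabilityTheory.lintegral_betaPDF_eq_one`; same computation as the tree's private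
`integrableOn_betaIntegrand_and_integral_eq` in `Literature/…/KontsevichZagier.lean`). [folklore] -/
theorem integrableOn_betaKernel_and_integral_eq {a b : ℚ} (ha : 0 < a) (hb : 0 < b) :
    IntegrableOn (betaKernel a b) (Ioo 0 1) ∧
      ∫ t in Ioo (0:ℝ) 1, betaKernel a b t = ProbabilityTheory.beta a b := by
  have hα : (0:ℝ) < a := by exact_mod_cast ha
  have hβ : (0:ℝ) < b := by exact_mod_cast hb
  have hc0 : 0 < ProbabilityTheory.beta a b := ProbabilityTheory.beta_pos hα hβ
  set g : ℝ → ℝ := fun x => 1 / ProbabilityTheory.beta a b * x ^ ((a:ℝ) - 1) * (1 - x) ^ ((b:ℝ) - 1)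
    with hg
  have hlin : ∫⁻ x in Ioo (0 : ℝ) 1, ENNReal.ofReal (g x) = 1 := by
    rw [hg, ← ProbabilityTheory.lintegral_betaPDF, ProbabilityTheory.lintegral_betaPDF_eq_one hα hβ]
  have hg0 : 0 ≤ᵐ[volume.restrict (Ioo (0 : ℝ) 1)] g := by
    refine ae_restrict_of_forall_mem measurableSet_Ioo fun x hx => ?_
    have h1 : 0 ≤ x ^ ((a:ℝ) - 1) := Real.rpow_nonneg hx.1.le _
    have h2 : 0 ≤ (1 - x) ^ ((b:ℝ) - 1) := Real.rpow_nonneg (by linarith [hx.2]) _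
    simp only [hg, Pi.zero_apply]
    exact mul_nonneg (mul_nonneg (by positivity) h1) h2
  have hgm : AEStronglyMeasurable g (volume.restrict (Ioo (0 : ℝ) 1)) :=
    Measurable.aestronglyMeasurable (by fun_prop)
  have hgi : Integrable g (volume.restrict (Ioo (0 : ℝ) 1)) :=
    ⟨hgm, (hasFiniteIntegral_iff_ofReal hg0).2 (by simp [hlin])⟩
  have hgint : ∫ x in Ioo (0 : ℝ) 1, g x = 1 := by
    rw [integral_eq_lintegral_of_nonneg_ae hg0 hgm, hlin]; simp
  have hfg : betaKernel a b = fun x => ProbabilityTheory.beta a b * g x := by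
    funext x
    simp only [hg, betaKernel]
    field_simp
  refine ⟨?_, ?_⟩
  · rw [hfg]; exact hgi.const_mul _
  · rw [hfg, integral_const_mul, hgint, mul_one]

/-- The Beta integral is positive. [folklore] -/
theorem integral_betaKernel_pos {a b : ℚ} (ha : 0 < a) (hb : 0 < b) :
    0 < ∫ t in Ioo (0:ℝ) 1, betaKernel a b t := by
  rw [(integrableOn_betaKernel_and_integral_eq ha hb).2]
  exact ProbabilityTheory.beta_pos (by exact_mod_cast ha) (by exact_mod_cast hb)

/-- **Equivalent pinned representations have base representations of equal value** as soon as
`∫₀¹ k ≠ 0` (soundness of the calculus + Fubini). [folklore] -/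
theorem value_eq_of_isPinned_of_equivalent {n m : ℕ} {k : ℝ → ℝ} (hk : ∫ t in Ioo (0:ℝ) 1, k t ≠ 0)
    {r : IntegralRep n} {r' : IntegralRep m} {q : IntegralRep (1 + n)} {q' : IntegralRep (1 + m)}
    (hq : IsPinned k r q) (hq' : IsPinned k r' q') (hqq' : Equivalent q q') :
    r.value = r'.value := by
  have hv : q.value = q'.value := Equivalent.value_eq_holds hqq'
  rw [value_of_isPinned hq, value_of_isPinned hq'] at hv
  exact mul_left_cancel₀ hk hv

/-- Transport of integrability between `S ⊆ ℝ` and `{x | x 0 ∈ S} ⊆ ℝ¹`. [folklore] -/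
theorem integrableOn_comp_apply_zero_iff {g : ℝ → ℝ} {S : Set ℝ} :
    IntegrableOn (fun x : Fin 1 → ℝ => g (x 0)) {x | x 0 ∈ S} ↔ IntegrableOn g S :=
  (volume_preserving_funUnique (Fin 1) ℝ).integrableOn_comp_preimage
    (MeasurableEquiv.funUnique (Fin 1) ℝ).measurableEmbedding

/-! ## §3 WHY IT RESISTS, I: the crux is implied by the summit

`KernelCancellation k` for ANY kernel with `∫₀¹ k ≠ 0` follows from the kernel form
`KZKernelConjecture` of Conjecture 1, which the tree proves EQUIVALENT to the summit
(`kzKernelConjecture_iff_isRational`). Hence `¬ BetaCancellation → ¬ KontsevichZagierPeriods`: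
a refutation of this crux is a disproof of the (formalised) Kontsevich–Zagier period conjecture,
exactly as for `KZ.PiCancellation` (`KZ.piCancellation_of_kernel`). No cheap kill exists unless the
summit itself is cheaply false. -/

/-- Kernel conjecture ⇒ cancellation by every kernel of non-zero integral. [folklore] -/
theorem kernelCancellation_of_kzKernelConjecture (hK : KZKernelConjecture) {k : ℝ → ℝ}
    (hk : ∫ t in Ioo (0:ℝ) 1, k t ≠ 0) : KernelCancellation k := by
  intro n m r r' q q' hq hq' hqq'
  apply hK
  rw [KZ.eval_of_sub_of, value_eq_of_isPinned_of_equivalent hk hq hq' hqq', sub_self]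

/-- **Kernel conjecture ⇒ `BetaCancellation`.** [folklore] -/
theorem betaCancellation_of_kzKernelConjecture (hK : KZKernelConjecture) : BetaCancellation :=
  betaCancellation_iff.2 fun _ _ ha hb =>
    kernelCancellation_of_kzKernelConjecture hK (integral_betaKernel_pos ha hb).ne'

/-- **Summit ⇒ `BetaCancellation`**: the crux is a CONSEQUENCE of the sub-problem statement, so
any counterexample to it refutes `KontsevichZagierPeriods`. [folklore] -/
theorem betaCancellation_of_summit (h : _root_.KontsevichZagierPeriods) : BetaCancellation :=
  betaCancellation_of_kzKernelConjecture (kzKernelConjecture_iff_isRational.2 h)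

/-- Contrapositive, the disprover's reading: **refuting the crux refutes the summit**. [folklore] -/
theorem not_summit_of_not_betaCancellation (h : ¬ BetaCancellation) :
    ¬ _root_.KontsevichZagierPeriods :=
  fun hs => h (betaCancellation_of_summit hs)

/-! ## §4 Witness representations -/

/-! The open unit interval `(0,1) ⊆ ℝ¹` in the crux's shape is the tree's `KZreg.unitIoo`
(`= {t | 0 < t 0 ∧ t 0 < 1}`, with `KZreg.isSemialgebraic_unitIoo`, `KZreg.volume_unitIoo`). -/

/-- Membership in `unitIoo`, in the crux's `Set.Ioo` spelling. [folklore] -/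
@[simp] theorem mem_unitIoo (x : Fin 1 → ℝ) : x ∈ unitIoo ↔ x 0 ∈ Ioo (0:ℝ) 1 := Iff.rfl

/-- `(0,1) ⊆ ℝ¹` is the open unit box. [folklore] -/
theorem unitIoo_eq_pi : unitIoo = Set.pi univ fun _ : Fin 1 => Ioo (0:ℝ) 1 := by
  ext x
  simp [KZreg.unitIoo, Fin.forall_fin_one]

/-- Continuous functions are integrable on `(0,1) ⊆ ℝ¹`. [folklore] -/
theorem integrableOn_unitIoo_of_continuous {f : (Fin 1 → ℝ) → ℝ} (hf : Continuous f) :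
    IntegrableOn f unitIoo := by
  have hK : IsCompact (Set.pi univ fun _ : Fin 1 => Icc (0:ℝ) 1) :=
    isCompact_univ_pi fun _ => isCompact_Icc
  refine (hf.continuousOn.integrableOn_compact hK).mono_set ?_
  rw [unitIoo_eq_pi]
  exact Set.pi_mono fun _ _ => Ioo_subset_Icc_self

/-- A kernel representation `[(0,1), p]` on `ℝ¹` for a `ℚ`-polynomial `p`. [folklore] -/
def polyKernelRep (p : MvPolynomial (Fin 1) ℚ) : IntegralRep 1 where
  domain := unitIoo
  integrand := fun x => aeval x p
  isSemialgebraic_domain := isSemialgebraic_unitIoo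
  isSemialgebraicFunOn_integrand := isSemialgebraicFunOn_aeval isSemialgebraic_unitIoo p
  integrableOn := by
    have hc : Continuous fun x : Fin 1 → ℝ => aeval x p := by
      have : (fun x : Fin 1 → ℝ => aeval x p) =
          fun x => MvPolynomial.eval x (p.map (algebraMap ℚ ℝ)) := by
        funext x
        rw [MvPolynomial.eval_map, MvPolynomial.aeval_def]
      rw [this]
      exact MvPolynomial.continuous_eval _
    exact integrableOn_unitIoo_of_continuous hc

/-- The domain of `polyKernelRep p`. [folklore] -/
@[simp] theorem polyKernelRep_domain (p : MvPolynomial (Fin 1) ℚ) :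
    (polyKernelRep p).domain = unitIoo := rfl

/-- The integrand of `polyKernelRep p`. [folklore] -/
@[simp] theorem polyKernelRep_integrand (p : MvPolynomial (Fin 1) ℚ) :
    (polyKernelRep p).integrand = fun x => aeval x p := rfl

/-- **Products with a kernel on `(0,1)` are pinned**: `κ.prod r` is pinned over `r` with kernel
`k` whenever `κ = [(0,1), k]`. In particular the hypotheses of the crux are satisfiable over
EVERY `r` (no vacuity) as soon as the kernel is semialgebraic and integrable on `(0,1)`.
[folklore] -/
theorem isPinned_prod {n : ℕ} {k : ℝ → ℝ} (κ : IntegralRep 1) (hκ : κ.domain = unitIoo)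
    (hk : ∀ x ∈ unitIoo, κ.integrand x = k (x 0)) (r : IntegralRep n) :
    IsPinned k r (κ.prod r) := by
  constructor
  · ext z
    simp only [IntegralRep.prod_domain, IntegralRep.mem_prodDomain, hκ, mem_unitIoo, pinDomain,
      mem_setOf_eq]
  · intro z hz
    rw [IntegralRep.prod_integrand_eq]
    simp only [IntegralRep.prod_domain, IntegralRep.mem_prodDomain, hκ] at hz
    simp only [IntegralRep.prodFun, pinFun, hk _ hz.1]

/-- `[π]` and `−[π]` are NOT equivalent (soundness: `π ≠ −π`). [folklore] -/
theorem not_equivalent_piRep_neg : ¬ Equivalent piRep piRep.neg := by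
  intro h
  have hv := Equivalent.value_eq_holds h
  rw [IntegralRep.value_neg, piRep_value] at hv
  linarith [Real.pi_pos]

/-- The Beta kernel at `a = b = 1` is the constant `1`. [folklore] -/
@[simp] theorem betaKernel_one_one : betaKernel 1 1 = fun _ => 1 := by
  funext t
  simp [betaKernel]

/-- `[(0,1), 1] × r` is pinned over `r` with the Beta kernel at `a = b = 1`. [folklore] -/
theorem isPinned_one_prod {n : ℕ} (r : IntegralRep n) :
    IsPinned (betaKernel 1 1) r ((polyKernelRep 1).prod r) :=
  isPinned_prod (polyKernelRep 1) rfl (fun x _ => by simp) r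

/-! ## §5 LOAD-BEARING HYPOTHESES

Each `…Without…` Prop is the crux with the named hypothesis dropped, in the crux's literal shape;
`_false_without_` shows any proof must use that hypothesis. Witness throughout: `a = b = 1`
(Beta kernel `≡ 1`), `r = [π] = [{x²+y² ≤ 1}, 1]`, `r' = −[π]`, and the pinned products
`[(0,1), 1] × (±[π])`. The positivity hypotheses `0 < a`, `0 < b` are NOT load-bearing — see §7. -/

/-- The crux WITHOUT the two hypotheses pinning `q'` to `r'`. -/
def BetaCancellationWithoutPin' : Prop :=
  ∀ (a b : ℚ), 0 < a → 0 < b → ∀ ⦃n m : ℕ⦄ (r : IntegralRep n) (r' : IntegralRep m)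
    (q : IntegralRep (1 + n)) (q' : IntegralRep (1 + m)),
    q.domain = {z | z (Fin.castAdd n 0) ∈ Set.Ioo (0:ℝ) 1 ∧ (fun j => z (Fin.natAdd 1 j)) ∈ r.domain} →
    Set.EqOn q.integrand (fun z => (z (Fin.castAdd n 0)) ^ ((a:ℝ) - 1) *
      (1 - z (Fin.castAdd n 0)) ^ ((b:ℝ) - 1) * r.integrand (fun j => z (Fin.natAdd 1 j))) q.domain →
    Equivalent q q' → Equivalent r r'

/-- **The pinning of `q'` is load-bearing.** Witness: `q' := q` (pinned over `r = [π]`, not over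
`r' = −[π]`). [folklore] -/
theorem betaCancellation_false_without_pin' : ¬ BetaCancellationWithoutPin' := by
  intro h
  have hq := isPinned_one_prod piRep
  exact not_equivalent_piRep_neg (h 1 1 one_pos one_pos piRep piRep.neg _
    ((polyKernelRep 1).prod piRep) hq.1 hq.2 (Equivalent.refl _))

/-- The crux WITHOUT the two hypotheses pinning `q` to `r`. -/
def BetaCancellationWithoutPin : Prop :=
  ∀ (a b : ℚ), 0 < a → 0 < b → ∀ ⦃n m : ℕ⦄ (r : IntegralRep n) (r' : IntegralRep m)
    (q : IntegralRep (1 + n)) (q' : IntegralRep (1 + m)),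
    q'.domain = {z | z (Fin.castAdd m 0) ∈ Set.Ioo (0:ℝ) 1 ∧ (fun j => z (Fin.natAdd 1 j)) ∈ r'.domain} →
    Set.EqOn q'.integrand (fun z => (z (Fin.castAdd m 0)) ^ ((a:ℝ) - 1) *
      (1 - z (Fin.castAdd m 0)) ^ ((b:ℝ) - 1) * r'.integrand (fun j => z (Fin.natAdd 1 j))) q'.domain →
    Equivalent q q' → Equivalent r r'

/-- **The pinning of `q` is load-bearing** (symmetric witness). [folklore] -/
theorem betaCancellation_false_without_pin : ¬ BetaCancellationWithoutPin := by
  intro h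
  have hq' := isPinned_one_prod piRep.neg
  exact not_equivalent_piRep_neg (h 1 1 one_pos one_pos piRep piRep.neg
    ((polyKernelRep 1).prod piRep.neg) _ hq'.1 hq'.2 (Equivalent.refl _))

/-- The crux WITHOUT the hypothesis `Equivalent q q'`. -/
def BetaCancellationWithoutEquiv : Prop :=
  ∀ (a b : ℚ), 0 < a → 0 < b → ∀ ⦃n m : ℕ⦄ (r : IntegralRep n) (r' : IntegralRep m)
    (q : IntegralRep (1 + n)) (q' : IntegralRep (1 + m)),
    q.domain = {z | z (Fin.castAdd n 0) ∈ Set.Ioo (0:ℝ) 1 ∧ (fun j => z (Fin.natAdd 1 j)) ∈ r.domain} →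
    Set.EqOn q.integrand (fun z => (z (Fin.castAdd n 0)) ^ ((a:ℝ) - 1) *
      (1 - z (Fin.castAdd n 0)) ^ ((b:ℝ) - 1) * r.integrand (fun j => z (Fin.natAdd 1 j))) q.domain →
    q'.domain = {z | z (Fin.castAdd m 0) ∈ Set.Ioo (0:ℝ) 1 ∧ (fun j => z (Fin.natAdd 1 j)) ∈ r'.domain} →
    Set.EqOn q'.integrand (fun z => (z (Fin.castAdd m 0)) ^ ((a:ℝ) - 1) *
      (1 - z (Fin.castAdd m 0)) ^ ((b:ℝ) - 1) * r'.integrand (fun j => z (Fin.natAdd 1 j))) q'.domain →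
    Equivalent r r'

/-- **`Equivalent q q'` is load-bearing** (the conclusion is not vacuous: non-equivalent pairs
with pinned products exist). [folklore] -/
theorem betaCancellation_false_without_equiv : ¬ BetaCancellationWithoutEquiv := by
  intro h
  have hq := isPinned_one_prod piRep
  have hq' := isPinned_one_prod piRep.neg
  exact not_equivalent_piRep_neg (h 1 1 one_pos one_pos piRep piRep.neg _ _ hq.1 hq.2 hq'.1 hq'.2)

/-! ## §6 REFUTED STRENGTHENING: cancellation needs `∫₀¹ k ≠ 0`, not just `k ≠ 0`

The natural strengthening "every non-zero (polynomial, `ℚ`-semialgebraic, integrable) kernel on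
`(0,1)` cancels" is FALSE: a kernel which is ODD about `t = 1/2` has `κ × r ∼ κ × (−r)` for every
`r` by ONE change of variables (reflect the kernel coordinate, rule 2), while `[π] ≁ −[π]`.
So any proof of the crux must use an input distinguishing `t^{a-1}(1-t)^{b-1}` from `2t − 1`,
i.e. (at least) the non-vanishing of the Beta INTEGRAL — a purely combinatorial manipulation of
move certificates that is blind to the kernel's value cannot prove `BetaCancellation`. -/

/-- Reflecting the kernel coordinate: the head of the reflected vector. [folklore] -/
theorem head_boxReflection {n : ℕ} (z : Fin (1 + n) → ℝ) :
    (fun i : Fin 1 => boxReflection (Fin.castAdd n 0) z (Fin.castAdd n i)) =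
      boxReflection 0 (fun i => z (Fin.castAdd n i)) := by
  funext i
  obtain rfl : i = 0 := Fin.fin_one_eq_zero i
  simp [boxReflection]

/-- Reflecting the kernel coordinate: the tail is unchanged. [folklore] -/
theorem tail_boxReflection {n : ℕ} (z : Fin (1 + n) → ℝ) (j : Fin n) :
    boxReflection (Fin.castAdd n 0) z (Fin.natAdd 1 j) = z (Fin.natAdd 1 j) := by
  have hne : Fin.natAdd 1 j ≠ Fin.castAdd n 0 := by
    intro h
    have := congrArg Fin.val h
    simp at this
  simp [boxReflection, hne]

/-- **Odd kernels anti-commute with negation modulo ONE move**: if `κ = [(0,1), k]` with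
`k (1 − t) = −k t`, then `κ × r ∼ κ × (−r)` for every `r` (rule 2 with the reflection of the kernel
coordinate, `|det| = 1`). [folklore] -/
theorem equivalent_prod_neg_of_odd {n : ℕ} (κ : IntegralRep 1) (hκ : κ.domain = unitIoo)
    (hodd : ∀ x ∈ unitIoo, κ.integrand (boxReflection 0 x) = -κ.integrand x) (r : IntegralRep n) :
    Equivalent (κ.prod r) (κ.prod r.neg) := by
  refine of_sub_of_mem_relations_of_boxReflection (Fin.castAdd n 0) ?_ ?_
  · ext z
    simp only [IntegralRep.prod_domain, IntegralRep.mem_prodDomain, IntegralRep.domain_neg,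
      mem_preimage, hκ, mem_unitIoo, tail_boxReflection]
    simp only [boxReflection, if_true, mem_Ioo]
    constructor <;> rintro ⟨⟨h1, h2⟩, h3⟩ <;> exact ⟨⟨by linarith, by linarith⟩, h3⟩
  · intro z hz
    simp only [IntegralRep.prod_domain, IntegralRep.mem_prodDomain, hκ, mem_unitIoo] at hz
    rw [IntegralRep.prod_integrand_eq, IntegralRep.prod_integrand_eq]
    simp only [IntegralRep.prodFun, IntegralRep.integrand_neg, Pi.neg_apply, tail_boxReflection]
    rw [head_boxReflection, hodd _ (by simpa using hz.1)]
    ring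

/-- **No cancellation by an odd kernel.** If `k` is odd about `1/2` on `(0,1)` and is the
integrand of some representation `κ = [(0,1), k]` (i.e. `k` is `ℚ`-semialgebraic and integrable
there, so that pinned products exist), then `KernelCancellation k` fails: witness `r = [π]`,
`r' = −[π]`, `q = κ × [π] ∼ q' = κ × (−[π])`. [folklore] -/
theorem not_kernelCancellation_of_odd {k : ℝ → ℝ} (κ : IntegralRep 1) (hκ : κ.domain = unitIoo)
    (hk : ∀ x ∈ unitIoo, κ.integrand x = k (x 0)) (hodd : ∀ t ∈ Ioo (0:ℝ) 1, k (1 - t) = -k t) :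
    ¬ KernelCancellation k := by
  intro h
  have hq := isPinned_prod κ hκ hk piRep
  have hq' := isPinned_prod κ hκ hk piRep.neg
  refine not_equivalent_piRep_neg (h piRep piRep.neg _ _ hq hq' ?_)
  refine equivalent_prod_neg_of_odd κ hκ (fun x hx => ?_) piRep
  have hx' : boxReflection 0 x ∈ unitIoo := by
    simp only [mem_unitIoo, boxReflection_apply_self, mem_Ioo] at hx ⊢
    constructor <;> linarith [hx.1, hx.2]
  rw [hk _ hx', hk _ hx, boxReflection_apply_self]
  exact hodd _ hx

/-- **The strengthening "every non-zero polynomial kernel cancels" is false**: the kernel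
`2t − 1` (non-zero, `ℚ`-polynomial, bounded) does not cancel. [folklore] -/
theorem not_kernelCancellation_two_mul_sub_one : ¬ KernelCancellation (fun t => 2 * t - 1) :=
  not_kernelCancellation_of_odd (polyKernelRep (2 * X 0 - 1)) rfl (fun x _ => by simp)
    (fun t _ => by ring)

/-- The same in the crux's literal shape: "cancellation by every `ℚ`-polynomial kernel that does
not vanish identically on `(0,1)`" — FALSE. -/
def PolynomialKernelCancellation : Prop :=
  ∀ p : Polynomial ℚ, (∃ t ∈ Set.Ioo (0:ℚ) 1, p.eval t ≠ 0) →
    ∀ ⦃n m : ℕ⦄ (r : IntegralRep n) (r' : IntegralRep m) (q : IntegralRep (1 + n))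
      (q' : IntegralRep (1 + m)),
    q.domain = {z | z (Fin.castAdd n 0) ∈ Set.Ioo (0:ℝ) 1 ∧ (fun j => z (Fin.natAdd 1 j)) ∈ r.domain} →
    Set.EqOn q.integrand (fun z => (p.map (algebraMap ℚ ℝ)).eval (z (Fin.castAdd n 0)) *
      r.integrand (fun j => z (Fin.natAdd 1 j))) q.domain →
    q'.domain = {z | z (Fin.castAdd m 0) ∈ Set.Ioo (0:ℝ) 1 ∧ (fun j => z (Fin.natAdd 1 j)) ∈ r'.domain} →
    Set.EqOn q'.integrand (fun z => (p.map (algebraMap ℚ ℝ)).eval (z (Fin.castAdd m 0)) *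
      r'.integrand (fun j => z (Fin.natAdd 1 j))) q'.domain →
    Equivalent q q' → Equivalent r r'

/-- `PolynomialKernelCancellation` is false (kernel `2t − 1`). [folklore] -/
theorem not_polynomialKernelCancellation : ¬ PolynomialKernelCancellation := by
  intro h
  have hp : ∃ t ∈ Set.Ioo (0:ℚ) 1, (2 * Polynomial.X - 1 : Polynomial ℚ).eval t ≠ 0 :=
    ⟨1/4, by norm_num, by norm_num⟩
  have hev : ∀ t : ℝ, ((2 * Polynomial.X - 1 : Polynomial ℚ).map (algebraMap ℚ ℝ)).eval t
      = 2 * t - 1 := by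
    intro t
    simp
  apply not_kernelCancellation_two_mul_sub_one
  intro n m r r' q q' hq hq' hqq'
  refine h _ hp r r' q q' hq.1 (fun z hz => ?_) hq'.1 (fun z hz => ?_) hqq'
  · rw [hq.2 hz]
    simp only [pinFun, hev]
  · rw [hq'.2 hz]
    simp only [pinFun, hev]

/-! ## §7 NOT LOAD-BEARING: `0 < a`, `0 < b` (non-integrable kernels cancel vacuously)

If `|k|` is NOT integrable on `(0,1)` then a representation `q` pinned over `r` with kernel `k`
exists only when `f = 0` a.e. on `σ` (Tonelli: integrability of `k ⊗ f` on `(0,1) × σ` forces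
`∫_σ |f| = 0` or `∫₀¹ |k| < ∞`), and then `[r] ∈ relations` (split `σ` into the semialgebraic zero
set of `f` and a null remainder). Hence `KernelCancellation k` HOLDS for such `k`
(`kernelCancellation_of_not_integrableOn`), in particular for the Beta kernel with `a ≤ 0` or
`b ≤ 0` (`kernelCancellation_betaKernel_of_nonpos_left/right`): the positivity hypotheses of the
crux only exclude degenerate-TRUE instances — they are non-vacuity guards that no proof can use. -/

/-- A representation whose (semialgebraic) integrand vanishes a.e. on its domain is a relation:
domain additivity along the zero set `{x ∈ σ | f x = 0}` (semialgebraic by Tarski–Seidenberg,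
`isSemialgebraic_sep_eq`) whose complement in `σ` is null. [folklore] -/
theorem of_mem_relations_of_ae_eq_zero {n : ℕ} (r : IntegralRep n)
    (h : ∀ᵐ x ∂(volume.restrict r.domain), r.integrand x = 0) : of r ∈ relations := by
  have hE : IsSemialgebraic ℚ {x | x ∈ r.domain ∧ r.integrand x = (fun _ => (0:ℝ)) x} :=
    isSemialgebraic_sep_eq r.isSemialgebraicFunOn_integrand
      ((isSemialgebraicFunOn_aeval r.isSemialgebraic_domain 0).congr fun x _ => by simp)
  have hEr : {x | x ∈ r.domain ∧ r.integrand x = (fun _ => (0:ℝ)) x} ⊆ r.domain := fun x hx => hx.1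
  have hvol : volume (r.domain \ {x | x ∈ r.domain ∧ r.integrand x = (fun _ => (0:ℝ)) x}) = 0 := by
    have h' := (ae_restrict_iff' (IntegralRep.measurableSet_domain_holds r)).1 h
    rw [ae_iff] at h'
    refine measure_mono_null (fun x hx => ?_) h'
    simp only [mem_setOf_eq, Classical.not_imp]
    exact ⟨hx.1, fun h0 => hx.2 ⟨hx.1, h0⟩⟩
  have h1 := r.of_sub_of_restrict_mem_relations hE hEr hvol
  have h2 : of (r.restrict _ hE hEr) ∈ relations :=
    of_mem_relations_of_eqOn_zero _ fun x hx => hx.2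
  have := relations.add_mem h1 h2
  simpa using this

/-- **Tonelli for pinned representations**: if `q` is pinned over `r` with kernel `k` and `f` is
not a.e. zero on `σ`, then `|k|` is integrable on `(0,1)`. [folklore] -/
theorem integrableOn_abs_of_isPinned {n : ℕ} {k : ℝ → ℝ} {r : IntegralRep n}
    {q : IntegralRep (1 + n)} (hq : IsPinned k r q)
    (hr : ¬ ∀ᵐ x ∂(volume.restrict r.domain), r.integrand x = 0) :
    IntegrableOn (fun t => |k t|) (Ioo (0:ℝ) 1) := by
  obtain ⟨hd, hi⟩ := hq
  have hmeas : MeasurableSet q.domain := IntegralRep.measurableSet_domain_holds q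
  have H0 : IntegrableOn (pinFun k r.integrand) (pinDomain r.domain) := by
    have := q.integrableOn.congr_fun hi hmeas
    rwa [hd] at this
  have H1 : IntegrableOn (fun p : (Fin 1 → ℝ) × (Fin n → ℝ) => k (p.1 0) * r.integrand p.2)
      (unitIoo ×ˢ r.domain) ((volume : Measure (Fin 1 → ℝ)).prod volume) := by
    have h := ((volume_preserving_appendMeasurableEquiv (n := 1) (m := n)).integrableOn_comp_preimage
      (appendMeasurableEquiv 1 n).measurableEmbedding).2 H0
    have hpre : appendMeasurableEquiv 1 n ⁻¹' pinDomain r.domain = unitIoo ×ˢ r.domain := by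
      ext p
      simp only [mem_preimage, appendMeasurableEquiv_apply, pinDomain, mem_setOf_eq,
        Fin.append_left, Fin.append_right, mem_prod, mem_unitIoo]
    have hfun : (pinFun k r.integrand ∘ appendMeasurableEquiv 1 n) =
        fun p => k (p.1 0) * r.integrand p.2 := by
      funext p
      simp only [Function.comp_apply, appendMeasurableEquiv_apply, pinFun, Fin.append_left,
        Fin.append_right]
    rw [hpre, hfun, Measure.volume_eq_prod] at h
    exact h
  rw [IntegrableOn, ← Measure.prod_restrict] at H1
  have H2 := ((integrable_prod_iff H1.aestronglyMeasurable).1 H1).2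
  have hC : ∀ x : Fin 1 → ℝ, ∫ y, ‖k (x 0) * r.integrand y‖ ∂(volume.restrict r.domain) =
      |k (x 0)| * ∫ y in r.domain, |r.integrand y| := by
    intro x
    simp only [norm_mul, Real.norm_eq_abs]
    exact integral_const_mul _ _
  simp_rw [hC] at H2
  have hC0 : (∫ y in r.domain, |r.integrand y|) ≠ 0 := by
    intro h0
    apply hr
    have hint : IntegrableOn (fun y => |r.integrand y|) r.domain := r.integrableOn.abs
    have h1 := (integral_eq_zero_iff_of_nonneg_ae (ae_of_all _ fun y => abs_nonneg _) hint).1 h0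
    filter_upwards [h1] with y hy
    simpa using hy
  have H3 : Integrable (fun x : Fin 1 → ℝ => |k (x 0)|) (volume.restrict unitIoo) := by
    refine (H2.mul_const (∫ y in r.domain, |r.integrand y|)⁻¹).congr (ae_of_all _ fun x => ?_)
    simp only
    rw [mul_assoc, mul_inv_cancel₀ hC0, mul_one]
  exact integrableOn_comp_apply_zero_iff.1 H3

/-- **Non-integrable kernels pin only trivial representations**: if `|k| ∉ L¹(0,1)` and `q` is
pinned over `r` with kernel `k`, then `[r] ∈ relations`. [folklore] -/
theorem of_mem_relations_of_isPinned {n : ℕ} {k : ℝ → ℝ}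
    (hk : ¬ IntegrableOn (fun t => |k t|) (Ioo (0:ℝ) 1)) {r : IntegralRep n}
    {q : IntegralRep (1 + n)} (hq : IsPinned k r q) : of r ∈ relations := by
  by_cases hr : ∀ᵐ x ∂(volume.restrict r.domain), r.integrand x = 0
  · exact of_mem_relations_of_ae_eq_zero r hr
  · exact absurd (integrableOn_abs_of_isPinned hq hr) hk

/-- **Cancellation by a non-integrable kernel holds** (vacuously: both bases are relations).
[folklore] -/
theorem kernelCancellation_of_not_integrableOn {k : ℝ → ℝ}
    (hk : ¬ IntegrableOn (fun t => |k t|) (Ioo (0:ℝ) 1)) : KernelCancellation k :=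
  fun _ _ _ _ _ _ hq hq' _ =>
    relations.sub_mem (of_mem_relations_of_isPinned hk hq) (of_mem_relations_of_isPinned hk hq')

/-- For `a ≤ 0` the Beta kernel is not integrable on `(0,1)`: on `(0, 1/2)` it dominates
`m · t⁻¹`, `m = min 1 (1/2)^{b-1} > 0`, and `t⁻¹ ∉ L¹(0, 1/2)` (`intervalIntegrable_inv_iff`).
[folklore] -/
theorem not_integrableOn_abs_betaKernel_of_nonpos_left {a : ℚ} (ha : a ≤ 0) (b : ℚ) :
    ¬ IntegrableOn (fun t => |betaKernel a b t|) (Ioo (0:ℝ) 1) := by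
  intro h
  set m : ℝ := min 1 ((1/2 : ℝ) ^ ((b:ℝ) - 1)) with hm
  have hm0 : 0 < m := lt_min one_pos (Real.rpow_pos_of_pos (by norm_num) _)
  have ha' : (a:ℝ) ≤ 0 := by exact_mod_cast ha
  have hbound : ∀ t ∈ Ioo (0:ℝ) (1/2), t⁻¹ ≤ m⁻¹ * |betaKernel a b t| := by
    intro t ht
    have ht0 : 0 < t := ht.1
    have ht1 : t ≤ 1 := by linarith [ht.2]
    have h1 : t⁻¹ ≤ t ^ ((a:ℝ) - 1) := by
      rw [← Real.rpow_neg_one]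
      exact Real.rpow_le_rpow_of_exponent_ge ht0 ht1 (by linarith)
    have h2 : m ≤ (1 - t) ^ ((b:ℝ) - 1) := by
      rcases le_or_gt 0 ((b:ℝ) - 1) with hb | hb
      · exact (min_le_right _ _).trans (Real.rpow_le_rpow (by norm_num) (by linarith [ht.2]) hb)
      · refine (min_le_left _ _).trans ?_
        have h1t := Real.rpow_le_rpow_of_nonpos (x := 1 - t) (y := 1) (z := (b:ℝ) - 1)
          (by linarith [ht.2]) (by linarith) hb.le
        rwa [Real.one_rpow] at h1t
    have hpos : 0 ≤ t ^ ((a:ℝ) - 1) := Real.rpow_nonneg ht0.le _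
    have hpos' : 0 ≤ (1 - t) ^ ((b:ℝ) - 1) := Real.rpow_nonneg (by linarith [ht.2]) _
    have hk : betaKernel a b t = t ^ ((a:ℝ) - 1) * (1 - t) ^ ((b:ℝ) - 1) := rfl
    rw [hk, abs_of_nonneg (mul_nonneg hpos hpos')]
    have h3 : t⁻¹ * m ≤ t ^ ((a:ℝ) - 1) * (1 - t) ^ ((b:ℝ) - 1) := mul_le_mul h1 h2 hm0.le hpos
    calc t⁻¹ = m⁻¹ * (t⁻¹ * m) := by
          rw [mul_comm t⁻¹ m, ← mul_assoc, inv_mul_cancel₀ hm0.ne', one_mul]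
      _ ≤ m⁻¹ * (t ^ ((a:ℝ) - 1) * (1 - t) ^ ((b:ℝ) - 1)) :=
          mul_le_mul_of_nonneg_left h3 (inv_nonneg.2 hm0.le)
  have hI : IntegrableOn (fun t : ℝ => t⁻¹) (Ioo (0:ℝ) (1/2)) := by
    have h' : IntegrableOn (fun t => m⁻¹ * |betaKernel a b t|) (Ioo (0:ℝ) (1/2)) :=
      (h.mono_set (Ioo_subset_Ioo_right (by norm_num))).const_mul _
    refine h'.mono' measurable_inv.aestronglyMeasurable ?_
    refine ae_restrict_of_forall_mem measurableSet_Ioo fun t ht => ?_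
    rw [Real.norm_eq_abs, abs_of_pos (inv_pos.2 ht.1)]
    exact hbound t ht
  have hII : IntervalIntegrable (fun t : ℝ => t⁻¹) volume 0 (1/2) := by
    rw [intervalIntegrable_iff_integrableOn_Ioo_of_le (by norm_num : (0:ℝ) ≤ 1/2)]
    exact hI
  rcases intervalIntegrable_inv_iff.1 hII with h0 | h0
  · norm_num at h0
  · exact h0 Set.left_mem_uIcc

/-- The Beta kernel under `t ↦ 1 − t`: `k_{a,b}(1−t) = k_{b,a}(t)`. [folklore] -/
theorem betaKernel_one_sub (a b : ℚ) (t : ℝ) : betaKernel a b (1 - t) = betaKernel b a t := by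
  simp only [betaKernel, sub_sub_cancel]
  ring

/-- For `b ≤ 0` the Beta kernel is not integrable on `(0,1)` (reflect `t ↦ 1 − t`, which
preserves Lebesgue measure and `(0,1)`). [folklore] -/
theorem not_integrableOn_abs_betaKernel_of_nonpos_right (a : ℚ) {b : ℚ} (hb : b ≤ 0) :
    ¬ IntegrableOn (fun t => |betaKernel a b t|) (Ioo (0:ℝ) 1) := by
  intro h
  apply not_integrableOn_abs_betaKernel_of_nonpos_left hb a
  have hmp : MeasurePreserving (fun t : ℝ => 1 - t) volume volume :=
    Measure.measurePreserving_sub_left volume 1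
  have hme : MeasurableEmbedding (fun t : ℝ => 1 - t) :=
    (MeasurableEquiv.subLeft (1:ℝ)).measurableEmbedding
  have hpre : (fun t : ℝ => 1 - t) ⁻¹' Ioo (0:ℝ) 1 = Ioo 0 1 := by
    ext t
    simp only [mem_preimage, mem_Ioo]
    constructor <;> rintro ⟨h1, h2⟩ <;> constructor <;> linarith
  have h2 := (hmp.integrableOn_comp_preimage hme).2 h
  rw [hpre] at h2
  refine h2.congr_fun (fun t _ => ?_) measurableSet_Ioo
  simp only [Function.comp_apply, betaKernel_one_sub]

/-- **`BetaCancellation` with `a ≤ 0` HOLDS** (kernel form). [folklore] -/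
theorem kernelCancellation_betaKernel_of_nonpos_left {a : ℚ} (ha : a ≤ 0) (b : ℚ) :
    KernelCancellation (betaKernel a b) :=
  kernelCancellation_of_not_integrableOn (not_integrableOn_abs_betaKernel_of_nonpos_left ha b)

/-- **`BetaCancellation` with `b ≤ 0` HOLDS** (kernel form). [folklore] -/
theorem kernelCancellation_betaKernel_of_nonpos_right (a : ℚ) {b : ℚ} (hb : b ≤ 0) :
    KernelCancellation (betaKernel a b) :=
  kernelCancellation_of_not_integrableOn (not_integrableOn_abs_betaKernel_of_nonpos_right a hb)

/-- **The crux WITHOUT `0 < a`, `0 < b` is equivalent to the crux**: all parameter values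
outside the positive quadrant are settled (true) by Tonelli. [folklore] -/
theorem kernelCancellation_betaKernel_iff :
    (∀ a b : ℚ, KernelCancellation (betaKernel a b)) ↔ BetaCancellation := by
  rw [betaCancellation_iff]
  refine ⟨fun h a b _ _ => h a b, fun h a b => ?_⟩
  rcases le_or_gt a 0 with ha | ha
  · exact kernelCancellation_betaKernel_of_nonpos_left ha b
  rcases le_or_gt b 0 with hb | hb
  · exact kernelCancellation_betaKernel_of_nonpos_right a hb
  · exact h a b ha hb

/-! ## §8 PROVABLE BOUNDARY CASE `a = b = 1` (calibration: the crux is TRUE at the trivial end)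

With the constant kernel a pinned `q` is `[(0,1) × σ, f(tail)]`, which is ONE Newton–Leibniz move
(`KZ.IntegralRep.slab`, primitive `t · f`) plus one coordinate rotation (rule 2, `finAddFlip`)
plus a null boundary away from `r` itself; so `q ∼ r`, and cancellation is transitivity. The same
argument with the polynomial primitive of `t^{A}(1-t)^{B}` and `N · [σ, f/N] ∼ [σ, f]`
(`N = 1/B(A+1,B+1) ∈ ℕ`) proves every INTEGER instance; the open content of the crux is the
non-integer regime, where no semialgebraic primitive of the kernel exists. -/

/-- A coordinate hyperplane `{w | w i = c} ⊆ ℝᵏ` is Lebesgue-null. [folklore] -/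
theorem volume_setOf_apply_eq_zero {k : ℕ} (i : Fin k) (c : ℝ) :
    volume {w : Fin k → ℝ | w i = c} = 0 := by
  rw [volume_pi]
  exact Measure.pi_hyperplane _ _ _

/-- The unit slab over `r` with the slab coordinate FIRST: `[[0,1] × σ, f(tail)]`
(`KZ.IntegralRep.slab r 0` reindexed along `finAddFlip`). [folklore] -/
def slabFirst {n : ℕ} (r : IntegralRep n) : IntegralRep (1 + n) := (r.slab 0).reindex finAddFlip

/-- Pulling back along `finAddFlip`: the initial segment is the tail. [folklore] -/
theorem init_comp_finAddFlip {n : ℕ} (w : Fin (1 + n) → ℝ) :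
    Fin.init (fun i : Fin (n + 1) => w (finAddFlip i)) = fun j => w (Fin.natAdd 1 j) := by
  funext j
  simp only [Fin.init]
  rw [show Fin.castSucc j = Fin.castAdd 1 j from rfl, finAddFlip_apply_castAdd]

/-- `finAddFlip` sends the last coordinate to the head. [folklore] -/
theorem finAddFlip_last (n : ℕ) : finAddFlip (Fin.last n) = Fin.castAdd n (0 : Fin 1) := by
  rw [show Fin.last n = Fin.natAdd n (0 : Fin 1) from Fin.ext (by simp), finAddFlip_apply_natAdd]

/-- The domain of `slabFirst r`. [folklore] -/
theorem slabFirst_domain {n : ℕ} (r : IntegralRep n) :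
    (slabFirst r).domain = {w | (fun j => w (Fin.natAdd 1 j)) ∈ r.domain ∧
      0 ≤ w (Fin.castAdd n 0) ∧ w (Fin.castAdd n 0) ≤ 1} := by
  ext w
  simp only [slabFirst, IntegralRep.reindex_domain, IntegralRep.domain_slab,
    IntegralRep.slabDomain, mem_setOf_eq, init_comp_finAddFlip, finAddFlip_last, Nat.cast_zero,
    zero_add]

/-- The integrand of `slabFirst r` is `f(tail)`. [folklore] -/
theorem slabFirst_integrand {n : ℕ} (r : IntegralRep n) (w : Fin (1 + n) → ℝ) :
    (slabFirst r).integrand w = r.integrand (fun j => w (Fin.natAdd 1 j)) := by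
  simp only [slabFirst, IntegralRep.reindex_integrand, IntegralRep.integrand_slab,
    init_comp_finAddFlip]

/-- `r ∼ slabFirst r` (one Newton–Leibniz move and one coordinate rotation). [folklore] -/
theorem equivalent_slabFirst {n : ℕ} (r : IntegralRep n) : Equivalent r (slabFirst r) :=
  (r.equivalent_slab 0).trans (of_sub_of_reindex_mem_relations (r.slab 0) finAddFlip)

/-- **A representation pinned with the constant kernel `1` is equivalent to its base.**
[folklore] -/
theorem equivalent_of_isPinned_one {n : ℕ} {r : IntegralRep n} {q : IntegralRep (1 + n)}
    (hq : IsPinned (fun _ => (1:ℝ)) r q) : Equivalent q r := by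
  obtain ⟨hd, hi⟩ := hq
  have hE : IsSemialgebraic ℚ (pinDomain r.domain) := hd ▸ q.isSemialgebraic_domain
  have hEsub : pinDomain r.domain ⊆ (slabFirst r).domain := by
    intro w hw
    rw [slabFirst_domain]
    exact ⟨hw.2, hw.1.1.le, hw.1.2.le⟩
  have hvol : volume ((slabFirst r).domain \ pinDomain r.domain) = 0 := by
    refine measure_mono_null (fun w hw => ?_)
      (measure_union_null (volume_setOf_apply_eq_zero (Fin.castAdd n 0) 0)
        (volume_setOf_apply_eq_zero (Fin.castAdd n 0) 1))
    rw [slabFirst_domain] at hw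
    obtain ⟨⟨hσ, h0, h1⟩, hno⟩ := hw
    by_contra hc
    simp only [mem_union, mem_setOf_eq, not_or] at hc
    exact hno ⟨⟨lt_of_le_of_ne h0 (Ne.symm hc.1), lt_of_le_of_ne h1 hc.2⟩, hσ⟩
  have h1 := (slabFirst r).of_sub_of_restrict_mem_relations hE hEsub hvol
  have h2 : of ((slabFirst r).restrict _ hE hEsub) - of q ∈ relations := by
    refine of_sub_of_mem_relations_of_eqOn hd fun w hw => ?_
    simp only [IntegralRep.integrand_restrict, IntegralRep.domain_restrict] at hw ⊢
    rw [hi (hd ▸ hw), slabFirst_integrand]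
    simp [pinFun]
  have h3 : of r - of (slabFirst r) ∈ relations := equivalent_slabFirst r
  have : of r - of q = (of r - of (slabFirst r)) +
      (of (slabFirst r) - of ((slabFirst r).restrict _ hE hEsub)) +
      (of ((slabFirst r).restrict _ hE hEsub) - of q) := by abel
  apply Equivalent.symm
  show of r - of q ∈ relations
  rw [this]
  exact relations.add_mem (relations.add_mem h3 h1) h2

/-- **Cancellation by the constant kernel holds** (transitivity through the bases). [folklore] -/
theorem kernelCancellation_one : KernelCancellation (fun _ => (1:ℝ)) :=
  fun _ _ _ _ _ _ hq hq' hqq' =>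
    ((equivalent_of_isPinned_one hq).symm.trans hqq').trans (equivalent_of_isPinned_one hq')

/-- **`BetaCancellation` holds at `a = b = 1`** (kernel form). [folklore] -/
theorem kernelCancellation_betaKernel_one_one : KernelCancellation (betaKernel 1 1) := by
  rw [betaKernel_one_one]
  exact kernelCancellation_one

/-- **`BetaCancellation` holds at `a = b = 1`**, in the crux's literal shape. [folklore] -/
theorem betaCancellation_one_one :
    ∀ ⦃n m : ℕ⦄ (r : IntegralRep n) (r' : IntegralRep m) (q : IntegralRep (1 + n))
      (q' : IntegralRep (1 + m)),
    q.domain = {z | z (Fin.castAdd n 0) ∈ Set.Ioo (0:ℝ) 1 ∧ (fun j => z (Fin.natAdd 1 j)) ∈ r.domain} →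
    Set.EqOn q.integrand (fun z => (z (Fin.castAdd n 0)) ^ (((1:ℚ):ℝ) - 1) *
      (1 - z (Fin.castAdd n 0)) ^ (((1:ℚ):ℝ) - 1) * r.integrand (fun j => z (Fin.natAdd 1 j))) q.domain →
    q'.domain = {z | z (Fin.castAdd m 0) ∈ Set.Ioo (0:ℝ) 1 ∧ (fun j => z (Fin.natAdd 1 j)) ∈ r'.domain} →
    Set.EqOn q'.integrand (fun z => (z (Fin.castAdd m 0)) ^ (((1:ℚ):ℝ) - 1) *
      (1 - z (Fin.castAdd m 0)) ^ (((1:ℚ):ℝ) - 1) * r'.integrand (fun j => z (Fin.natAdd 1 j))) q'.domain →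
    Equivalent q q' → Equivalent r r' :=
  fun _ _ r r' q q' hd hi hd' hi' hqq' =>
    kernelCancellation_betaKernel_one_one r r' q q' ⟨hd, hi⟩ ⟨hd', hi'⟩ hqq'

/-! ## §9 WHY IT RESISTS, II: `BetaCancellation → KZ.PiCancellation`

The instance `a = b = 1/2` of the crux is cancellation by the class `[β(1/2,1/2)] =
[(0,1), (t(1-t))^{-1/2}]`, and `[β(1/2,1/2)] ∼ [π] = [{x²+y² ≤ 1}, 1]` by FOUR moves of the calculus
(§9.3–9.5: the affine substitution `t = (1+x)/2`, rule 2; Kontsevich–Zagier's own §1.1 step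
`∫ dx/√(1-x²) = ∫ 2√(1-x²) dx`, one Newton–Leibniz move with primitive `−x√(1−x²)` plus integrand
additivity; and `∫ 2√(1−x²) dx = ∬_{disc} 1`, one Newton–Leibniz move along `y`). Hence
`BetaCancellation` implies `KZ.PiCancellation` (`KZProduct.lean`; the open crux
stmt-KontsevichZagierPeriods-0540 of route AyoubSpecialisation, whose motivic shadow — injectivity
of effective into `2πi`-localised formal periods — is an open question, Huber–Wüstholz 2022 App. A). -/

/-! ### §9.1 The kernel at `a = b = 1/2` -/

/-- `t^{-1/2} (1-t)^{-1/2} = 1/√(t(1-t))` on `[0,1]`. [folklore] -/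
theorem betaKernel_half_half {s : ℝ} (hs : 0 ≤ s) (hs' : s ≤ 1) :
    betaKernel (1/2) (1/2) s = (√(s * (1 - s)))⁻¹ := by
  have he : ((1/2 : ℚ) : ℝ) - 1 = -(1/2 : ℝ) := by push_cast; ring
  simp only [betaKernel, he]
  rw [Real.rpow_neg hs, Real.rpow_neg (by linarith), ← Real.sqrt_eq_rpow, ← Real.sqrt_eq_rpow,
    ← mul_inv, ← Real.sqrt_mul hs]

/-- After `t = (1+x)/2`: `β-kernel((1+x)/2) · (1/2) = 1/√(1-x²)` on `[-1,1]`. [folklore] -/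
theorem betaKernel_half_affine {t : ℝ} (ht : t ∈ Icc (-1:ℝ) 1) :
    betaKernel (1/2) (1/2) ((1 + t) / 2) * (1/2) = (√(1 - t ^ 2))⁻¹ := by
  rw [betaKernel_half_half (by linarith [ht.1]) (by linarith [ht.2])]
  have h : (1 + t) / 2 * (1 - (1 + t) / 2) = (1 - t ^ 2) / 4 := by ring
  have h4 : √(4:ℝ) = 2 := by
    rw [show (4:ℝ) = 2 ^ 2 by norm_num, Real.sqrt_sq (by norm_num)]
  rw [h, Real.sqrt_div' _ (by norm_num : (0:ℝ) ≤ 4), h4, inv_div]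
  ring

/-- Semialgebraicity of `1/√P` on `{P > 0}`: it is `√P · (1/P)` there. [folklore] -/
theorem isSemialgebraicFunOn_of_eqOn_inv_sqrt {m : ℕ} {s : Set (Fin m → ℝ)}
    (hs : IsSemialgebraic ℚ s) (P : MvPolynomial (Fin m) ℚ) (hP : ∀ x ∈ s, 0 < aeval x P)
    {f : (Fin m → ℝ) → ℝ} (hf : ∀ x ∈ s, f x = (√(aeval x P))⁻¹) : IsSemialgebraicFunOn ℚ s f := by
  have h1 : IsSemialgebraicFunOn ℚ s (fun x => √(aeval x P)) :=
    IsSemialgebraicFunOn.sqrt_holds (isSemialgebraicFunOn_aeval hs P)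
  have h2 : IsSemialgebraicFunOn ℚ s (fun x => aeval x (1 : MvPolynomial (Fin m) ℚ) / aeval x P) :=
    isSemialgebraicFunOn_aeval_div_aeval hs 1 P fun x hx => (hP x hx).ne'
  refine (IsSemialgebraicFunOn.mul_holds h1 h2).congr fun x hx => ?_
  have hp := hP x hx
  have hsq : √(aeval x P) * √(aeval x P) = aeval x P := Real.mul_self_sqrt hp.le
  have hne : √(aeval x P) ≠ 0 := (Real.sqrt_pos.2 hp).ne'
  rw [hf x hx, Pi.mul_apply, map_one, one_div]
  calc √(aeval x P) * (aeval x P)⁻¹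
      = √(aeval x P) * (√(aeval x P) * √(aeval x P))⁻¹ := by rw [hsq]
    _ = (√(aeval x P))⁻¹ := by rw [mul_inv, ← mul_assoc, mul_inv_cancel₀ hne, one_mul]

/-- **`[β(1/2,1/2)] = [(0,1), t^{-1/2}(1-t)^{-1/2}]`**, the Beta representation of `π` in the
crux's pinned shape. [folklore] -/
def betaHalfRep : IntegralRep 1 where
  domain := unitIoo
  integrand := fun x => betaKernel (1/2) (1/2) (x 0)
  isSemialgebraic_domain := isSemialgebraic_unitIoo
  isSemialgebraicFunOn_integrand := by
    refine isSemialgebraicFunOn_of_eqOn_inv_sqrt isSemialgebraic_unitIoo (X 0 * (1 - X 0))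
      (fun x hx => ?_) (fun x hx => ?_)
    · simp only [mem_unitIoo, mem_Ioo] at hx
      simp only [map_mul, map_sub, map_one, MvPolynomial.aeval_X]
      exact mul_pos hx.1 (by linarith)
    · simp only [mem_unitIoo, mem_Ioo] at hx
      simp only [map_mul, map_sub, map_one, MvPolynomial.aeval_X]
      exact betaKernel_half_half hx.1.le hx.2.le
  integrableOn := integrableOn_comp_apply_zero_iff.2
    (integrableOn_betaKernel_and_integral_eq (a := 1/2) (b := 1/2) (by norm_num) (by norm_num)).1

/-- The domain of `betaHalfRep`. [folklore] -/
@[simp] theorem betaHalfRep_domain : betaHalfRep.domain = unitIoo := rfl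

/-- The integrand of `betaHalfRep`. [folklore] -/
@[simp] theorem betaHalfRep_integrand :
    betaHalfRep.integrand = fun x => betaKernel (1/2) (1/2) (x 0) := rfl

/-! ### §9.2 The intervals `(-1,1)`, `[-1,1] ⊆ ℝ¹` -/

/-- `(-1,1) ⊆ ℝ¹`. [folklore] -/
def symIoo : Set (Fin 1 → ℝ) := {x | x 0 ∈ Ioo (-1:ℝ) 1}

/-- `[-1,1] ⊆ ℝ¹`. [folklore] -/
def symIcc : Set (Fin 1 → ℝ) := {x | x 0 ∈ Icc (-1:ℝ) 1}

/-- Membership in `symIoo`. [folklore] -/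
@[simp] theorem mem_symIoo (x : Fin 1 → ℝ) : x ∈ symIoo ↔ x 0 ∈ Ioo (-1:ℝ) 1 := Iff.rfl

/-- Membership in `symIcc`. [folklore] -/
@[simp] theorem mem_symIcc (x : Fin 1 → ℝ) : x ∈ symIcc ↔ x 0 ∈ Icc (-1:ℝ) 1 := Iff.rfl

/-- `(-1,1)` is `ℚ`-semialgebraic. [folklore] -/
theorem isSemialgebraic_symIoo : IsSemialgebraic ℚ symIoo := by
  have h1 := Literature.ModelTheory.ExponentialFields.isSemialgebraic_setOf_eval_lt (k := ℚ) (R := ℝ)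
    (-1 : MvPolynomial (Fin 1) ℚ) (X 0)
  have h2 := Literature.ModelTheory.ExponentialFields.isSemialgebraic_setOf_eval_lt (k := ℚ) (R := ℝ)
    (X 0 : MvPolynomial (Fin 1) ℚ) 1
  have h := h1.inter h2
  simp only [map_neg, map_one, MvPolynomial.aeval_X] at h
  have hset : symIoo = {x : Fin 1 → ℝ | -1 < x 0} ∩ {x | x 0 < 1} := by
    ext x
    simp [symIoo]
  rw [hset]
  exact h

/-- `[-1,1]` is `ℚ`-semialgebraic. [folklore] -/
theorem isSemialgebraic_symIcc : IsSemialgebraic ℚ symIcc := by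
  have h1 := Literature.ModelTheory.ExponentialFields.isSemialgebraic_setOf_eval_le (k := ℚ) (R := ℝ)
    (-1 : MvPolynomial (Fin 1) ℚ) (X 0)
  have h2 := Literature.ModelTheory.ExponentialFields.isSemialgebraic_setOf_eval_le (k := ℚ) (R := ℝ)
    (X 0 : MvPolynomial (Fin 1) ℚ) 1
  have h := h1.inter h2
  simp only [map_neg, map_one, MvPolynomial.aeval_X] at h
  have hset : symIcc = {x : Fin 1 → ℝ | -1 ≤ x 0} ∩ {x | x 0 ≤ 1} := by
    ext x
    simp [symIcc]
  rw [hset]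
  exact h

/-- `(-1,1) ⊆ [-1,1]`. [folklore] -/
theorem symIoo_subset_symIcc : symIoo ⊆ symIcc := fun _ hx => Ioo_subset_Icc_self hx

/-- `[-1,1] ∖ (-1,1)` is null (two hyperplanes). [folklore] -/
theorem volume_symIcc_diff_symIoo : volume (symIcc \ symIoo) = 0 := by
  refine measure_mono_null (fun x hx => ?_)
    (measure_union_null (volume_setOf_apply_eq_zero (0 : Fin 1) (-1))
      (volume_setOf_apply_eq_zero (0 : Fin 1) 1))
  simp only [mem_sdiff, mem_symIcc, mem_Icc, mem_symIoo, mem_Ioo, not_and, not_lt] at hx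
  simp only [mem_union, mem_setOf_eq]
  obtain ⟨⟨h1, h2⟩, h3⟩ := hx
  rcases h1.lt_or_eq with h1 | h1
  · exact Or.inr (le_antisymm h2 (h3 h1))
  · exact Or.inl h1.symm

/-- `[-1,1] ⊆ ℝ¹` is the closed box. [folklore] -/
theorem symIcc_eq_pi : symIcc = Set.pi univ fun _ : Fin 1 => Icc (-1:ℝ) 1 := by
  ext x
  simp only [symIcc, mem_setOf_eq, mem_univ_pi, Fin.forall_fin_one]

/-- Continuous functions are integrable on `[-1,1] ⊆ ℝ¹`. [folklore] -/
theorem integrableOn_symIcc_of_continuous {f : (Fin 1 → ℝ) → ℝ} (hf : Continuous f) :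
    IntegrableOn f symIcc := by
  rw [symIcc_eq_pi]
  exact hf.continuousOn.integrableOn_compact (isCompact_univ_pi fun _ => isCompact_Icc)

/-- Continuous functions are integrable on `(-1,1) ⊆ ℝ¹`. [folklore] -/
theorem integrableOn_symIoo_of_continuous {f : (Fin 1 → ℝ) → ℝ} (hf : Continuous f) :
    IntegrableOn f symIoo :=
  (integrableOn_symIcc_of_continuous hf).mono_set symIoo_subset_symIcc

/-! ### §9.3 Move 1 (rule 2): the affine substitution `t = (1 + x)/2` -/

/-- The affine map `x ↦ (1 + x)/2` of `ℝ¹`. [folklore] -/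
def halfAffine (x : Fin 1 → ℝ) : Fin 1 → ℝ := fun _ => (1 + x 0) / 2

/-- Its derivative, `(1/2) · id`. [folklore] -/
def halfAffineDeriv : (Fin 1 → ℝ) →L[ℝ] (Fin 1 → ℝ) := (1/2 : ℝ) • ContinuousLinearMap.id ℝ _

/-- `halfAffine` is `(1/2) · id + 1/2`. [folklore] -/
theorem halfAffine_eq (x : Fin 1 → ℝ) : halfAffine x = halfAffineDeriv x + fun _ => (1/2 : ℝ) := by
  funext i
  obtain rfl : i = 0 := Fin.fin_one_eq_zero i
  simp [halfAffine, halfAffineDeriv]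
  ring

/-- `halfAffine` has derivative `(1/2) · id`. [folklore] -/
theorem hasFDerivAt_halfAffine (x : Fin 1 → ℝ) : HasFDerivAt halfAffine halfAffineDeriv x := by
  have : halfAffine = fun x => halfAffineDeriv x + fun _ => (1/2 : ℝ) := funext halfAffine_eq
  rw [this]
  exact halfAffineDeriv.hasFDerivAt.add_const _

/-- `|det ((1/2) · id_{ℝ¹})| = 1/2`. [folklore] -/
theorem abs_det_halfAffineDeriv : |halfAffineDeriv.det| = 1/2 := by
  have : halfAffineDeriv.det = 1/2 := by
    change LinearMap.det ((halfAffineDeriv : (Fin 1 → ℝ) →L[ℝ] (Fin 1 → ℝ)) :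
      (Fin 1 → ℝ) →ₗ[ℝ] (Fin 1 → ℝ)) = 1/2
    rw [halfAffineDeriv, ContinuousLinearMap.toLinearMap_smul, ContinuousLinearMap.coe_id,
      LinearMap.det_smul, LinearMap.det_id, Module.finrank_fin_fun]
    norm_num
  rw [this]
  norm_num

/-- `halfAffine` is injective. [folklore] -/
theorem injective_halfAffine : Function.Injective halfAffine := by
  intro x y h
  have h0 := congrFun h 0
  simp only [halfAffine] at h0
  funext i
  obtain rfl : i = 0 := Fin.fin_one_eq_zero i
  linarith

/-- `halfAffine` maps `(-1,1)` onto `(0,1)`. [folklore] -/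
theorem image_halfAffine_symIoo : halfAffine '' symIoo = unitIoo := by
  ext y
  constructor
  · rintro ⟨x, hx, rfl⟩
    simp only [mem_symIoo, mem_Ioo] at hx
    simp only [mem_unitIoo, halfAffine, mem_Ioo]
    constructor <;> linarith
  · intro hy
    simp only [mem_unitIoo, mem_Ioo] at hy
    refine ⟨fun _ => 2 * y 0 - 1, ?_, ?_⟩
    · simp only [mem_symIoo, mem_Ioo]
      constructor <;> linarith
    · funext i
      obtain rfl : i = 0 := Fin.fin_one_eq_zero i
      simp only [halfAffine]
      ring

/-- `halfAffine` is a `ℚ`-polynomial map. [folklore] -/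
theorem isSemialgebraicMapOn_halfAffine : IsSemialgebraicMapOn ℚ symIoo halfAffine := by
  convert isSemialgebraicMapOn_aeval isSemialgebraic_symIoo
    (fun _ : Fin 1 => (C (1/2 : ℚ) * (1 + X 0) : MvPolynomial (Fin 1) ℚ)) using 2 with x
  funext i
  simp only [halfAffine, map_mul, map_add, map_one, MvPolynomial.aeval_C, MvPolynomial.aeval_X,
    eq_ratCast]
  push_cast
  ring

/-- **`[(-1,1), 1/√(1-x²)]`**, written as the pull-back of `betaHalfRep` along `halfAffine`
(integrand `β-kernel((1+x)/2) · |det| = 1/√(1−x²)`). [folklore] -/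
def invSqrtRep : IntegralRep 1 where
  domain := symIoo
  integrand := fun x => betaKernel (1/2) (1/2) ((1 + x 0) / 2) * (1/2)
  isSemialgebraic_domain := isSemialgebraic_symIoo
  isSemialgebraicFunOn_integrand := by
    refine isSemialgebraicFunOn_of_eqOn_inv_sqrt isSemialgebraic_symIoo (1 - X 0 ^ 2)
      (fun x hx => ?_) (fun x hx => ?_)
    · simp only [mem_symIoo, mem_Ioo] at hx
      simp only [map_sub, map_one, map_pow, MvPolynomial.aeval_X]
      nlinarith
    · simp only [map_sub, map_one, map_pow, MvPolynomial.aeval_X]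
      exact betaKernel_half_affine (Ioo_subset_Icc_self hx)
  integrableOn := by
    have hmeas : MeasurableSet symIoo :=
      Literature.ModelTheory.ExponentialFields.IsSemialgebraic.measurableSet_holds
        isSemialgebraic_symIoo
    have key := (integrableOn_image_iff_integrableOn_abs_det_fderiv_smul volume hmeas
      (f' := fun _ => halfAffineDeriv) (fun x _ => (hasFDerivAt_halfAffine x).hasFDerivWithinAt)
      injective_halfAffine.injOn (fun x : Fin 1 → ℝ => betaKernel (1/2) (1/2) (x 0))).1
      (by rw [image_halfAffine_symIoo]; exact betaHalfRep.integrableOn)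
    refine key.congr_fun (fun x _ => ?_) hmeas
    simp only [abs_det_halfAffineDeriv, halfAffine, smul_eq_mul]
    ring

/-- The domain of `invSqrtRep`. [folklore] -/
@[simp] theorem invSqrtRep_domain : invSqrtRep.domain = symIoo := rfl

/-- The integrand of `invSqrtRep` (literal). [folklore] -/
theorem invSqrtRep_integrand :
    invSqrtRep.integrand = fun x => betaKernel (1/2) (1/2) ((1 + x 0) / 2) * (1/2) := rfl

/-- The integrand of `invSqrtRep` is `1/√(1-x²)` on `(-1,1)`. [folklore] -/
theorem invSqrtRep_integrand_eq {x : Fin 1 → ℝ} (hx : x ∈ symIoo) :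
    invSqrtRep.integrand x = (√(1 - x 0 ^ 2))⁻¹ :=
  betaKernel_half_affine (Ioo_subset_Icc_self hx)

/-- **Move 1**: `[(-1,1), 1/√(1-x²)] − [β(1/2,1/2)]` is ONE change-of-variables move. [folklore] -/
theorem invSqrtRep_sub_betaHalfRep_mem : of invSqrtRep - of betaHalfRep ∈ changeOfVariablesRel :=
  ⟨1, invSqrtRep, betaHalfRep, halfAffine, fun _ => halfAffineDeriv, isSemialgebraicMapOn_halfAffine,
    fun x _ => (hasFDerivAt_halfAffine x).hasFDerivWithinAt, injective_halfAffine.injOn,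
    image_halfAffine_symIoo.symm, fun x _ => by rw [abs_det_halfAffineDeriv]; rfl, rfl⟩

/-! ### §9.4 Moves 2–3 (rule 3, rule 1): KZ's §1.1 step `∫ dx/√(1−x²) = ∫ 2√(1−x²) dx` -/

/-- **`[(-1,1), 2√(1-x²)]`**. [cite: KontsevichZagier2001, §1.1] -/
def twoSqrtRep : IntegralRep 1 where
  domain := symIoo
  integrand := fun x => 2 * √(1 - x 0 ^ 2)
  isSemialgebraic_domain := isSemialgebraic_symIoo
  isSemialgebraicFunOn_integrand := by
    have h1 : IsSemialgebraicFunOn ℚ symIoo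
        (fun x => √(aeval x (1 - X 0 ^ 2 : MvPolynomial (Fin 1) ℚ))) :=
      IsSemialgebraicFunOn.sqrt_holds (isSemialgebraicFunOn_aeval isSemialgebraic_symIoo _)
    refine (IsSemialgebraicFunOn.mul_holds (isSemialgebraicFunOn_natCast isSemialgebraic_symIoo 2)
      h1).congr fun x _ => ?_
    simp only [Pi.mul_apply, map_sub, map_one, map_pow, MvPolynomial.aeval_X, Nat.cast_ofNat]
  integrableOn := integrableOn_symIoo_of_continuous (by fun_prop)

/-- The domain of `twoSqrtRep`. [folklore] -/
@[simp] theorem twoSqrtRep_domain : twoSqrtRep.domain = symIoo := rfl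

/-- The integrand of `twoSqrtRep`. [folklore] -/
@[simp] theorem twoSqrtRep_integrand : twoSqrtRep.integrand = fun x => 2 * √(1 - x 0 ^ 2) := rfl

/-- `1/√u − 2√u = (2x² − 1)/√u` when `u = 1 − x² > 0`. [folklore] -/
theorem inv_sqrt_sub_two_sqrt {u x2 : ℝ} (hu : 0 < u) (hx : u = 1 - x2) :
    (√u)⁻¹ - 2 * √u = (2 * x2 - 1) * (√u)⁻¹ := by
  have hs : √u ≠ 0 := (Real.sqrt_pos.2 hu).ne'
  have hsq : √u * √u = u := Real.mul_self_sqrt hu.le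
  calc (√u)⁻¹ - 2 * √u = (√u)⁻¹ - 2 * √u * (√u * (√u)⁻¹) := by rw [mul_inv_cancel₀ hs, mul_one]
    _ = (1 - 2 * (√u * √u)) * (√u)⁻¹ := by ring
    _ = (2 * x2 - 1) * (√u)⁻¹ := by rw [hsq, hx]; ring

/-- `d/dt (−t√(1−t²)) = (2t²−1)/√(1−t²)` on `(−1,1)`. [folklore] -/
theorem hasDerivAt_neg_mul_sqrt {t : ℝ} (ht : t ∈ Ioo (-1:ℝ) 1) :
    HasDerivAt (fun s : ℝ => -s * √(1 - s ^ 2)) ((2 * t ^ 2 - 1) * (√(1 - t ^ 2))⁻¹) t := by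
  have hu : HasDerivAt (fun s : ℝ => 1 - s ^ 2) (-(2 * t)) t := by
    simpa using ((hasDerivAt_pow 2 t).const_sub 1)
  have hpos : 0 < 1 - t ^ 2 := by nlinarith [ht.1, ht.2]
  have hs := hu.sqrt hpos.ne'
  have hF := (hasDerivAt_id' t).neg.mul hs
  refine hF.congr_deriv ?_
  have hs0 : √(1 - t ^ 2) ≠ 0 := (Real.sqrt_pos.2 hpos).ne'
  have hsq : √(1 - t ^ 2) * √(1 - t ^ 2) = 1 - t ^ 2 := Real.mul_self_sqrt hpos.le
  calc -1 * √(1 - t ^ 2) + -t * (-(2 * t) / (2 * √(1 - t ^ 2)))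
        = -√(1 - t ^ 2) * (√(1 - t ^ 2) * (√(1 - t ^ 2))⁻¹) + t ^ 2 * (√(1 - t ^ 2))⁻¹ := by
        rw [mul_inv_cancel₀ hs0]; ring
    _ = (-(√(1 - t ^ 2) * √(1 - t ^ 2)) + t ^ 2) * (√(1 - t ^ 2))⁻¹ := by ring
    _ = (2 * t ^ 2 - 1) * (√(1 - t ^ 2))⁻¹ := by rw [hsq]; ring

/-- **`[[-1,1], (2x²−1)/√(1−x²)]`**: the derivative of the primitive `−x√(1−x²)` on the CLOSED
band of the Newton–Leibniz move (junk value `0` at `x = ±1`, where `(√0)⁻¹ = 0`). [folklore] -/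
def derivRep : IntegralRep 1 where
  domain := symIcc
  integrand := fun x => (2 * x 0 ^ 2 - 1) * (√(1 - x 0 ^ 2))⁻¹
  isSemialgebraic_domain := isSemialgebraic_symIcc
  isSemialgebraicFunOn_integrand := by
    have hE : IsSemialgebraic ℚ (symIcc \ symIoo) := isSemialgebraic_symIcc.diff isSemialgebraic_symIoo
    have h1 : IsSemialgebraicFunOn ℚ symIoo (fun x => (2 * x 0 ^ 2 - 1) * (√(1 - x 0 ^ 2))⁻¹) := by
      have ha : IsSemialgebraicFunOn ℚ symIoo (fun x : Fin 1 → ℝ => 2 * x 0 ^ 2 - 1) :=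
        (isSemialgebraicFunOn_aeval isSemialgebraic_symIoo (2 * X 0 ^ 2 - 1)).congr fun x _ => by
          simp
      have hb : IsSemialgebraicFunOn ℚ symIoo (fun x : Fin 1 → ℝ => (√(1 - x 0 ^ 2))⁻¹) :=
        isSemialgebraicFunOn_of_eqOn_inv_sqrt isSemialgebraic_symIoo (1 - X 0 ^ 2)
          (fun x hx => by
            simp only [mem_symIoo, mem_Ioo] at hx
            simp only [map_sub, map_one, map_pow, MvPolynomial.aeval_X]
            nlinarith)
          (fun x _ => by simp)
      exact IsSemialgebraicFunOn.mul_holds ha hb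
    have h2 : IsSemialgebraicFunOn ℚ (symIcc \ symIoo) (fun _ => (0:ℝ)) :=
      (isSemialgebraicFunOn_aeval hE 0).congr fun x _ => by simp
    have hU : symIcc = symIoo ∪ (symIcc \ symIoo) := by
      ext x
      simp only [mem_union, mem_sdiff]
      constructor
      · intro h
        by_cases h' : x ∈ symIoo
        · exact Or.inl h'
        · exact Or.inr ⟨h, h'⟩
      · rintro (h | h)
        · exact symIoo_subset_symIcc h
        · exact h.1
    rw [hU]
    refine IsSemialgebraicFunOn.union h1 h2 (fun x _ => rfl) (fun x hx => ?_)
    simp only [mem_sdiff, mem_symIcc, mem_Icc, mem_symIoo, mem_Ioo, not_and, not_lt] at hx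
    obtain ⟨⟨h1', h2'⟩, h3⟩ := hx
    have hx0 : x 0 ^ 2 = 1 := by
      rcases h1'.lt_or_eq with h | h
      · rw [le_antisymm h2' (h3 h)]; norm_num
      · rw [← h]; norm_num
    simp [hx0]
  integrableOn := by
    have hmeas : MeasurableSet symIoo :=
      Literature.ModelTheory.ExponentialFields.IsSemialgebraic.measurableSet_holds
        isSemialgebraic_symIoo
    have h1 : IntegrableOn (fun x : Fin 1 → ℝ => (2 * x 0 ^ 2 - 1) * (√(1 - x 0 ^ 2))⁻¹) symIoo := by
      refine (invSqrtRep.integrableOn.sub twoSqrtRep.integrableOn).congr_fun (fun x hx => ?_) hmeas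
      have hx' : x ∈ symIoo := hx
      rw [Pi.sub_apply, invSqrtRep_integrand_eq hx', twoSqrtRep_integrand]
      simp only [mem_symIoo, mem_Ioo] at hx'
      exact inv_sqrt_sub_two_sqrt (by nlinarith) rfl
    refine h1.congr_set_ae (ae_eq_set.2 ⟨volume_symIcc_diff_symIoo, ?_⟩)
    exact measure_mono_null (fun x hx => (hx.2 (symIoo_subset_symIcc hx.1)).elim) measure_empty

/-- The domain of `derivRep`. [folklore] -/
@[simp] theorem derivRep_domain : derivRep.domain = symIcc := rfl

/-- The integrand of `derivRep`. [folklore] -/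
@[simp] theorem derivRep_integrand :
    derivRep.integrand = fun x => (2 * x 0 ^ 2 - 1) * (√(1 - x 0 ^ 2))⁻¹ := rfl

/-- The zero representation on the point `ℝ⁰`. [folklore] -/
def zeroRep0 : IntegralRep 0 where
  domain := univ
  integrand := 0
  isSemialgebraic_domain := isSemialgebraic_univ
  isSemialgebraicFunOn_integrand :=
    (isSemialgebraicFunOn_aeval isSemialgebraic_univ 0).congr fun x _ => by simp
  integrableOn := integrableOn_zero

/-- `[pt, 0]` is a relation. [folklore] -/
theorem of_zeroRep0_mem_relations : of zeroRep0 ∈ relations :=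
  of_mem_relations_of_eqOn_zero zeroRep0 fun _ _ => rfl

/-- **Move 2 (rule 3)**: `[[-1,1], (2x²−1)/√(1−x²)] − [pt, 0]` is ONE Newton–Leibniz move with
primitive `F(x) = −x√(1−x²)` (continuous on `[−1,1]`, differentiable inside, `F(±1) = 0`).
[cite: KontsevichZagier2001, §1.1] -/
theorem derivRep_sub_zeroRep0_mem : of derivRep - of zeroRep0 ∈ newtonLeibnizRel := by
  refine ⟨0, derivRep, zeroRep0, fun _ => (-1:ℝ), fun _ => (1:ℝ),
    fun z => -z (Fin.last 0) * √(1 - z (Fin.last 0) ^ 2), ?_, ?_, ?_, fun _ _ => by norm_num,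
    ?_, ?_, ?_, ?_, rfl⟩
  · have ha : IsSemialgebraicFunOn ℚ symIcc (fun z : Fin 1 → ℝ => -z (Fin.last 0)) :=
      (isSemialgebraicFunOn_aeval isSemialgebraic_symIcc (-X (Fin.last 0))).congr fun z _ => by
        simp
    have hb : IsSemialgebraicFunOn ℚ symIcc (fun z : Fin 1 → ℝ => √(1 - z (Fin.last 0) ^ 2)) :=
      (IsSemialgebraicFunOn.sqrt_holds (isSemialgebraicFunOn_aeval isSemialgebraic_symIcc
        (1 - X (Fin.last 0) ^ 2))).congr fun z _ => by simp
    exact IsSemialgebraicFunOn.mul_holds ha hb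
  · exact (isSemialgebraicFunOn_aeval isSemialgebraic_univ (-1 : MvPolynomial (Fin 0) ℚ)).congr
      fun x _ => by simp
  · exact (isSemialgebraicFunOn_aeval isSemialgebraic_univ (1 : MvPolynomial (Fin 0) ℚ)).congr
      fun x _ => by simp
  · ext z
    simp only [derivRep_domain, mem_setOf_eq, zeroRep0, mem_univ, true_and]
    rfl
  · intro x _
    simp only [Fin.snoc_last]
    exact (by fun_prop : Continuous fun t : ℝ => -t * √(1 - t ^ 2)).continuousOn
  · intro x _ t ht
    simp only [Fin.snoc_last, derivRep_integrand]
    rw [show (0 : Fin 1) = Fin.last 0 from rfl, Fin.snoc_last]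
    exact hasDerivAt_neg_mul_sqrt ht
  · intro x _
    have e : ∀ s : ℝ, (Fin.snoc x s : Fin 1 → ℝ) 0 = s := fun s => by
      rw [show (0 : Fin 1) = Fin.last 0 from rfl, Fin.snoc_last]
    simp [zeroRep0, e]

/-- `[(-1,1), (2x²−1)/√(1−x²)]` (the open restriction of `derivRep`) is a relation. [folklore] -/
theorem of_derivRep_restrict_mem_relations :
    of (derivRep.restrict symIoo isSemialgebraic_symIoo symIoo_subset_symIcc) ∈ relations := by
  have h1 : of derivRep - of (derivRep.restrict symIoo isSemialgebraic_symIoo symIoo_subset_symIcc)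
      ∈ relations :=
    derivRep.of_sub_of_restrict_mem_relations isSemialgebraic_symIoo symIoo_subset_symIcc
      volume_symIcc_diff_symIoo
  have h2 : of derivRep ∈ relations := by
    have := relations.add_mem (newtonLeibnizRel_subset_relations derivRep_sub_zeroRep0_mem)
      of_zeroRep0_mem_relations
    simpa using this
  have := relations.sub_mem h2 h1
  simpa using this

/-- **Move 3 (rule 1)**: `[(-1,1), 1/√(1−x²)] − [(-1,1), 2√(1−x²)] − [(-1,1), (2x²−1)/√(1−x²)]`
is ONE integrand-additivity move. [cite: KontsevichZagier2001, §1.1] -/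
theorem invSqrtRep_sub_twoSqrtRep_sub_mem :
    of invSqrtRep - of twoSqrtRep -
      of (derivRep.restrict symIoo isSemialgebraic_symIoo symIoo_subset_symIcc) ∈ integrandAddRel := by
  refine ⟨1, invSqrtRep, twoSqrtRep,
    derivRep.restrict symIoo isSemialgebraic_symIoo symIoo_subset_symIcc, rfl, rfl,
    fun x hx => ?_, rfl⟩
  have hx' : x ∈ symIoo := hx
  rw [Pi.add_apply, invSqrtRep_integrand_eq hx', twoSqrtRep_integrand, IntegralRep.integrand_restrict,
    derivRep_integrand]
  simp only [mem_symIoo, mem_Ioo] at hx'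
  have := inv_sqrt_sub_two_sqrt (u := 1 - x 0 ^ 2) (x2 := x 0 ^ 2) (by nlinarith) rfl
  linarith

/-- **`[(-1,1), 1/√(1−x²)] ∼ [(-1,1), 2√(1−x²)]`** (Kontsevich–Zagier's §1.1 example, inside the
calculus: moves 2 and 3). [cite: KontsevichZagier2001, §1.1] -/
theorem equivalent_invSqrtRep_twoSqrtRep : Equivalent invSqrtRep twoSqrtRep := by
  have h1 := integrandAddRel_subset_relations invSqrtRep_sub_twoSqrtRep_sub_mem
  have h2 := of_derivRep_restrict_mem_relations
  have := relations.add_mem h1 h2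
  simpa [Equivalent] using this

/-! ### §9.5 Move 4 (rule 3): `∫_{-1}^{1} 2√(1−x²) dx = ∬_{x²+y²≤1} 1` -/

/-- The band `{(x,y) | x ∈ (-1,1), −√(1−x²) ≤ y ≤ √(1−x²)}` = the closed disc minus `(±1, 0)`,
in the Newton–Leibniz format. [folklore] -/
def discBand : Set (Fin 2 → ℝ) :=
  {z | (Fin.init z : Fin 1 → ℝ) ∈ symIoo ∧ -√(1 - (Fin.init z : Fin 1 → ℝ) 0 ^ 2) ≤ z (Fin.last 1) ∧
    z (Fin.last 1) ≤ √(1 - (Fin.init z : Fin 1 → ℝ) 0 ^ 2)}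

/-- The band is the disc cut by the open strip `−1 < x < 1`. [folklore] -/
theorem discBand_eq : discBand = piDisc ∩ {z | -1 < z 0 ∧ z 0 < 1} := by
  ext z
  have e0 : (Fin.init z : Fin 1 → ℝ) 0 = z 0 := rfl
  have e1 : z (Fin.last 1) = z 1 := rfl
  simp only [discBand, mem_setOf_eq, mem_symIoo, mem_Ioo, e0, e1, mem_inter_iff, mem_piDisc]
  constructor
  · rintro ⟨⟨h1, h2⟩, h3, h4⟩
    have hu : 0 ≤ 1 - z 0 ^ 2 := by nlinarith
    have hab : |z 1| ≤ √(1 - z 0 ^ 2) := abs_le.mpr ⟨h3, h4⟩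
    have h5 := pow_le_pow_left₀ (abs_nonneg (z 1)) hab 2
    rw [sq_abs, Real.sq_sqrt hu] at h5
    exact ⟨by linarith, h1, h2⟩
  · rintro ⟨h, h1, h2⟩
    have hab : |z 1| ≤ √(1 - z 0 ^ 2) := Real.abs_le_sqrt (by nlinarith)
    exact ⟨⟨h1, h2⟩, (abs_le.mp hab).1, (abs_le.mp hab).2⟩

/-- The band is `ℚ`-semialgebraic. [folklore] -/
theorem isSemialgebraic_discBand : IsSemialgebraic ℚ discBand := by
  have h1 := Literature.ModelTheory.ExponentialFields.isSemialgebraic_setOf_eval_lt (k := ℚ) (R := ℝ)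
    (-1 : MvPolynomial (Fin 2) ℚ) (X 0)
  have h2 := Literature.ModelTheory.ExponentialFields.isSemialgebraic_setOf_eval_lt (k := ℚ) (R := ℝ)
    (X 0 : MvPolynomial (Fin 2) ℚ) 1
  have h := isSemialgebraic_piDisc.inter (h1.inter h2)
  simp only [map_neg, map_one, MvPolynomial.aeval_X] at h
  rw [discBand_eq]
  convert h using 1
  ext z
  simp

/-- The band lies in the disc. [folklore] -/
theorem discBand_subset_piDisc : discBand ⊆ piDisc := by
  rw [discBand_eq]
  exact inter_subset_left

/-- The disc minus the band is null (it lies on the lines `x = ±1`). [folklore] -/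
theorem volume_piDisc_diff_discBand : volume (piDisc \ discBand) = 0 := by
  refine measure_mono_null (fun z hz => ?_)
    (measure_union_null (volume_setOf_apply_eq_zero (0 : Fin 2) (-1))
      (volume_setOf_apply_eq_zero (0 : Fin 2) 1))
  rw [discBand_eq] at hz
  simp only [mem_sdiff, mem_inter_iff, mem_piDisc, mem_setOf_eq, not_and, not_lt] at hz
  obtain ⟨hd, hno⟩ := hz
  have hsq : z 0 ^ 2 ≤ 1 := by nlinarith [sq_nonneg (z 1)]
  have hz0 : -1 ≤ z 0 ∧ z 0 ≤ 1 := abs_le.mp (abs_le_one_iff_mul_self_le_one.mpr (by nlinarith))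
  simp only [mem_union, mem_setOf_eq]
  rcases hz0.1.lt_or_eq with h | h
  · exact Or.inr (le_antisymm hz0.2 (hno hd h))
  · exact Or.inl h.symm

/-- **Move 4 (rule 3)**: `[disc band, 1] − [(-1,1), 2√(1−x²)]` is ONE Newton–Leibniz move along
`y` with primitive `F(x,y) = y`. [cite: KontsevichZagier2001, §1.1 eq. (1)] -/
theorem piRep_restrict_sub_twoSqrtRep_mem :
    of (piRep.restrict discBand isSemialgebraic_discBand discBand_subset_piDisc) - of twoSqrtRep ∈
      newtonLeibnizRel := by
  have hb : IsSemialgebraicFunOn ℚ symIoo (fun x : Fin 1 → ℝ => √(1 - x 0 ^ 2)) :=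
    (IsSemialgebraicFunOn.sqrt_holds (isSemialgebraicFunOn_aeval isSemialgebraic_symIoo
      (1 - X 0 ^ 2))).congr fun x _ => by simp
  refine ⟨1, _, twoSqrtRep, fun x => -√(1 - x 0 ^ 2), fun x => √(1 - x 0 ^ 2), fun z => z (Fin.last 1),
    ?_, ?_, hb, fun x _ => ?_, rfl, ?_, ?_, ?_, rfl⟩
  · exact (isSemialgebraicFunOn_aeval isSemialgebraic_discBand (X (Fin.last 1))).congr fun z _ => by
      simp
  · exact hb.neg.congr fun x _ => by simp
  · exact neg_le_self (Real.sqrt_nonneg _)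
  · intro x _
    simp only [Fin.snoc_last]
    exact continuousOn_id
  · intro x _ t _
    simp only [Fin.snoc_last, IntegralRep.integrand_restrict, piRep_integrand]
    exact hasDerivAt_id' t
  · intro x _
    simp only [Fin.snoc_last, twoSqrtRep_integrand]
    ring

/-- **`[(-1,1), 2√(1−x²)] ∼ [π]`** (move 4 plus the null boundary `x = ±1`).
[cite: KontsevichZagier2001, §1.1 eq. (1)] -/
theorem equivalent_twoSqrtRep_piRep : Equivalent twoSqrtRep piRep := by
  have h1 : Equivalent (piRep.restrict discBand isSemialgebraic_discBand discBand_subset_piDisc)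
      twoSqrtRep :=
    newtonLeibnizRel_subset_relations piRep_restrict_sub_twoSqrtRep_mem
  have h2 : Equivalent piRep (piRep.restrict discBand isSemialgebraic_discBand discBand_subset_piDisc) :=
    piRep.of_sub_of_restrict_mem_relations isSemialgebraic_discBand discBand_subset_piDisc
      volume_piDisc_diff_discBand
  exact (h2.trans h1).symm

/-- **`[β(1/2,1/2)] ∼ [π]` inside the calculus** (four moves: affine substitution, KZ's
`1/√(1−x²) ↔ 2√(1−x²)` step, and the disc as the region under `±√(1−x²)`). The value identity is
`B(1/2,1/2) = Γ(1/2)² = π`. [cite: KontsevichZagier2001, §1.1] -/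
theorem equivalent_betaHalfRep_piRep : Equivalent betaHalfRep piRep := by
  have h1 : Equivalent invSqrtRep betaHalfRep :=
    changeOfVariablesRel_subset_relations invSqrtRep_sub_betaHalfRep_mem
  exact (h1.symm.trans equivalent_invSqrtRep_twoSqrtRep).trans equivalent_twoSqrtRep_piRep

/-- Sanity check by soundness: `B(1/2,1/2) = π`, read off the move chain. [folklore] -/
theorem betaHalfRep_value : betaHalfRep.value = Real.pi := by
  rw [Equivalent.value_eq_holds equivalent_betaHalfRep_piRep, piRep_value]

/-! ### §9.6 The reduction -/

/-- **Cancellation by `β(1/2,1/2)` implies `π`-cancellation**: if the instance `a = b = 1/2` of the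
crux holds then `[π]` is a non-zero-divisor on `FormalRep ⧸ relations` (`KZ.PiCancellation`, the
open crux 0540 of route AyoubSpecialisation). Proof: `c ≡ [r] − [r']` (`exists_integralRep_sub`),
`[π]·c ∈ relations ⇒ [π]×r ∼ [π]×r' ⇒ β×r ∼ β×r'` (`[β] ∼ [π]`, two-sided ideal) `⇒ r ∼ r'`.
[folklore] -/
theorem piCancellation_of_kernelCancellation_half
    (h : KernelCancellation (betaKernel (1/2) (1/2))) : KZ.PiCancellation := by
  intro c hc
  obtain ⟨n, m, r, r', hrel⟩ := exists_integralRep_sub_holds c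
  have h1 : of piRep * (of r - of r') ∈ relations := by
    have h' : of piRep * (c - (of r - of r')) ∈ relations := mul_mem_relations_left_holds _ _ hrel
    have := relations.sub_mem hc h'
    rwa [← mul_sub, sub_sub_cancel] at this
  rw [mul_sub, of_mul_of, of_mul_of] at h1
  have h2 : Equivalent (betaHalfRep.prod r) (betaHalfRep.prod r') :=
    ((Equivalent.prod equivalent_betaHalfRep_piRep (Equivalent.refl r)).trans h1).trans
      (Equivalent.prod equivalent_betaHalfRep_piRep (Equivalent.refl r')).symm
  have h3 : Equivalent r r' :=
    h r r' _ _ (isPinned_prod betaHalfRep rfl (fun x _ => rfl) r)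
      (isPinned_prod betaHalfRep rfl (fun x _ => rfl) r') h2
  have := relations.add_mem hrel h3
  simpa using this

/-- **`BetaCancellation → KZ.PiCancellation`.** The crux is at least as strong as the open
`π`-cancellation crux of route AyoubSpecialisation (stmt-KontsevichZagierPeriods-0540); together
with §3: `KZ.PiCancellation ≤ BetaCancellation ≤ KZKernelConjecture = summit`. [folklore] -/
theorem piCancellation_of_betaCancellation (h : BetaCancellation) : KZ.PiCancellation :=
  piCancellation_of_kernelCancellation_half
    (betaCancellation_iff.1 h (1/2) (1/2) (by norm_num) (by norm_num))

/-! ## §10 PROVABLE CASES: all positive INTEGER exponents `(a, b) = (A+1, B+1)`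

For integer exponents the kernel `t^A (1−t)^B` is a `ℚ`-polynomial with a polynomial primitive
`P`, `P(0) = 0`, `P(1) = B(A+1,B+1) = A!B!/(A+B+1)! = 1/N` with `N = (A+B+1)!/(A!B!) ∈ ℕ`. So a
pinned `q` is, modulo one coordinate rotation and a null boundary, the band
`[[0,1] × σ, P'(t) f]`, which is ONE Newton–Leibniz move away from `[σ, f/N]`; and
`N • [σ, f/N] ∼ [σ, f] = [r]` is integrand additivity (`KZ.IntegralRep.of_constMul_nat_sub_nsmul_mem_relations`).
Hence `q ∼ q' ⇒ [σ,f/N] ∼ [σ',f'/N] ⇒ r ∼ r'` — NO division by `N` is needed because the factor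
`1/N` travels inside the integrand. This is exactly what fails for non-integer exponents: the
primitive of `t^{a-1}(1-t)^{b-1}` is not semialgebraic and `B(a,b)` is (expected) transcendental. -/

section IntegerExponents

open Polynomial

/-- A polynomial antiderivative with zero constant term. [folklore] -/
def antideriv (p : ℚ[X]) : ℚ[X] := p.sum fun i c => Polynomial.C (c / (i + 1)) * Polynomial.X ^ (i + 1)

/-- `(antideriv p)' = p`. [folklore] -/
theorem derivative_antideriv (p : ℚ[X]) : derivative (antideriv p) = p := by
  rw [antideriv, Polynomial.sum_def, derivative_sum]
  conv_rhs => rw [← p.sum_C_mul_X_pow_eq, Polynomial.sum_def]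
  refine Finset.sum_congr rfl fun i _ => ?_
  rw [derivative_C_mul_X_pow, Nat.add_sub_cancel]
  congr 2
  push_cast
  field_simp

/-- `antideriv p` has no constant term. [folklore] -/
theorem antideriv_coeff_zero (p : ℚ[X]) : (antideriv p).coeff 0 = 0 := by
  rw [antideriv, Polynomial.sum_def, finsetSum_coeff]
  refine Finset.sum_eq_zero fun i _ => ?_
  simp [coeff_X_pow]

/-- `(antideriv p)(0) = 0` over `ℝ`. [folklore] -/
theorem aeval_zero_antideriv (p : ℚ[X]) : (aeval (0:ℝ) (antideriv p) : ℝ) = 0 := by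
  simp [Polynomial.aeval_def, Polynomial.eval₂_at_zero, antideriv_coeff_zero]

/-- The integer-exponent kernel `X^A (1 − X)^B ∈ ℚ[X]`. [folklore] -/
def kerPoly (A B : ℕ) : ℚ[X] := Polynomial.X ^ A * (1 - Polynomial.X) ^ B

/-- Evaluating `kerPoly`. [folklore] -/
@[simp] theorem aeval_kerPoly (A B : ℕ) (t : ℝ) : (aeval t (kerPoly A B) : ℝ) = t ^ A * (1 - t) ^ B := by
  simp [kerPoly]

/-- The Beta kernel at integer exponents is the polynomial kernel (everywhere on `ℝ`). [folklore] -/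
theorem betaKernel_natCast_succ (A B : ℕ) :
    betaKernel ((A:ℚ) + 1) ((B:ℚ) + 1) = fun t => (aeval t (kerPoly A B) : ℝ) := by
  funext t
  simp only [betaKernel, aeval_kerPoly]
  push_cast
  simp only [add_sub_cancel_right, Real.rpow_natCast]

/-- `B(A+1, B+1) = A! B! / (A+B+1)!`. [folklore] -/
theorem beta_natCast_succ (A B : ℕ) :
    ProbabilityTheory.beta ((A:ℝ) + 1) ((B:ℝ) + 1) =
      (A.factorial * B.factorial : ℝ) / (A + B + 1).factorial := by
  rw [ProbabilityTheory.beta]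
  have h1 : Real.Gamma ((A:ℝ) + 1) = A.factorial := Real.Gamma_nat_eq_factorial A
  have h2 : Real.Gamma ((B:ℝ) + 1) = B.factorial := Real.Gamma_nat_eq_factorial B
  have h3 : Real.Gamma ((A:ℝ) + 1 + ((B:ℝ) + 1)) = (A + B + 1).factorial := by
    rw [show (A:ℝ) + 1 + ((B:ℝ) + 1) = ((A + B + 1 : ℕ) : ℝ) + 1 by push_cast; ring]
    exact Real.Gamma_nat_eq_factorial _
  rw [h1, h2, h3]

/-- **`P(1) = A!B!/(A+B+1)!`** for the primitive `P = antideriv (kerPoly A B)` (FTC + the Beta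
integral). [folklore] -/
theorem aeval_one_antideriv_kerPoly (A B : ℕ) :
    (aeval (1:ℝ) (antideriv (kerPoly A B)) : ℝ) = (A.factorial * B.factorial : ℝ) / (A + B + 1).factorial := by
  have hFTC : ∫ t in (0:ℝ)..1, (aeval t (kerPoly A B) : ℝ) =
      aeval (1:ℝ) (antideriv (kerPoly A B)) - aeval (0:ℝ) (antideriv (kerPoly A B)) :=
    intervalIntegral.integral_eq_sub_of_hasDerivAt (f := fun x : ℝ => (aeval x (antideriv (kerPoly A B)) : ℝ))
      (fun t _ => by
        have h := Polynomial.hasDerivAt_aeval (antideriv (kerPoly A B)) t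
        rwa [derivative_antideriv] at h)
      ((Polynomial.continuous_aeval _).intervalIntegrable _ _)
  have hI : ∫ t in (0:ℝ)..1, (aeval t (kerPoly A B) : ℝ) = ProbabilityTheory.beta ((A:ℝ) + 1) ((B:ℝ) + 1) := by
    rw [intervalIntegral.integral_of_le zero_le_one, integral_Ioc_eq_integral_Ioo]
    have hb := (integrableOn_betaKernel_and_integral_eq (a := (A:ℚ) + 1) (b := (B:ℚ) + 1)
      (by positivity) (by positivity)).2
    push_cast at hb
    rw [← hb, betaKernel_natCast_succ]
  rw [aeval_zero_antideriv, sub_zero] at hFTC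
  rw [← hFTC, hI, beta_natCast_succ]

/-- The integer `N = (A+B+1)!/(A!B!)`. [folklore] -/
def betaDenom (A B : ℕ) : ℕ := (A + B + 1).factorial / (A.factorial * B.factorial)

/-- `A! B! ∣ (A+B+1)!`. [folklore] -/
theorem factorial_mul_factorial_dvd (A B : ℕ) : A.factorial * B.factorial ∣ (A + B + 1).factorial :=
  (Nat.factorial_mul_factorial_dvd_factorial_add A B).trans (Nat.factorial_dvd_factorial (by omega))

/-- `P(1) = 1/N`: the Beta value at integer exponents is the RECIPROCAL OF AN INTEGER. [folklore] -/
theorem aeval_one_antideriv_kerPoly_eq_inv (A B : ℕ) :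
    (aeval (1:ℝ) (antideriv (kerPoly A B)) : ℝ) = ((betaDenom A B : ℕ) : ℝ)⁻¹ := by
  rw [aeval_one_antideriv_kerPoly, betaDenom, Nat.cast_div (factorial_mul_factorial_dvd A B)
    (by positivity), inv_div]
  push_cast
  ring

/-- `N ≠ 0`. [folklore] -/
theorem betaDenom_pos (A B : ℕ) : 0 < betaDenom A B :=
  Nat.div_pos (Nat.le_of_dvd (Nat.factorial_pos _) (factorial_mul_factorial_dvd A B)) (by positivity)

variable {n : ℕ}

/-- **`[[0,1] × σ, p(t) · f]`** (slab coordinate `t` LAST): the band of the Newton–Leibniz move,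
for a `ℚ`-polynomial kernel `p`. [folklore] -/
def polySlab (r : IntegralRep n) (p : ℚ[X]) : IntegralRep (n + 1) where
  domain := r.slabDomain 0
  integrand := fun z => (aeval (z (Fin.last n)) p : ℝ) * r.integrand (Fin.init z)
  isSemialgebraic_domain := r.isSemialgebraic_slabDomain 0
  isSemialgebraicFunOn_integrand := by
    refine IsSemialgebraicFunOn.mul_holds ?_ (r.slab 0).isSemialgebraicFunOn_integrand
    refine (isSemialgebraicFunOn_aeval (r.isSemialgebraic_slabDomain 0)
      (Polynomial.aeval (MvPolynomial.X (Fin.last n) : MvPolynomial (Fin (n + 1)) ℚ) p)).congr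
      fun z _ => ?_
    show MvPolynomial.aeval z (Polynomial.aeval (MvPolynomial.X (Fin.last n)) p) = _
    rw [← Polynomial.aeval_algHom_apply, MvPolynomial.aeval_X]
  integrableOn := by
    obtain ⟨C, hC⟩ := (isCompact_Icc (a := (0:ℝ)) (b := 1)).exists_bound_of_continuousOn
      (Polynomial.continuous_aeval p).continuousOn
    refine Integrable.bdd_mul (c := C) (r.integrableOn_slabDomain 0) ?_ ?_
    · exact ((Polynomial.continuous_aeval p).comp (continuous_apply (Fin.last n))).aestronglyMeasurable
    · refine ae_restrict_of_forall_mem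
        (Literature.ModelTheory.ExponentialFields.IsSemialgebraic.measurableSet_holds
          (r.isSemialgebraic_slabDomain 0)) fun z hz => hC _ ⟨?_, ?_⟩
      · simpa using hz.2.1
      · simpa using hz.2.2

/-- The domain of `polySlab r p`. [folklore] -/
@[simp] theorem polySlab_domain (r : IntegralRep n) (p : ℚ[X]) : (polySlab r p).domain = r.slabDomain 0 := rfl

/-- The integrand of `polySlab r p`. [folklore] -/
@[simp] theorem polySlab_integrand (r : IntegralRep n) (p : ℚ[X]) :
    (polySlab r p).integrand = fun z => (aeval (z (Fin.last n)) p : ℝ) * r.integrand (Fin.init z) := rfl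

/-- The base `[σ, P(1) · f]` of the Newton–Leibniz move, a scaled copy of `r`. [folklore] -/
def scaledBase (r : IntegralRep n) (p : ℚ[X]) : IntegralRep n :=
  r.constMul (algebraMap ℚ ℝ ((antideriv p).eval 1)) (isAlgebraic_algebraMap _)

/-- **ONE Newton–Leibniz move**: `[[0,1] × σ, p(t) f] − [σ, P(1) f] ∈ newtonLeibnizRel`, primitive
`F(x, t) = P(t) f(x)` with `P = antideriv p`. [cite: KontsevichZagier2001, §1.2 rule (3)] -/
theorem polySlab_sub_scaledBase_mem (r : IntegralRep n) (p : ℚ[X]) :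
    of (polySlab r p) - of (scaledBase r p) ∈ newtonLeibnizRel := by
  refine ⟨n, polySlab r p, scaledBase r p, fun _ => ((0:ℕ):ℝ), fun _ => ((0:ℕ):ℝ) + 1,
    fun z => (aeval (z (Fin.last n)) (antideriv p) : ℝ) * r.integrand (Fin.init z),
    (polySlab r (antideriv p)).isSemialgebraicFunOn_integrand,
    isSemialgebraicFunOn_natCast r.isSemialgebraic_domain 0, ?_, fun _ _ => by simp, rfl, ?_, ?_, ?_,
    rfl⟩
  · exact (isSemialgebraicFunOn_aeval r.isSemialgebraic_domain
      (((0:ℕ) : MvPolynomial (Fin n) ℚ) + 1)).congr fun x _ => by simp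
  · intro x _
    simp only [Fin.snoc_last, Fin.init_snoc]
    exact ((Polynomial.continuous_aeval _).mul continuous_const).continuousOn
  · intro x _ t _
    simp only [polySlab_integrand, Fin.snoc_last, Fin.init_snoc]
    have h := (Polynomial.hasDerivAt_aeval (antideriv p) t).mul_const (r.integrand x)
    rwa [derivative_antideriv] at h
  · intro x _
    simp only [scaledBase, IntegralRep.integrand_constMul, Fin.snoc_last, Fin.init_snoc, Nat.cast_zero,
      zero_add, aeval_zero_antideriv, zero_mul, sub_zero]
    congr 1
    have h := Polynomial.aeval_algebraMap_apply_eq_algebraMap_eval (A := ℝ) (1:ℚ) (antideriv p)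
    rw [map_one] at h
    exact h.symm

/-- `polySlab` with the slab coordinate FIRST (reindexed along `finAddFlip`). [folklore] -/
def polySlabFirst (r : IntegralRep n) (p : ℚ[X]) : IntegralRep (1 + n) := (polySlab r p).reindex finAddFlip

/-- The domain of `polySlabFirst r p`. [folklore] -/
theorem polySlabFirst_domain (r : IntegralRep n) (p : ℚ[X]) :
    (polySlabFirst r p).domain = {w | (fun j => w (Fin.natAdd 1 j)) ∈ r.domain ∧
      0 ≤ w (Fin.castAdd n 0) ∧ w (Fin.castAdd n 0) ≤ 1} := by
  ext w
  simp only [polySlabFirst, IntegralRep.reindex_domain, polySlab_domain, IntegralRep.slabDomain,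
    mem_setOf_eq, init_comp_finAddFlip, finAddFlip_last, Nat.cast_zero, zero_add]

/-- The integrand of `polySlabFirst r p` is `p(head) · f(tail)`. [folklore] -/
theorem polySlabFirst_integrand (r : IntegralRep n) (p : ℚ[X]) (w : Fin (1 + n) → ℝ) :
    (polySlabFirst r p).integrand w =
      (aeval (w (Fin.castAdd n 0)) p : ℝ) * r.integrand (fun j => w (Fin.natAdd 1 j)) := by
  simp only [polySlabFirst, IntegralRep.reindex_integrand, polySlab_integrand, init_comp_finAddFlip,
    finAddFlip_last]

/-- **A representation pinned with a polynomial kernel is equivalent to its band** (one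
coordinate rotation, rule 2, and a null boundary). [folklore] -/
theorem equivalent_polySlab_of_isPinned {p : ℚ[X]} {r : IntegralRep n} {q : IntegralRep (1 + n)}
    (hq : IsPinned (fun t => (aeval t p : ℝ)) r q) : Equivalent q (polySlab r p) := by
  obtain ⟨hd, hi⟩ := hq
  have hE : IsSemialgebraic ℚ (pinDomain r.domain) := hd ▸ q.isSemialgebraic_domain
  have hEsub : pinDomain r.domain ⊆ (polySlabFirst r p).domain := by
    intro w hw
    rw [polySlabFirst_domain]
    exact ⟨hw.2, hw.1.1.le, hw.1.2.le⟩
  have hvol : volume ((polySlabFirst r p).domain \ pinDomain r.domain) = 0 := by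
    refine measure_mono_null (fun w hw => ?_)
      (measure_union_null (volume_setOf_apply_eq_zero (Fin.castAdd n 0) 0)
        (volume_setOf_apply_eq_zero (Fin.castAdd n 0) 1))
    rw [polySlabFirst_domain] at hw
    obtain ⟨⟨hσ, h0, h1⟩, hno⟩ := hw
    by_contra hc
    simp only [mem_union, mem_setOf_eq, not_or] at hc
    exact hno ⟨⟨lt_of_le_of_ne h0 (Ne.symm hc.1), lt_of_le_of_ne h1 hc.2⟩, hσ⟩
  have h1 := (polySlabFirst r p).of_sub_of_restrict_mem_relations hE hEsub hvol
  have h2 : of ((polySlabFirst r p).restrict _ hE hEsub) - of q ∈ relations := by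
    refine of_sub_of_mem_relations_of_eqOn hd fun w hw => ?_
    simp only [IntegralRep.integrand_restrict, IntegralRep.domain_restrict] at hw ⊢
    rw [hi (hd ▸ hw), polySlabFirst_integrand]
    simp [pinFun]
  have h3 : of (polySlab r p) - of (polySlabFirst r p) ∈ relations :=
    of_sub_of_reindex_mem_relations (polySlab r p) finAddFlip
  have : of (polySlab r p) - of q = (of (polySlab r p) - of (polySlabFirst r p)) +
      (of (polySlabFirst r p) - of ((polySlabFirst r p).restrict _ hE hEsub)) +
      (of ((polySlabFirst r p).restrict _ hE hEsub) - of q) := by abel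
  apply Equivalent.symm
  show of (polySlab r p) - of q ∈ relations
  rw [this]
  exact relations.add_mem (relations.add_mem h3 h1) h2

/-- **A pinned representation with polynomial kernel is equivalent to the scaled base**
`[σ, P(1) f]`. [folklore] -/
theorem equivalent_scaledBase_of_isPinned {p : ℚ[X]} {r : IntegralRep n} {q : IntegralRep (1 + n)}
    (hq : IsPinned (fun t => (aeval t p : ℝ)) r q) : Equivalent q (scaledBase r p) :=
  (equivalent_polySlab_of_isPinned hq).trans
    (newtonLeibnizRel_subset_relations (polySlab_sub_scaledBase_mem r p))

/-- **`[r] − N • [σ, f/N] ∈ relations`** when `P(1) = 1/N`: integrand additivity only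
(`KZ.IntegralRep.of_constMul_nat_sub_nsmul_mem_relations`), NO division. [folklore] -/
theorem of_sub_nsmul_scaledBase_mem (r : IntegralRep n) (A B : ℕ) :
    of r - betaDenom A B • of (scaledBase r (kerPoly A B)) ∈ relations := by
  have hN : ((betaDenom A B : ℕ) : ℝ) ≠ 0 := by exact_mod_cast (betaDenom_pos A B).ne'
  have h1 := (scaledBase r (kerPoly A B)).of_constMul_nat_sub_nsmul_mem_relations (betaDenom A B)
  have h2 : of r - of ((scaledBase r (kerPoly A B)).constMul ((betaDenom A B : ℕ) : ℝ)
      (isAlgebraic_nat _)) ∈ relations := by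
    refine of_sub_of_mem_relations_of_eqOn rfl fun x _ => ?_
    simp only [scaledBase, IntegralRep.integrand_constMul]
    rw [← Polynomial.aeval_algebraMap_apply_eq_algebraMap_eval, map_one,
      aeval_one_antideriv_kerPoly_eq_inv, ← mul_assoc, mul_inv_cancel₀ hN, one_mul]
  have := relations.add_mem h2 h1
  simpa using this

/-- **`BetaCancellation` HOLDS for all positive integer exponents** (kernel form). [folklore] -/
theorem kernelCancellation_betaKernel_natCast_succ (A B : ℕ) :
    KernelCancellation (betaKernel ((A:ℚ) + 1) ((B:ℚ) + 1)) := by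
  rw [betaKernel_natCast_succ]
  intro n m r r' q q' hq hq' hqq'
  have hs : Equivalent (scaledBase r (kerPoly A B)) (scaledBase r' (kerPoly A B)) :=
    ((equivalent_scaledBase_of_isPinned hq).symm.trans hqq').trans
      (equivalent_scaledBase_of_isPinned hq')
  have h1 := of_sub_nsmul_scaledBase_mem r A B
  have h2 := of_sub_nsmul_scaledBase_mem r' A B
  have h3 : betaDenom A B • (of (scaledBase r (kerPoly A B)) - of (scaledBase r' (kerPoly A B))) ∈
      relations := relations.nsmul_mem hs _
  have : of r - of r' = (of r - betaDenom A B • of (scaledBase r (kerPoly A B))) +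
      betaDenom A B • (of (scaledBase r (kerPoly A B)) - of (scaledBase r' (kerPoly A B))) -
      (of r' - betaDenom A B • of (scaledBase r' (kerPoly A B))) := by
    rw [nsmul_sub]; abel
  show of r - of r' ∈ relations
  rw [this]
  exact relations.sub_mem (relations.add_mem h1 h3) h2

/-- **`BetaCancellation` for positive integers `a, b`**, with the parameters as rationals.
[folklore] -/
theorem kernelCancellation_betaKernel_of_int {a b : ℚ} (ha : ∃ A : ℕ, a = A + 1) (hb : ∃ B : ℕ, b = B + 1) :
    KernelCancellation (betaKernel a b) := by
  obtain ⟨A, rfl⟩ := ha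
  obtain ⟨B, rfl⟩ := hb
  exact kernelCancellation_betaKernel_natCast_succ A B

/-- **`BetaCancellation` for positive INTEGER `a, b`, in the crux's literal shape.** [folklore] -/
theorem betaCancellation_of_int (a b : ℚ) (ha : ∃ A : ℕ, a = A + 1) (hb : ∃ B : ℕ, b = B + 1) :
    ∀ ⦃n m : ℕ⦄ (r : IntegralRep n) (r' : IntegralRep m) (q : IntegralRep (1 + n))
      (q' : IntegralRep (1 + m)),
    q.domain = {z | z (Fin.castAdd n 0) ∈ Set.Ioo (0:ℝ) 1 ∧ (fun j => z (Fin.natAdd 1 j)) ∈ r.domain} →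
    Set.EqOn q.integrand (fun z => (z (Fin.castAdd n 0)) ^ ((a:ℝ) - 1) *
      (1 - z (Fin.castAdd n 0)) ^ ((b:ℝ) - 1) * r.integrand (fun j => z (Fin.natAdd 1 j))) q.domain →
    q'.domain = {z | z (Fin.castAdd m 0) ∈ Set.Ioo (0:ℝ) 1 ∧ (fun j => z (Fin.natAdd 1 j)) ∈ r'.domain} →
    Set.EqOn q'.integrand (fun z => (z (Fin.castAdd m 0)) ^ ((a:ℝ) - 1) *
      (1 - z (Fin.castAdd m 0)) ^ ((b:ℝ) - 1) * r'.integrand (fun j => z (Fin.natAdd 1 j))) q'.domain →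
    Equivalent q q' → Equivalent r r' :=
  fun _ _ r r' q q' hd hi hd' hi' hqq' =>
    kernelCancellation_betaKernel_of_int ha hb r r' q q' ⟨hd, hi⟩ ⟨hd', hi'⟩ hqq'

end IntegerExponents

/-! # GEN 2 (refuter-cdisprove-…-13633-g2-0, 2026-08-16) -/

/-! ## §11 TORSION IS NOT AN ESCAPE: `FormalRep ⧸ relations` is torsion-free (and divisible) -/

/-- Scaling by `k` and then by `k⁻¹` is the identity on representations (`k ≠ 0`). [folklore] -/
theorem constMul_inv_constMul {n : ℕ} (r : IntegralRep n) {c : ℝ} (hc : IsAlgebraic ℚ c)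
    (hc0 : c ≠ 0) : (r.constMul c hc).constMul c⁻¹ hc.inv = r := by
  refine IntegralRep.ext' rfl ?_
  funext x
  simp only [IntegralRep.integrand_constMul]
  rw [← mul_assoc, inv_mul_cancel₀ hc0, one_mul]

/-- Scaling by `k⁻¹` and then by `k` is the identity on representations (`k ≠ 0`). [folklore] -/
theorem constMul_constMul_inv {n : ℕ} (r : IntegralRep n) {c : ℝ} (hc : IsAlgebraic ℚ c)
    (hc0 : c ≠ 0) : (r.constMul c⁻¹ hc.inv).constMul c hc = r := by
  refine IntegralRep.ext' rfl ?_
  funext x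
  simp only [IntegralRep.integrand_constMul]
  rw [← mul_assoc, mul_inv_cancel₀ hc0, one_mul]

/-- `scale c⁻¹ ∘ scale c = id` on `FormalRep` (`c ≠ 0` real algebraic). [folklore] -/
theorem scale_inv_scale {c : ℝ} (hc : IsAlgebraic ℚ c) (hc0 : c ≠ 0) (x : FormalRep) :
    scale c⁻¹ hc.inv (scale c hc x) = x := by
  induction x using FreeAbelianGroup.induction_on with
  | zero => simp
  | of s =>
    obtain ⟨n, r⟩ := s
    show scale c⁻¹ hc.inv (scale c hc (of r)) = of r
    rw [scale_of, scale_of, constMul_inv_constMul r hc hc0]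
  | neg s ih =>
    obtain ⟨n, r⟩ := s
    show scale c⁻¹ hc.inv (scale c hc (-of r)) = -of r
    rw [map_neg, map_neg, scale_of, scale_of, constMul_inv_constMul r hc hc0]
  | add x y hx hy => rw [map_add, map_add, hx, hy]

/-- `scale c ∘ scale c⁻¹ = id` on `FormalRep` (`c ≠ 0` real algebraic). [folklore] -/
theorem scale_scale_inv {c : ℝ} (hc : IsAlgebraic ℚ c) (hc0 : c ≠ 0) (x : FormalRep) :
    scale c hc (scale c⁻¹ hc.inv x) = x := by
  induction x using FreeAbelianGroup.induction_on with
  | zero => simp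
  | of s =>
    obtain ⟨n, r⟩ := s
    show scale c hc (scale c⁻¹ hc.inv (of r)) = of r
    rw [scale_of, scale_of, constMul_constMul_inv r hc hc0]
  | neg s ih =>
    obtain ⟨n, r⟩ := s
    show scale c hc (scale c⁻¹ hc.inv (-of r)) = -of r
    rw [map_neg, map_neg, scale_of, scale_of, constMul_constMul_inv r hc hc0]
  | add x y hx hy => rw [map_add, map_add, hx, hy]

/-- **Cancelling a non-zero algebraic scalar from a relation**: `scale c x ∈ relations ↔
x ∈ relations`. [folklore] -/
theorem scale_mem_relations_iff {c : ℝ} (hc : IsAlgebraic ℚ c) (hc0 : c ≠ 0) (x : FormalRep) :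
    scale c hc x ∈ relations ↔ x ∈ relations := by
  refine ⟨fun h => ?_, scale_mem_relations c hc⟩
  have h' := scale_mem_relations c⁻¹ hc.inv h
  rwa [scale_inv_scale hc hc0] at h'

/-- **Cancelling a non-zero algebraic scalar from an equivalence.** [folklore] -/
theorem equivalent_of_equivalent_constMul {n m : ℕ} {r : IntegralRep n} {r' : IntegralRep m}
    {c : ℝ} (hc : IsAlgebraic ℚ c) (hc0 : c ≠ 0)
    (h : Equivalent (r.constMul c hc) (r'.constMul c hc)) : Equivalent r r' := by
  have h' := h.constMul c⁻¹ hc.inv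
  rwa [constMul_inv_constMul r hc hc0, constMul_inv_constMul r' hc hc0] at h'

/-- **Integer multiples are scalings modulo relations**: `k • x − scale k x ∈ relations`
(integrand additivity, `KZ.IntegralRep.of_constMul_nat_sub_nsmul_mem_relations`, extended
additively). [folklore] -/
theorem nsmul_sub_scale_mem_relations (k : ℕ) (x : FormalRep) :
    k • x - scale (k : ℝ) (isAlgebraic_nat k) x ∈ relations := by
  induction x using FreeAbelianGroup.induction_on with
  | zero => simp [relations.zero_mem]
  | of s =>
    obtain ⟨n, r⟩ := s
    show k • of r - scale (k : ℝ) (isAlgebraic_nat k) (of r) ∈ relations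
    rw [scale_of, ← neg_sub]
    exact relations.neg_mem (r.of_constMul_nat_sub_nsmul_mem_relations k)
  | neg s ih =>
    obtain ⟨n, r⟩ := s
    have h0 : k • of r - scale (k : ℝ) (isAlgebraic_nat k) (of r) ∈ relations := by
      rw [scale_of, ← neg_sub]
      exact relations.neg_mem (r.of_constMul_nat_sub_nsmul_mem_relations k)
    have : k • (-of r) - scale (k : ℝ) (isAlgebraic_nat k) (-of r) =
        -(k • of r - scale (k : ℝ) (isAlgebraic_nat k) (of r)) := by
      rw [smul_neg, map_neg]; abel
    show k • (-of r) - scale (k : ℝ) (isAlgebraic_nat k) (-of r) ∈ relations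
    rw [this]
    exact relations.neg_mem h0
  | add x y hx hy =>
    have : k • (x + y) - scale (k : ℝ) (isAlgebraic_nat k) (x + y) =
        (k • x - scale (k : ℝ) (isAlgebraic_nat k) x) + (k • y - scale (k : ℝ) (isAlgebraic_nat k) y) := by
      rw [smul_add, map_add]; abel
    rw [this]
    exact relations.add_mem hx hy

/-- **TORSION-FREENESS of the formal effective period group `FormalRep ⧸ relations`**:
`k • x ∈ relations → x ∈ relations` for every `k ≠ 0` — "division by a positive integer IS a
derived rule" of the calculus (`k • x ≡ scale k x`, and `scale k⁻¹` preserves relations). So no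
"only `N · ([r] − [r'])` is a relation" obstruction can exist anywhere in this calculus.
[folklore] -/
theorem mem_relations_of_nsmul_mem {k : ℕ} (hk : k ≠ 0) {x : FormalRep}
    (h : k • x ∈ relations) : x ∈ relations := by
  have hk' : (k : ℝ) ≠ 0 := by exact_mod_cast hk
  have h1 : scale (k : ℝ) (isAlgebraic_nat k) x ∈ relations := by
    have := relations.sub_mem h (nsmul_sub_scale_mem_relations k x)
    rwa [sub_sub_cancel] at this
  exact (scale_mem_relations_iff (isAlgebraic_nat k) hk' x).1 h1

/-- Torsion-freeness, `iff` form. [folklore] -/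
theorem nsmul_mem_relations_iff {k : ℕ} (hk : k ≠ 0) (x : FormalRep) :
    k • x ∈ relations ↔ x ∈ relations :=
  ⟨mem_relations_of_nsmul_mem hk, fun h => relations.nsmul_mem h k⟩

/-- Torsion-freeness for integer multiples. [folklore] -/
theorem zsmul_mem_relations_iff {k : ℤ} (hk : k ≠ 0) (x : FormalRep) :
    k • x ∈ relations ↔ x ∈ relations := by
  rcases Int.natAbs_eq k with hk' | hk'
  · rw [hk', natCast_zsmul]
    exact nsmul_mem_relations_iff (by omega) x
  · rw [hk', neg_smul, natCast_zsmul, neg_mem_iff]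
    exact nsmul_mem_relations_iff (by omega) x

/-- **Two-term form**: `k • ([r] − [r']) ∈ relations → r ∼ r'` (`k ≠ 0`). This moots the failure
mode "only `N·([r]−[r'])` may be a relation" recorded for cruxes `MultiplicationThree` /
`MultiplicationAccessible` of the route. [folklore] -/
theorem equivalent_of_nsmul_sub_mem {n m : ℕ} {k : ℕ} (hk : k ≠ 0) {r : IntegralRep n}
    {r' : IntegralRep m} (h : k • (of r - of r') ∈ relations) : Equivalent r r' :=
  mem_relations_of_nsmul_mem hk h

/-- **DIVISIBILITY**: every class is a `k`-th multiple modulo relations (`x ≡ k • scale k⁻¹ x`).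
With torsion-freeness, `FormalRep ⧸ relations` is uniquely divisible — a `ℚ`-vector space.
[folklore] -/
theorem exists_nsmul_sub_mem_relations {k : ℕ} (hk : k ≠ 0) (x : FormalRep) :
    ∃ y : FormalRep, x - k • y ∈ relations := by
  have hk' : (k : ℝ) ≠ 0 := by exact_mod_cast hk
  refine ⟨scale (k : ℝ)⁻¹ (isAlgebraic_nat k).inv x, ?_⟩
  have h1 := nsmul_sub_scale_mem_relations k (scale (k : ℝ)⁻¹ (isAlgebraic_nat k).inv x)
  rw [scale_scale_inv (isAlgebraic_nat k) hk'] at h1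
  have : x - k • scale (k : ℝ)⁻¹ (isAlgebraic_nat k).inv x =
      -(k • scale (k : ℝ)⁻¹ (isAlgebraic_nat k).inv x - x) := by abel
  rw [this]
  exact relations.neg_mem h1


/-! ## §12 THE PRIMITIVE CRITERION: kernels the calculus can integrate in closed form

For a kernel `k` on `[0,1]` admitting a `ℚ`-semialgebraic primitive `K ∈ C([0,1])`, `K' = k` on
`(0,1)`, cancellation is DECIDED inside the calculus by the value `K 1 − K 0 = ∫₀¹ k`:
`KernelCancellation k ↔ K 1 ≠ K 0`. The `→` half is one Newton–Leibniz move over an arbitrary base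
(`q ∼ [σ, (K 1 − K 0) f]`) and the cancellation of the algebraic scalar `K 1 − K 0`; the `←` half
is `q ∼ [σ, 0] ∈ relations` for every base, and `[π] ≁ −[π]`. -/

/-- The closed unit interval `[0,1] ⊆ ℝ¹`. [folklore] -/
def unitIcc : Set (Fin 1 → ℝ) := {x | x 0 ∈ Icc (0:ℝ) 1}

/-- Membership in `unitIcc`. [folklore] -/
@[simp] theorem mem_unitIcc (x : Fin 1 → ℝ) : x ∈ unitIcc ↔ x 0 ∈ Icc (0:ℝ) 1 := Iff.rfl

/-- `[0,1] ⊆ ℝ¹` is `ℚ`-semialgebraic. [folklore] -/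
theorem isSemialgebraic_unitIcc : IsSemialgebraic ℚ unitIcc := by
  have h1 := Literature.ModelTheory.ExponentialFields.isSemialgebraic_setOf_eval_le (k := ℚ) (R := ℝ)
    (0 : MvPolynomial (Fin 1) ℚ) (X 0)
  have h2 := Literature.ModelTheory.ExponentialFields.isSemialgebraic_setOf_eval_le (k := ℚ) (R := ℝ)
    (X 0 : MvPolynomial (Fin 1) ℚ) 1
  have h := h1.inter h2
  simp only [map_zero, map_one, MvPolynomial.aeval_X] at h
  have hset : unitIcc = {x : Fin 1 → ℝ | 0 ≤ x 0} ∩ {x | x 0 ≤ 1} := by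
    ext x
    simp [unitIcc]
  rw [hset]
  exact h

/-- `(0,1) ⊆ [0,1]`. [folklore] -/
theorem unitIoo_subset_unitIcc : unitIoo ⊆ unitIcc := fun _ hx => ⟨hx.1.le, hx.2.le⟩

/-- `[0,1] ∖ (0,1)` is null. [folklore] -/
theorem volume_unitIcc_diff_unitIoo : volume (unitIcc \ unitIoo) = 0 := by
  refine measure_mono_null (fun x hx => ?_)
    (measure_union_null (volume_setOf_apply_eq_zero (0 : Fin 1) 0)
      (volume_setOf_apply_eq_zero (0 : Fin 1) 1))
  simp only [mem_sdiff, mem_unitIcc, mem_Icc, mem_unitIoo, mem_Ioo, not_and, not_lt] at hx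
  simp only [mem_union, mem_setOf_eq]
  obtain ⟨⟨h1, h2⟩, h3⟩ := hx
  rcases h1.lt_or_eq with h1 | h1
  · exact Or.inr (le_antisymm h2 (h3 h1))
  · exact Or.inl h1.symm

/-- `[0,1] ⊆ ℝ¹` is the closed box. [folklore] -/
theorem unitIcc_eq_pi : unitIcc = Set.pi univ fun _ : Fin 1 => Icc (0:ℝ) 1 := by
  ext x
  simp only [unitIcc, mem_setOf_eq, mem_univ_pi, Fin.forall_fin_one]

/-- `[[0,1], g]`: the representation on the closed unit interval with integrand `g (x 0)`.
[folklore] -/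
def iccRep (g : ℝ → ℝ) (hg : IsSemialgebraicFunOn ℚ unitIcc (fun x => g (x 0)))
    (hgi : IntegrableOn g (Icc (0:ℝ) 1)) : IntegralRep 1 where
  domain := unitIcc
  integrand := fun x => g (x 0)
  isSemialgebraic_domain := isSemialgebraic_unitIcc
  isSemialgebraicFunOn_integrand := hg
  integrableOn := integrableOn_comp_apply_zero_iff.2 hgi

/-- The domain of `iccRep`. [folklore] -/
@[simp] theorem iccRep_domain (g : ℝ → ℝ) (hg : IsSemialgebraicFunOn ℚ unitIcc (fun x => g (x 0)))
    (hgi : IntegrableOn g (Icc (0:ℝ) 1)) : (iccRep g hg hgi).domain = unitIcc := rfl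

/-- The integrand of `iccRep`. [folklore] -/
@[simp] theorem iccRep_integrand (g : ℝ → ℝ) (hg : IsSemialgebraicFunOn ℚ unitIcc (fun x => g (x 0)))
    (hgi : IntegrableOn g (Icc (0:ℝ) 1)) : (iccRep g hg hgi).integrand = fun x => g (x 0) := rfl

/-- The last coordinate of `ℝ^{n+1}` as `Fin.natAdd n 0`. [folklore] -/
theorem natAdd_zero_eq_last (n : ℕ) : (Fin.natAdd n (0 : Fin 1) : Fin (n + 1)) = Fin.last n :=
  Fin.ext (by simp)

/-- `Fin.init` through `Fin.castAdd 1`. [folklore] -/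
theorem init_eq_comp_castAdd {n : ℕ} (z : Fin (n + 1) → ℝ) :
    (Fin.init z : Fin n → ℝ) = fun i => z (Fin.castAdd 1 i) := rfl

/-- The integrand of `r × [[0,1], g]` on a fibre `Fin.snoc x t`. [folklore] -/
theorem prod_iccRep_integrand_snoc {n : ℕ} (r : IntegralRep n) (g : ℝ → ℝ)
    (hg : IsSemialgebraicFunOn ℚ unitIcc (fun x => g (x 0))) (hgi : IntegrableOn g (Icc (0:ℝ) 1))
    (x : Fin n → ℝ) (t : ℝ) :
    (r.prod (iccRep g hg hgi)).integrand (Fin.snoc x t) = r.integrand x * g t := by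
  rw [IntegralRep.prod_integrand_eq]
  simp only [IntegralRep.prodFun, iccRep_integrand]
  congr 1
  · congr 1
    funext i
    exact Fin.snoc_castSucc (α := fun _ => ℝ) t x i
  · rw [natAdd_zero_eq_last, Fin.snoc_last]

/-- **ONE Newton–Leibniz move over an arbitrary base**: `[σ × [0,1], f ⊗ k] − [σ, (K 1 − K 0)·f]
∈ newtonLeibnizRel`, with primitive `F = f ⊗ K`. [cite: KontsevichZagier2001, §1.2 rule (3)] -/
theorem prod_iccRep_sub_constMul_mem_newtonLeibnizRel {n : ℕ} (r : IntegralRep n) {k K : ℝ → ℝ}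
    (hk : IsSemialgebraicFunOn ℚ unitIcc (fun x => k (x 0))) (hki : IntegrableOn k (Icc (0:ℝ) 1))
    (hK : IsSemialgebraicFunOn ℚ unitIcc (fun x => K (x 0))) (hKc : ContinuousOn K (Icc (0:ℝ) 1))
    (hKd : ∀ t ∈ Ioo (0:ℝ) 1, HasDerivAt K (k t) t) (halg : IsAlgebraic ℚ (K 1 - K 0)) :
    of (r.prod (iccRep k hk hki)) - of (r.constMul (K 1 - K 0) halg) ∈ newtonLeibnizRel := by
  have hKi : IntegrableOn K (Icc (0:ℝ) 1) := hKc.integrableOn_compact isCompact_Icc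
  refine ⟨n, r.prod (iccRep k hk hki), r.constMul (K 1 - K 0) halg, fun _ => ((0:ℕ):ℝ),
    fun _ => ((0:ℕ):ℝ) + 1, (r.prod (iccRep K hK hKi)).integrand,
    (r.prod (iccRep K hK hKi)).isSemialgebraicFunOn_integrand,
    isSemialgebraicFunOn_natCast r.isSemialgebraic_domain 0, ?_, fun _ _ => by simp, ?_, ?_, ?_, ?_,
    rfl⟩
  · exact (isSemialgebraicFunOn_aeval r.isSemialgebraic_domain
      (((0:ℕ) : MvPolynomial (Fin n) ℚ) + 1)).congr fun x _ => by simp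
  · ext z
    simp only [IntegralRep.prod_domain, IntegralRep.mem_prodDomain, iccRep_domain, mem_unitIcc,
      mem_Icc, IntegralRep.domain_constMul, mem_setOf_eq, Nat.cast_zero, zero_add,
      init_eq_comp_castAdd, natAdd_zero_eq_last]
  · intro x _
    simp only [prod_iccRep_integrand_snoc, Nat.cast_zero, zero_add]
    exact continuousOn_const.mul hKc
  · intro x _ t ht
    simp only [Nat.cast_zero, zero_add] at ht
    have hF : (fun s : ℝ => (r.prod (iccRep K hK hKi)).integrand (Fin.snoc x s)) =
        fun s => r.integrand x * K s := by
      funext s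
      exact prod_iccRep_integrand_snoc r K hK hKi x s
    rw [hF, prod_iccRep_integrand_snoc]
    exact (hKd t ht).const_mul (r.integrand x)
  · intro x _
    simp only [prod_iccRep_integrand_snoc, IntegralRep.integrand_constMul, Nat.cast_zero, zero_add]
    ring

/-- **A representation pinned with kernel `k` over `r` is equivalent to `[σ, (K 1 − K 0)·f]`**
when `k` has the `ℚ`-semialgebraic primitive `K` on `[0,1]` (congruence, commutativity of `×`,
a null boundary, and the Newton–Leibniz move). [folklore] -/
theorem equivalent_constMul_of_isPinned_of_primitive {n : ℕ} {k K : ℝ → ℝ}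
    (hk : IsSemialgebraicFunOn ℚ unitIcc (fun x => k (x 0))) (hki : IntegrableOn k (Icc (0:ℝ) 1))
    (hK : IsSemialgebraicFunOn ℚ unitIcc (fun x => K (x 0))) (hKc : ContinuousOn K (Icc (0:ℝ) 1))
    (hKd : ∀ t ∈ Ioo (0:ℝ) 1, HasDerivAt K (k t) t) (halg : IsAlgebraic ℚ (K 1 - K 0))
    {r : IntegralRep n} {q : IntegralRep (1 + n)} (hq : IsPinned k r q) :
    Equivalent q (r.constMul (K 1 - K 0) halg) := by
  set κ := iccRep k hk hki with hκ
  set κ₀ := κ.restrict unitIoo isSemialgebraic_unitIoo unitIoo_subset_unitIcc with hκ₀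
  have hp : IsPinned k r (κ₀.prod r) := isPinned_prod κ₀ rfl (fun _ _ => rfl) r
  have h1 : Equivalent q (κ₀.prod r) := by
    refine of_sub_of_mem_relations_of_eqOn (hp.1.trans hq.1.symm) fun z hz => ?_
    rw [hq.2 hz, hp.2 (hp.1.symm ▸ hq.1 ▸ hz)]
  have h2 : Equivalent (κ₀.prod r) (r.prod κ₀) := by
    have := of_mul_of_sub_of_mul_of_mem_relations κ₀ r
    rwa [of_mul_of, of_mul_of] at this
  have h3 : Equivalent (r.prod κ₀) (r.prod κ) := by
    refine Equivalent.prod (Equivalent.refl r) (Equivalent.symm ?_)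
    exact κ.of_sub_of_restrict_mem_relations isSemialgebraic_unitIoo unitIoo_subset_unitIcc
      volume_unitIcc_diff_unitIoo
  have h4 : Equivalent (r.prod κ) (r.constMul (K 1 - K 0) halg) :=
    newtonLeibnizRel_subset_relations
      (prod_iccRep_sub_constMul_mem_newtonLeibnizRel r hk hki hK hKc hKd halg)
  exact ((h1.trans h2).trans h3).trans h4

/-- **PRIMITIVE CRITERION, positive half**: if `K 1 ≠ K 0` then `KernelCancellation k`.
[folklore] -/
theorem kernelCancellation_of_primitive {k K : ℝ → ℝ}
    (hk : IsSemialgebraicFunOn ℚ unitIcc (fun x => k (x 0))) (hki : IntegrableOn k (Icc (0:ℝ) 1))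
    (hK : IsSemialgebraicFunOn ℚ unitIcc (fun x => K (x 0))) (hKc : ContinuousOn K (Icc (0:ℝ) 1))
    (hKd : ∀ t ∈ Ioo (0:ℝ) 1, HasDerivAt K (k t) t) (halg : IsAlgebraic ℚ (K 1 - K 0))
    (hc : K 1 - K 0 ≠ 0) : KernelCancellation k := by
  intro n m r r' q q' hq hq' hqq'
  have e1 := equivalent_constMul_of_isPinned_of_primitive hk hki hK hKc hKd halg hq
  have e2 := equivalent_constMul_of_isPinned_of_primitive hk hki hK hKc hKd halg hq'
  exact equivalent_of_equivalent_constMul halg hc ((e1.symm.trans hqq').trans e2)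

/-- **PRIMITIVE CRITERION, negative half**: if `K 1 = K 0` then `KernelCancellation k` FAILS
(every pinned representation is a relation; witness `[π] ≁ −[π]`). [folklore] -/
theorem not_kernelCancellation_of_primitive {k K : ℝ → ℝ}
    (hk : IsSemialgebraicFunOn ℚ unitIcc (fun x => k (x 0))) (hki : IntegrableOn k (Icc (0:ℝ) 1))
    (hK : IsSemialgebraicFunOn ℚ unitIcc (fun x => K (x 0))) (hKc : ContinuousOn K (Icc (0:ℝ) 1))
    (hKd : ∀ t ∈ Ioo (0:ℝ) 1, HasDerivAt K (k t) t) (hc : K 1 - K 0 = 0) :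
    ¬ KernelCancellation k := by
  intro h
  have halg : IsAlgebraic ℚ (K 1 - K 0) := by
    rw [hc]
    exact isAlgebraic_zero
  have key : ∀ {n : ℕ} (r : IntegralRep n) (q : IntegralRep (1 + n)), IsPinned k r q →
      of q ∈ relations := by
    intro n r q hq
    have e := equivalent_constMul_of_isPinned_of_primitive hk hki hK hKc hKd halg hq
    have hz : of (r.constMul (K 1 - K 0) halg) ∈ relations :=
      of_mem_relations_of_eqOn_zero _ fun x _ => by
        simp only [IntegralRep.integrand_constMul, hc, zero_mul, Pi.zero_apply]
    have := relations.add_mem e hz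
    rwa [sub_add_cancel] at this
  set κ₀ : IntegralRep 1 :=
    (iccRep k hk hki).restrict unitIoo isSemialgebraic_unitIoo unitIoo_subset_unitIcc with hκ₀
  have hq := isPinned_prod κ₀ rfl (fun _ _ => rfl) piRep
  have hq' := isPinned_prod κ₀ rfl (fun _ _ => rfl) piRep.neg
  exact not_equivalent_piRep_neg (h piRep piRep.neg _ _ hq hq'
    (relations.sub_mem (key _ _ hq) (key _ _ hq')))

/-- **THE PRIMITIVE CRITERION.** For a kernel `k` on `[0,1]` with a `ℚ`-semialgebraic primitive
`K ∈ C([0,1])`, `K' = k` on `(0,1)`: `KernelCancellation k ↔ K 1 ≠ K 0`. [folklore] -/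
theorem kernelCancellation_iff_of_primitive {k K : ℝ → ℝ}
    (hk : IsSemialgebraicFunOn ℚ unitIcc (fun x => k (x 0))) (hki : IntegrableOn k (Icc (0:ℝ) 1))
    (hK : IsSemialgebraicFunOn ℚ unitIcc (fun x => K (x 0))) (hKc : ContinuousOn K (Icc (0:ℝ) 1))
    (hKd : ∀ t ∈ Ioo (0:ℝ) 1, HasDerivAt K (k t) t) (halg : IsAlgebraic ℚ (K 1 - K 0)) :
    KernelCancellation k ↔ K 1 - K 0 ≠ 0 :=
  ⟨fun h hc => not_kernelCancellation_of_primitive hk hki hK hKc hKd hc h,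
    kernelCancellation_of_primitive hk hki hK hKc hKd halg⟩

/-- The criterion's value is the integral: `K 1 − K 0 = ∫₀¹ k` (FTC), so the criterion is exactly
the value condition `∫₀¹ k ≠ 0` of §3, now DECIDED INSIDE the calculus. [folklore] -/
theorem integral_eq_of_primitive {k K : ℝ → ℝ} (hki : IntegrableOn k (Icc (0:ℝ) 1))
    (hKc : ContinuousOn K (Icc (0:ℝ) 1)) (hKd : ∀ t ∈ Ioo (0:ℝ) 1, HasDerivAt K (k t) t) :
    ∫ t in Ioo (0:ℝ) 1, k t = K 1 - K 0 := by
  rw [← integral_Ioc_eq_integral_Ioo, ← intervalIntegral.integral_of_le zero_le_one]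
  exact intervalIntegral.integral_eq_sub_of_hasDerivAt_of_le zero_le_one hKc hKd
    ((intervalIntegrable_iff_integrableOn_Icc_of_le zero_le_one).2 hki)

/-- `KernelCancellation` depends only on the kernel's values on `(0,1)`. [folklore] -/
theorem kernelCancellation_congr {k k' : ℝ → ℝ} (h : EqOn k k' (Ioo (0:ℝ) 1)) :
    KernelCancellation k ↔ KernelCancellation k' := by
  have key : ∀ {k k' : ℝ → ℝ}, EqOn k k' (Ioo (0:ℝ) 1) → ∀ {n : ℕ} (r : IntegralRep n)
      (q : IntegralRep (1 + n)), IsPinned k r q → IsPinned k' r q := by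
    intro k k' h n r q hq
    refine ⟨hq.1, fun z hz => ?_⟩
    rw [hq.2 hz]
    have hz' : z (Fin.castAdd n 0) ∈ Ioo (0:ℝ) 1 := by
      rw [hq.1] at hz
      exact hz.1
    simp only [pinFun, h hz']
  constructor
  · intro hc n m r r' q q' hq hq' hqq'
    exact hc r r' q q' (key h.symm r q hq) (key h.symm r' q' hq') hqq'
  · intro hc n m r r' q q' hq hq' hqq'
    exact hc r r' q q' (key h r q hq) (key h r' q' hq') hqq'


/-! ## §13 APPLICATIONS OF THE CRITERION

(a) polynomial kernels: `KernelCancellation p ↔ ∫₀¹ p ≠ 0` (complete answer; new refuted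
kernels which are NOT odd about `1/2`: `3t² − 1`, and the EVEN `6t² − 6t + 1`);
(b) an algebraic, non-polynomial refuted kernel `(3/2)√t − 1` (primitive `t√t − t`);
(c) POSITIVE non-integer instances of the crux: `β(a,1)` and `β(1,b)` for ALL rational
`a, b > 0` (primitive `t^a/a`), so the open core of `BetaCancellation` is `a ∉ ℤ ∧ b ∉ ℤ`. -/

section Applications

open Polynomial

/-- Two representations pinned with the same kernel over the same base are equivalent.
[folklore] -/
theorem equivalent_of_isPinned_of_isPinned {n : ℕ} {k : ℝ → ℝ} {r : IntegralRep n}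
    {q q₂ : IntegralRep (1 + n)} (hq : IsPinned k r q) (hq₂ : IsPinned k r q₂) :
    Equivalent q q₂ := by
  refine of_sub_of_mem_relations_of_eqOn (hq₂.1.trans hq.1.symm) fun z hz => ?_
  rw [hq.2 hz, hq₂.2 (hq₂.1.symm ▸ hq.1 ▸ hz)]

/-- A `ℚ`-polynomial in `x 0` is a `ℚ`-semialgebraic function. [folklore] -/
theorem isSemialgebraicFunOn_polynomial_aeval {s : Set (Fin 1 → ℝ)} (hs : IsSemialgebraic ℚ s)
    (p : ℚ[X]) : IsSemialgebraicFunOn ℚ s (fun x => (Polynomial.aeval (x 0) p : ℝ)) := by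
  refine (isSemialgebraicFunOn_aeval hs
    (Polynomial.aeval (MvPolynomial.X 0 : MvPolynomial (Fin 1) ℚ) p)).congr fun x _ => ?_
  show MvPolynomial.aeval x (Polynomial.aeval (MvPolynomial.X 0) p) = Polynomial.aeval (x 0) p
  rw [← Polynomial.aeval_algHom_apply, MvPolynomial.aeval_X]

/-- **Polynomial kernels: cancellation iff non-zero integral** (`P` any primitive of `p`).
[folklore] -/
theorem kernelCancellation_polynomial_iff (p P : ℚ[X]) (hP : derivative P = p) :
    KernelCancellation (fun t => (Polynomial.aeval t p : ℝ)) ↔ P.eval 1 ≠ P.eval 0 := by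
  have hval : (Polynomial.aeval (1:ℝ) P : ℝ) - Polynomial.aeval (0:ℝ) P =
      algebraMap ℚ ℝ (P.eval 1 - P.eval 0) := by
    have h1 := Polynomial.aeval_algebraMap_apply_eq_algebraMap_eval (A := ℝ) (1:ℚ) P
    have h0 := Polynomial.aeval_algebraMap_apply_eq_algebraMap_eval (A := ℝ) (0:ℚ) P
    rw [map_one] at h1
    rw [map_zero] at h0
    rw [map_sub, h1, h0]
  have h := kernelCancellation_iff_of_primitive (k := fun t => (Polynomial.aeval t p : ℝ))
    (K := fun t => (Polynomial.aeval t P : ℝ))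
    (isSemialgebraicFunOn_polynomial_aeval isSemialgebraic_unitIcc p)
    ((Polynomial.continuous_aeval p).continuousOn.integrableOn_compact isCompact_Icc)
    (isSemialgebraicFunOn_polynomial_aeval isSemialgebraic_unitIcc P)
    (Polynomial.continuous_aeval P).continuousOn
    (fun t _ => by
      have h := Polynomial.hasDerivAt_aeval P t
      rwa [hP] at h)
    (by rw [hval]; exact isAlgebraic_algebraMap _)
  rw [h, hval, map_ne_zero_iff _ (algebraMap ℚ ℝ).injective, sub_ne_zero]

/-- **Refuted kernel `3t² − 1`** (integral `0`; NOT odd about `1/2`, so §6's one-move reflection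
argument does not apply — yet cancellation fails). [folklore] -/
theorem not_kernelCancellation_three_sq_sub_one : ¬ KernelCancellation (fun t => 3 * t ^ 2 - 1) := by
  have h := kernelCancellation_polynomial_iff (3 * Polynomial.X ^ 2 - 1) (Polynomial.X ^ 3 - Polynomial.X) (by
    simp only [derivative_sub, derivative_X_pow, derivative_X, Nat.cast_ofNat, map_ofNat])
  have hfun : (fun t : ℝ => (Polynomial.aeval t (3 * Polynomial.X ^ 2 - 1 : ℚ[X]) : ℝ)) = fun t => 3 * t ^ 2 - 1 := by
    funext t
    rw [Polynomial.aeval_def, ← Polynomial.eval_map]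
    simp
  rw [hfun] at h
  rw [h]
  norm_num

/-- **Refuted EVEN kernel `6t² − 6t + 1`** (the shifted Legendre polynomial `P₂(2t−1)`:
symmetric under `t ↦ 1 − t`, integral `0`): cancellation fails although no reflection detects it.
[folklore] -/
theorem not_kernelCancellation_legendre_two : ¬ KernelCancellation (fun t => 6 * t ^ 2 - 6 * t + 1) := by
  have h := kernelCancellation_polynomial_iff (6 * Polynomial.X ^ 2 - 6 * Polynomial.X + 1)
    (2 * Polynomial.X ^ 3 - 3 * Polynomial.X ^ 2 + Polynomial.X) (by
    simp only [derivative_add, derivative_sub, derivative_mul, derivative_X_pow, derivative_X,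
      derivative_ofNat, Nat.cast_ofNat, map_ofNat, zero_mul, zero_add]
    norm_num
    ring)
  have hfun : (fun t : ℝ => (Polynomial.aeval t (6 * Polynomial.X ^ 2 - 6 * Polynomial.X + 1 : ℚ[X]) : ℝ)) =
      fun t => 6 * t ^ 2 - 6 * t + 1 := by
    funext t
    rw [Polynomial.aeval_def, ← Polynomial.eval_map]
    simp
  rw [hfun] at h
  rw [h]
  norm_num

/-- **Calibration the other way: `2t` cancels** (integral `1 ≠ 0`), although `2t − 1` does not.
[folklore] -/
theorem kernelCancellation_two_mul : KernelCancellation (fun t => 2 * t) := by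
  have h := kernelCancellation_polynomial_iff (2 * Polynomial.X) (Polynomial.X ^ 2) (by
    simp only [derivative_X_pow, Nat.cast_ofNat, map_ofNat]
    norm_num)
  have hfun : (fun t : ℝ => (Polynomial.aeval t (2 * Polynomial.X : ℚ[X]) : ℝ)) = fun t => 2 * t := by
    funext t
    rw [Polynomial.aeval_def, ← Polynomial.eval_map]
    simp
  rw [hfun] at h
  rw [h]
  norm_num

/-- **Refuted ALGEBRAIC (non-polynomial) kernel `(3/2)√t − 1`**: primitive `t√t − t`,
integral `0`. So neither "polynomial" nor "odd" is the point: the criterion is the integral.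
[folklore] -/
theorem not_kernelCancellation_sqrt_example :
    ¬ KernelCancellation (fun t => 3 / 2 * Real.sqrt t - 1) := by
  have hx0 : IsSemialgebraicFunOn ℚ unitIcc (fun x : Fin 1 → ℝ => x 0) :=
    isSemialgebraicFunOn_apply isSemialgebraic_unitIcc 0
  have hsq : IsSemialgebraicFunOn ℚ unitIcc (fun x : Fin 1 → ℝ => Real.sqrt (x 0)) :=
    IsSemialgebraicFunOn.sqrt_holds hx0
  refine not_kernelCancellation_of_primitive (K := fun t => t * Real.sqrt t - t) ?_ ?_ ?_ ?_ ?_ ?_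
  · refine (IsSemialgebraicFunOn.sub_holds (IsSemialgebraicFunOn.mul_holds
      (isSemialgebraicFunOn_ratCast isSemialgebraic_unitIcc (3/2)) hsq)
      (isSemialgebraicFunOn_ratCast isSemialgebraic_unitIcc 1)).congr fun x _ => ?_
    simp only [Pi.sub_apply, Pi.mul_apply]
    push_cast
    ring
  · exact (Continuous.continuousOn (by fun_prop)).integrableOn_compact isCompact_Icc
  · refine (IsSemialgebraicFunOn.sub_holds (IsSemialgebraicFunOn.mul_holds hx0 hsq) hx0).congr
      fun x _ => ?_
    simp only [Pi.sub_apply, Pi.mul_apply]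
  · exact Continuous.continuousOn (by fun_prop)
  · intro t ht
    have ht0 : t ≠ 0 := ht.1.ne'
    have hst : Real.sqrt t * Real.sqrt t = t := Real.mul_self_sqrt ht.1.le
    have hs0 : Real.sqrt t ≠ 0 := (Real.sqrt_pos.2 ht.1).ne'
    have h := ((hasDerivAt_id t).mul (Real.hasDerivAt_sqrt ht0)).sub (hasDerivAt_id t)
    refine h.congr_deriv ?_
    simp only [id]
    field_simp
    nlinarith [hst]
  · simp

/-! ### Extension to the closed interval, and Euler–Mellin monomials on `(0,1)` -/

/-- **Extension by rational endpoint values**: a function on `ℝ¹` which is `ℚ`-semialgebraic on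
`(0,1)` and takes rational values `c₀`, `c₁` at `x 0 = 0`, `x 0 = 1` is `ℚ`-semialgebraic on
`[0,1]` (the graph gains two rational points). [folklore] -/
theorem isSemialgebraicFunOn_unitIcc_of_unitIoo {f : (Fin 1 → ℝ) → ℝ}
    (hf : IsSemialgebraicFunOn ℚ unitIoo f) (c₀ c₁ : ℚ)
    (h0 : ∀ x : Fin 1 → ℝ, x 0 = 0 → f x = c₀) (h1 : ∀ x : Fin 1 → ℝ, x 0 = 1 → f x = c₁) :
    IsSemialgebraicFunOn ℚ unitIcc f := by
  rw [isSemialgebraicFunOn_iff] at hf ⊢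
  have hpt : ∀ (u c : ℚ), IsSemialgebraic ℚ
      {z : Fin (1 + 1) → ℝ | (Fin.init z : Fin 1 → ℝ) 0 = (u : ℝ) ∧ z (Fin.last 1) = (c : ℝ)} := by
    intro u c
    have h1 := Literature.ModelTheory.ExponentialFields.isSemialgebraic_setOf_eval_eq_zero
      (k := ℚ) (R := ℝ) (MvPolynomial.X (Fin.castSucc (0 : Fin 1)) - MvPolynomial.C u :
        MvPolynomial (Fin (1 + 1)) ℚ)
    have h2 := Literature.ModelTheory.ExponentialFields.isSemialgebraic_setOf_eval_eq_zero
      (k := ℚ) (R := ℝ) (MvPolynomial.X (Fin.last 1) - MvPolynomial.C c : MvPolynomial (Fin (1 + 1)) ℚ)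
    convert h1.inter h2 using 1
    ext z
    simp only [mem_setOf_eq, mem_inter_iff, map_sub, MvPolynomial.aeval_X, MvPolynomial.aeval_C,
      eq_ratCast, sub_eq_zero, Fin.init]
  have hset : {z : Fin (1 + 1) → ℝ | (Fin.init z : Fin 1 → ℝ) ∈ unitIcc ∧ z (Fin.last 1) = f (Fin.init z)} =
      {z | (Fin.init z : Fin 1 → ℝ) ∈ unitIoo ∧ z (Fin.last 1) = f (Fin.init z)} ∪
      {z | (Fin.init z : Fin 1 → ℝ) 0 = ((0:ℚ):ℝ) ∧ z (Fin.last 1) = (c₀:ℝ)} ∪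
      {z | (Fin.init z : Fin 1 → ℝ) 0 = ((1:ℚ):ℝ) ∧ z (Fin.last 1) = (c₁:ℝ)} := by
    ext z
    simp only [mem_union, mem_setOf_eq, mem_unitIcc, mem_Icc, mem_unitIoo, mem_Ioo, Rat.cast_zero,
      Rat.cast_one]
    constructor
    · rintro ⟨⟨hl, hr⟩, hz⟩
      rcases hl.lt_or_eq with hl | hl
      · rcases hr.lt_or_eq with hr | hr
        · exact Or.inl (Or.inl ⟨⟨hl, hr⟩, hz⟩)
        · exact Or.inr ⟨hr, by rw [hz, h1 _ hr]⟩
      · exact Or.inl (Or.inr ⟨hl.symm, by rw [hz, h0 _ hl.symm]⟩)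
    · rintro ((⟨⟨hl, hr⟩, hz⟩ | ⟨hl, hz⟩) | ⟨hl, hz⟩)
      · exact ⟨⟨hl.le, hr.le⟩, hz⟩
      · exact ⟨⟨hl.ge, by rw [hl]; exact zero_le_one⟩, by rw [hz, h0 _ hl]⟩
      · exact ⟨⟨by rw [hl]; exact zero_le_one, hl.le⟩, by rw [hz, h1 _ hl]⟩
  rw [hset]
  exact (hf.union (hpt 0 c₀)).union (hpt 1 c₁)

/-- **Euler–Mellin monomials are `ℚ`-semialgebraic on `(0,1)`**: `x ↦ c · (x 0)^e` for rational
`c, e` (`KZ.isSemialgebraicFunOn_mellinIntegrand`). [folklore] -/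
theorem isSemialgebraicFunOn_const_mul_rpow_unitIoo (c e : ℚ) :
    IsSemialgebraicFunOn ℚ unitIoo (fun x => (c : ℝ) * (x 0) ^ ((e : ℚ) : ℝ)) := by
  refine (isSemialgebraicFunOn_mellinIntegrand isSemialgebraic_unitIoo ![MvPolynomial.X 0] ![e] c
    (fun x hx k => ?_)).congr fun x _ => ?_
  · have hk : k = 0 := Fin.fin_one_eq_zero k
    subst hk
    simpa using hx.1
  · simp [mellinIntegrand_apply]

/-- The Beta kernel is `ℚ`-semialgebraic on `(0,1)` (two Euler–Mellin factors). [folklore] -/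
theorem isSemialgebraicFunOn_betaKernel_unitIoo (a b : ℚ) :
    IsSemialgebraicFunOn ℚ unitIoo (fun x => betaKernel a b (x 0)) := by
  refine (isSemialgebraicFunOn_mellinIntegrand isSemialgebraic_unitIoo
    ![MvPolynomial.X 0, 1 - MvPolynomial.X 0] ![a - 1, b - 1] 1 (fun x hx k => ?_)).congr fun x _ => ?_
  · have hx' : 0 < x 0 ∧ x 0 < 1 := hx
    fin_cases k
    · simpa using hx'.1
    · simp only [Fin.mk_one, Matrix.cons_val_one, Matrix.cons_val_fin_one, map_sub, map_one,
        MvPolynomial.aeval_X, sub_pos]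
      exact hx'.2
  · simp [mellinIntegrand_apply, betaKernel, Fin.prod_univ_two]

/-- **`[β(a,b)] = [(0,1), t^{a-1}(1-t)^{b-1}]`** on the open interval. [folklore] -/
def betaIooRep (a b : ℚ) (ha : 0 < a) (hb : 0 < b) : IntegralRep 1 where
  domain := unitIoo
  integrand := fun x => betaKernel a b (x 0)
  isSemialgebraic_domain := isSemialgebraic_unitIoo
  isSemialgebraicFunOn_integrand := isSemialgebraicFunOn_betaKernel_unitIoo a b
  integrableOn := integrableOn_comp_apply_zero_iff.2 (integrableOn_betaKernel_and_integral_eq ha hb).1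

/-- The domain of `betaIooRep`. [folklore] -/
@[simp] theorem betaIooRep_domain (a b : ℚ) (ha : 0 < a) (hb : 0 < b) :
    (betaIooRep a b ha hb).domain = unitIoo := rfl

/-- The integrand of `betaIooRep`. [folklore] -/
@[simp] theorem betaIooRep_integrand (a b : ℚ) (ha : 0 < a) (hb : 0 < b) :
    (betaIooRep a b ha hb).integrand = fun x => betaKernel a b (x 0) := rfl

/-- `[β(a,b)] × r` is pinned over `r` with the Beta kernel. [folklore] -/
theorem isPinned_betaIooRep_prod {n : ℕ} (a b : ℚ) (ha : 0 < a) (hb : 0 < b) (r : IntegralRep n) :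
    IsPinned (betaKernel a b) r ((betaIooRep a b ha hb).prod r) :=
  isPinned_prod (betaIooRep a b ha hb) rfl (fun _ _ => rfl) r

/-- `[β(a,b)] × r ∼ [β(b,a)] × r`: ONE rule-(2) move reflecting the kernel coordinate.
[folklore] -/
theorem equivalent_betaIooRep_prod_swap {n : ℕ} (a b : ℚ) (ha : 0 < a) (hb : 0 < b)
    (r : IntegralRep n) :
    Equivalent ((betaIooRep a b ha hb).prod r) ((betaIooRep b a hb ha).prod r) := by
  refine of_sub_of_mem_relations_of_boxReflection (Fin.castAdd n 0) ?_ ?_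
  · ext z
    simp only [IntegralRep.prod_domain, IntegralRep.mem_prodDomain, betaIooRep_domain,
      mem_preimage, mem_unitIoo, tail_boxReflection]
    simp only [boxReflection, if_true, mem_Ioo]
    constructor <;> rintro ⟨⟨h1, h2⟩, h3⟩ <;> exact ⟨⟨by linarith, by linarith⟩, h3⟩
  · intro z _
    rw [IntegralRep.prod_integrand_eq, IntegralRep.prod_integrand_eq]
    simp only [IntegralRep.prodFun, betaIooRep_integrand, tail_boxReflection]
    rw [boxReflection_apply_self, betaKernel_one_sub]

/-- **Symmetry of Beta cancellation**: `KernelCancellation (β(a,b)) → KernelCancellation (β(b,a))`.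
[folklore] -/
theorem kernelCancellation_betaKernel_swap {a b : ℚ} (ha : 0 < a) (hb : 0 < b)
    (h : KernelCancellation (betaKernel a b)) : KernelCancellation (betaKernel b a) := by
  intro n m r r' q q' hq hq' hqq'
  have e1 : Equivalent ((betaIooRep a b ha hb).prod r) q :=
    (equivalent_betaIooRep_prod_swap a b ha hb r).trans
      (equivalent_of_isPinned_of_isPinned (isPinned_betaIooRep_prod b a hb ha r) hq)
  have e2 : Equivalent ((betaIooRep a b ha hb).prod r') q' :=
    (equivalent_betaIooRep_prod_swap a b ha hb r').trans
      (equivalent_of_isPinned_of_isPinned (isPinned_betaIooRep_prod b a hb ha r') hq')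
  exact h r r' _ _ (isPinned_betaIooRep_prod a b ha hb r) (isPinned_betaIooRep_prod a b ha hb r')
    ((e1.trans hqq').trans e2.symm)

/-- The power kernel `t^{a-1}` on `(0,1)`, extended by `0`. [folklore] -/
def powKernel (a : ℚ) : ℝ → ℝ := fun t => if t ∈ Ioo (0:ℝ) 1 then t ^ ((a:ℝ) - 1) else 0

/-- Its primitive `t^a / a`. [folklore] -/
def powPrim (a : ℚ) : ℝ → ℝ := fun t => t ^ (a:ℝ) / a

/-- `powKernel a = t^{a-1}` on `(0,1)`. [folklore] -/
theorem powKernel_of_mem {a : ℚ} {t : ℝ} (ht : t ∈ Ioo (0:ℝ) 1) : powKernel a t = t ^ ((a:ℝ) - 1) := by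
  simp only [powKernel, if_pos ht]

/-- `β(a,1) = powKernel a` on `(0,1)`. [folklore] -/
theorem betaKernel_one_eqOn_powKernel (a : ℚ) : EqOn (betaKernel a 1) (powKernel a) (Ioo 0 1) := by
  intro t ht
  simp only [powKernel_of_mem ht, betaKernel, Rat.cast_one, sub_self, Real.rpow_zero, mul_one]

/-- `powKernel a` is `ℚ`-semialgebraic on `[0,1]`. [folklore] -/
theorem isSemialgebraicFunOn_powKernel (a : ℚ) :
    IsSemialgebraicFunOn ℚ unitIcc (fun x : Fin 1 → ℝ => powKernel a (x 0)) := by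
  refine isSemialgebraicFunOn_unitIcc_of_unitIoo ?_ 0 0 (fun x hx => ?_) (fun x hx => ?_)
  · refine (isSemialgebraicFunOn_const_mul_rpow_unitIoo 1 (a - 1)).congr fun x hx => ?_
    have hx' : x 0 ∈ Ioo (0:ℝ) 1 := hx
    simp only [powKernel_of_mem hx', Rat.cast_one, one_mul, Rat.cast_sub]
  · have : x 0 ∉ Ioo (0:ℝ) 1 := fun h => by rw [hx] at h; exact lt_irrefl _ h.1
    simp only [powKernel, if_neg this, Rat.cast_zero]
  · have : x 0 ∉ Ioo (0:ℝ) 1 := fun h => by rw [hx] at h; exact lt_irrefl _ h.2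
    simp only [powKernel, if_neg this, Rat.cast_zero]

/-- `powKernel a` is integrable on `[0,1]` for `a > 0`. [folklore] -/
theorem integrableOn_powKernel {a : ℚ} (ha : 0 < a) : IntegrableOn (powKernel a) (Icc (0:ℝ) 1) := by
  rw [integrableOn_Icc_iff_integrableOn_Ioo]
  exact ((integrableOn_betaKernel_and_integral_eq ha one_pos).1).congr_fun
    (betaKernel_one_eqOn_powKernel a) measurableSet_Ioo

/-- `powPrim a` is `ℚ`-semialgebraic on `[0,1]` for `a > 0`. [folklore] -/
theorem isSemialgebraicFunOn_powPrim {a : ℚ} (ha : 0 < a) :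
    IsSemialgebraicFunOn ℚ unitIcc (fun x : Fin 1 → ℝ => powPrim a (x 0)) := by
  have ha' : (a:ℝ) ≠ 0 := by exact_mod_cast ha.ne'
  refine isSemialgebraicFunOn_unitIcc_of_unitIoo ?_ 0 a⁻¹ (fun x hx => ?_) (fun x hx => ?_)
  · refine (isSemialgebraicFunOn_const_mul_rpow_unitIoo a⁻¹ a).congr fun x _ => ?_
    simp only [powPrim, Rat.cast_inv]
    rw [div_eq_inv_mul]
  · simp only [powPrim, hx, Real.zero_rpow ha', zero_div, Rat.cast_zero]
  · simp only [powPrim, hx, Real.one_rpow, one_div, Rat.cast_inv]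

/-- `powPrim a` is continuous on `[0,1]` for `a > 0`. [folklore] -/
theorem continuousOn_powPrim {a : ℚ} (ha : 0 < a) : ContinuousOn (powPrim a) (Icc (0:ℝ) 1) := by
  have ha0 : (0:ℝ) ≤ a := by exact_mod_cast ha.le
  exact (continuousOn_id.rpow_const fun x _ => Or.inr ha0).div_const _

/-- `(powPrim a)' = powKernel a` on `(0,1)`. [folklore] -/
theorem hasDerivAt_powPrim {a : ℚ} (ha : 0 < a) {t : ℝ} (ht : t ∈ Ioo (0:ℝ) 1) :
    HasDerivAt (powPrim a) (powKernel a t) t := by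
  have ha' : (a:ℝ) ≠ 0 := by exact_mod_cast ha.ne'
  rw [powKernel_of_mem ht]
  have h := (Real.hasDerivAt_rpow_const (x := t) (p := (a:ℝ)) (Or.inl ht.1.ne')).div_const (a:ℝ)
  rw [mul_div_cancel_left₀ _ ha'] at h
  exact h

/-- `powPrim a 1 − powPrim a 0 = 1/a`. [folklore] -/
theorem powPrim_one_sub_powPrim_zero {a : ℚ} (ha : 0 < a) :
    powPrim a 1 - powPrim a 0 = ((a⁻¹ : ℚ) : ℝ) := by
  have ha' : (a:ℝ) ≠ 0 := by exact_mod_cast ha.ne'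
  simp only [powPrim, Real.one_rpow, Real.zero_rpow ha', zero_div, sub_zero, one_div, Rat.cast_inv]

/-- `powPrim a 1 − powPrim a 0` is algebraic. [folklore] -/
theorem isAlgebraic_powPrim_diff {a : ℚ} (ha : 0 < a) : IsAlgebraic ℚ (powPrim a 1 - powPrim a 0) := by
  rw [powPrim_one_sub_powPrim_zero ha]
  exact isAlgebraic_algebraMap (a⁻¹ : ℚ)

/-- `powPrim a 1 − powPrim a 0 ≠ 0`. [folklore] -/
theorem powPrim_diff_ne_zero {a : ℚ} (ha : 0 < a) : powPrim a 1 - powPrim a 0 ≠ 0 := by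
  rw [powPrim_one_sub_powPrim_zero ha]
  exact_mod_cast (inv_ne_zero ha.ne')

/-- **`BetaCancellation` HOLDS at `(a, 1)` for EVERY rational `a > 0`** — including non-integer
`a`: the kernel `t^{a-1}` has the `ℚ`-semialgebraic primitive `t^a / a`, `K 1 − K 0 = 1/a ≠ 0`.
[folklore] -/
theorem kernelCancellation_betaKernel_right_one {a : ℚ} (ha : 0 < a) :
    KernelCancellation (betaKernel a 1) := by
  rw [kernelCancellation_congr (betaKernel_one_eqOn_powKernel a)]
  exact kernelCancellation_of_primitive (isSemialgebraicFunOn_powKernel a) (integrableOn_powKernel ha)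
    (isSemialgebraicFunOn_powPrim ha) (continuousOn_powPrim ha) (fun t ht => hasDerivAt_powPrim ha ht)
    (isAlgebraic_powPrim_diff ha) (powPrim_diff_ne_zero ha)

/-- **`BetaCancellation` HOLDS at `(1, b)` for EVERY rational `b > 0`** (symmetry). [folklore] -/
theorem kernelCancellation_betaKernel_left_one {b : ℚ} (hb : 0 < b) :
    KernelCancellation (betaKernel 1 b) :=
  kernelCancellation_betaKernel_swap hb one_pos (kernelCancellation_betaKernel_right_one hb)

end Applications


/-! ## §14 ONE INTEGER EXPONENT SUFFICES: translation in `b`, and `β(a, B+1)`, `β(A+1, b)` PROVED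

The two-term translation `(a+b)·[β(a,b+1)] ∼ b·[β(a,b)]` is ONE Newton–Leibniz move from the
point (primitive `t^a (1−t)^b`, vanishing at both ends) plus ONE integrand-additivity move; it is
the lead's `stub_betaTranslation`, proved here. With the scalar bookkeeping of §11 it transports
`KernelCancellation` from `(a,b)` to `(a,b+1)`, so from §13(c): `BetaCancellation` HOLDS whenever
ONE of `a, b` is a positive integer (the other any positive rational). THE OPEN CORE OF THE CRUX
IS EXACTLY `a ∉ ℤ ∧ b ∉ ℤ` — e.g. `(1/2,1/2)` (`= PiCancellation`), `(1/3,1/3)`, `(1/3,2/3)`. -/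

section Translation

/-- The zero representation on the point `ℝ⁰`. [folklore] -/
def ptZeroRep : IntegralRep 0 where
  domain := univ
  integrand := 0
  isSemialgebraic_domain := isSemialgebraic_univ
  isSemialgebraicFunOn_integrand :=
    (isSemialgebraicFunOn_aeval isSemialgebraic_univ 0).congr fun x _ => by simp
  integrableOn := integrableOn_zero

/-- `[pt, 0]` is a relation. [folklore] -/
theorem of_ptZeroRep_mem_relations : of ptZeroRep ∈ relations :=
  of_mem_relations_of_eqOn_zero ptZeroRep fun _ _ => rfl

/-- Two-factor Euler–Mellin monomials `c · (x 0)^e · (1 − x 0)^{e'}` are `ℚ`-semialgebraic on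
`(0,1)`. [folklore] -/
theorem isSemialgebraicFunOn_const_mul_rpow_mul_rpow_unitIoo (c e e' : ℚ) :
    IsSemialgebraicFunOn ℚ unitIoo
      (fun x => (c : ℝ) * ((x 0) ^ ((e : ℚ) : ℝ) * (1 - x 0) ^ ((e' : ℚ) : ℝ))) := by
  refine (isSemialgebraicFunOn_mellinIntegrand isSemialgebraic_unitIoo
    ![MvPolynomial.X 0, 1 - MvPolynomial.X 0] ![e, e'] c (fun x hx k => ?_)).congr fun x _ => ?_
  · have hx' : 0 < x 0 ∧ x 0 < 1 := hx
    fin_cases k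
    · simpa using hx'.1
    · simp only [Fin.mk_one, Matrix.cons_val_one, Matrix.cons_val_fin_one, map_sub, map_one,
        MvPolynomial.aeval_X, sub_pos]
      exact hx'.2
  · simp [mellinIntegrand_apply, Fin.prod_univ_two]

/-- The derivative of `t^a (1-t)^b` inside `(0,1)`. [folklore] -/
theorem hasDerivAt_rpow_mul_one_sub_rpow {a b t : ℝ} (ht : t ∈ Ioo (0:ℝ) 1) :
    HasDerivAt (fun s : ℝ => s ^ a * (1 - s) ^ b)
      (a * t ^ (a - 1) * (1 - t) ^ b + t ^ a * (-1 * b * (1 - t) ^ (b - 1))) t := by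
  have h1 : HasDerivAt (fun s : ℝ => s ^ a) (a * t ^ (a - 1)) t :=
    Real.hasDerivAt_rpow_const (Or.inl ht.1.ne')
  have h2 : HasDerivAt (fun s : ℝ => (1 - s) ^ b) (-1 * b * (1 - t) ^ (b - 1)) t := by
    have h := ((hasDerivAt_id t).const_sub 1).rpow_const (p := b) (Or.inl (by simp only [id]; linarith [ht.2]))
    simpa using h
  exact h1.mul h2

/-- **The translation `(a+b)·[β(a,b+1)] ∼ b·[β(a,b)]`** (one Newton–Leibniz move with primitive
`t^a(1−t)^b` from the point, one integrand-additivity move) — the lead's `stub_betaTranslation`.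
[folklore] -/
theorem betaTranslation (a b : ℚ) (ha : 0 < a) (hb : 0 < b)
    (ρ ρ' : IntegralRep 1)
    (hρd : ρ.domain = {x | x 0 ∈ Set.Ioo (0:ℝ) 1})
    (hρi : Set.EqOn ρ.integrand (fun x => ((a:ℝ) + b) * ((x 0) ^ ((a:ℝ) - 1) * (1 - x 0) ^ (b:ℝ)))
      ρ.domain)
    (hρ'd : ρ'.domain = {x | x 0 ∈ Set.Ioo (0:ℝ) 1})
    (hρ'i : Set.EqOn ρ'.integrand (fun x => (b:ℝ) * ((x 0) ^ ((a:ℝ) - 1) * (1 - x 0) ^ ((b:ℝ) - 1)))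
      ρ'.domain) :
    Equivalent ρ ρ' := by
  have ha' : (a:ℝ) ≠ 0 := by exact_mod_cast ha.ne'
  have hb' : (b:ℝ) ≠ 0 := by exact_mod_cast hb.ne'
  have hb1 : 0 < b + 1 := by linarith
  have ha1 : 0 < a + 1 := by linarith
  -- the derivative of the primitive, extended by `0` to the closed interval
  set g : ℝ → ℝ := fun t => if t ∈ Ioo (0:ℝ) 1 then
      (a:ℝ) * t ^ ((a:ℝ) - 1) * (1 - t) ^ (b:ℝ) + t ^ (a:ℝ) * (-1 * (b:ℝ) * (1 - t) ^ ((b:ℝ) - 1))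
    else 0 with hgdef
  have hg_eq : EqOn g (fun t => (a:ℝ) * betaKernel a (b + 1) t + (-(b:ℝ)) * betaKernel (a + 1) b t)
      (Ioo 0 1) := by
    intro t ht
    simp only [hgdef, if_pos ht, betaKernel, Rat.cast_add, Rat.cast_one, add_sub_cancel_right]
    ring
  have hgi : IntegrableOn g (Icc (0:ℝ) 1) := by
    rw [integrableOn_Icc_iff_integrableOn_Ioo]
    refine IntegrableOn.congr_fun ?_ hg_eq.symm measurableSet_Ioo
    exact ((integrableOn_betaKernel_and_integral_eq ha hb1).1.const_mul _).add
      ((integrableOn_betaKernel_and_integral_eq ha1 hb).1.const_mul _)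
  have hg_sa : IsSemialgebraicFunOn ℚ unitIcc (fun x : Fin 1 → ℝ => g (x 0)) := by
    refine isSemialgebraicFunOn_unitIcc_of_unitIoo ?_ 0 0 (fun x hx => ?_) (fun x hx => ?_)
    · refine (IsSemialgebraicFunOn.add_holds
        (isSemialgebraicFunOn_const_mul_rpow_mul_rpow_unitIoo a (a - 1) b)
        (isSemialgebraicFunOn_const_mul_rpow_mul_rpow_unitIoo (-b) a (b - 1))).congr fun x hx => ?_
      have hx' : x 0 ∈ Ioo (0:ℝ) 1 := hx
      simp only [hgdef, if_pos hx', Pi.add_apply, Rat.cast_sub, Rat.cast_one, Rat.cast_neg]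
      ring
    · have : x 0 ∉ Ioo (0:ℝ) 1 := fun h => by rw [hx] at h; exact lt_irrefl _ h.1
      simp only [hgdef, if_neg this, Rat.cast_zero]
    · have : x 0 ∉ Ioo (0:ℝ) 1 := fun h => by rw [hx] at h; exact lt_irrefl _ h.2
      simp only [hgdef, if_neg this, Rat.cast_zero]
  -- the band `[[0,1], g]` and the primitive `F = t^a (1-t)^b`
  set D : IntegralRep 1 := iccRep g hg_sa hgi with hD
  have hF_sa : IsSemialgebraicFunOn ℚ unitIcc (fun z : Fin 1 → ℝ => (z 0) ^ (a:ℝ) * (1 - z 0) ^ (b:ℝ)) := by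
    refine isSemialgebraicFunOn_unitIcc_of_unitIoo ?_ 0 0 (fun x hx => ?_) (fun x hx => ?_)
    · exact (isSemialgebraicFunOn_const_mul_rpow_mul_rpow_unitIoo 1 a b).congr fun x _ => by
        simp only [Rat.cast_one, one_mul]
    · simp only [hx, Real.zero_rpow ha', zero_mul, Rat.cast_zero]
    · simp only [hx, sub_self, Real.zero_rpow hb', mul_zero, Rat.cast_zero]
  have hNL : of D - of ptZeroRep ∈ newtonLeibnizRel := by
    refine ⟨0, D, ptZeroRep, fun _ => ((0:ℕ):ℝ), fun _ => ((0:ℕ):ℝ) + 1,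
      fun z => (z (Fin.last 0)) ^ (a:ℝ) * (1 - z (Fin.last 0)) ^ (b:ℝ), hF_sa,
      isSemialgebraicFunOn_natCast isSemialgebraic_univ 0, ?_, fun _ _ => by simp, ?_, ?_, ?_, ?_,
      rfl⟩
    · exact (isSemialgebraicFunOn_aeval isSemialgebraic_univ
        (((0:ℕ) : MvPolynomial (Fin 0) ℚ) + 1)).congr fun x _ => by simp
    · ext z
      simp only [hD, iccRep_domain, ptZeroRep, mem_univ, true_and, mem_setOf_eq, Nat.cast_zero,
        zero_add]
      rfl
    · intro x _
      simp only [Fin.snoc_last, Nat.cast_zero, zero_add]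
      exact ((continuousOn_id.rpow_const fun t _ => Or.inr (by positivity)).mul
        ((continuousOn_const.sub continuousOn_id).rpow_const fun t _ => Or.inr (by positivity)))
    · intro x _ t ht
      simp only [Nat.cast_zero, zero_add] at ht
      simp only [Fin.snoc_last, hD, iccRep_integrand]
      rw [show (0 : Fin 1) = Fin.last 0 from rfl, Fin.snoc_last]
      have hgt : g t = (a:ℝ) * t ^ ((a:ℝ) - 1) * (1 - t) ^ (b:ℝ) +
          t ^ (a:ℝ) * (-1 * (b:ℝ) * (1 - t) ^ ((b:ℝ) - 1)) := by simp only [hgdef, if_pos ht]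
      rw [hgt]
      exact hasDerivAt_rpow_mul_one_sub_rpow ht
    · intro x _
      simp only [ptZeroRep, Pi.zero_apply, Fin.snoc_last, Nat.cast_zero, zero_add, Real.one_rpow,
        sub_self, Real.zero_rpow hb', Real.zero_rpow ha', mul_zero, zero_mul, sub_zero]
  have hD_mem : of D ∈ relations := by
    have := relations.add_mem (newtonLeibnizRel_subset_relations hNL) of_ptZeroRep_mem_relations
    rwa [sub_add_cancel] at this
  -- its open restriction
  set D₀ := D.restrict unitIoo isSemialgebraic_unitIoo unitIoo_subset_unitIcc with hD₀
  have hD₀_mem : of D₀ ∈ relations := by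
    have h1 := D.of_sub_of_restrict_mem_relations isSemialgebraic_unitIoo unitIoo_subset_unitIcc
      volume_unitIcc_diff_unitIoo
    have := relations.sub_mem hD_mem h1
    rwa [sub_sub_cancel] at this
  -- integrand additivity on (0,1): ρ = D₀ + ρ'
  have hadd : of ρ - of D₀ - of ρ' ∈ integrandAddRel := by
    refine ⟨1, ρ, D₀, ρ', by rw [hρd]; rfl, by rw [hρ'd, hρd], fun x hx => ?_, rfl⟩
    have hx' : x 0 ∈ Ioo (0:ℝ) 1 := by rw [hρd] at hx; exact hx
    have hxρ' : x ∈ ρ'.domain := by rw [hρ'd]; exact hx'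
    rw [Pi.add_apply, hρi hx, hρ'i hxρ']
    simp only [hD₀, IntegralRep.integrand_restrict, hD, iccRep_integrand, hgdef, if_pos hx']
    have ht0 : (x 0) ≠ 0 := hx'.1.ne'
    have h1t : (1 - x 0) ≠ 0 := (sub_pos.2 hx'.2).ne'
    have e1 : (x 0) ^ (a:ℝ) = (x 0) ^ ((a:ℝ) - 1) * x 0 := by
      rw [Real.rpow_sub_one ht0, div_mul_cancel₀ _ ht0]
    have e2 : (1 - x 0) ^ (b:ℝ) = (1 - x 0) ^ ((b:ℝ) - 1) * (1 - x 0) := by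
      rw [Real.rpow_sub_one h1t, div_mul_cancel₀ _ h1t]
    rw [e1, e2]
    ring
  have := relations.add_mem (integrandAddRel_subset_relations hadd) hD₀_mem
  have h' : of ρ - of D₀ - of ρ' + of D₀ = of ρ - of ρ' := by abel
  rw [h'] at this
  exact this

/-- Scaling the first factor of a product scales the product. [folklore] -/
theorem constMul_prod_eq {l n : ℕ} (t : IntegralRep l) (r : IntegralRep n) {c : ℝ}
    (hc : IsAlgebraic ℚ c) : (t.constMul c hc).prod r = (t.prod r).constMul c hc := by
  refine IntegralRep.ext' rfl ?_
  rw [IntegralRep.prod_integrand_eq, IntegralRep.integrand_constMul, IntegralRep.prod_integrand_eq]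
  funext z
  simp only [IntegralRep.prodFun, IntegralRep.integrand_constMul, mul_assoc]

/-- **Translation of cancellation**: `KernelCancellation (β(a,b)) → KernelCancellation (β(a,b+1))`
(`betaTranslation` + the scalar bookkeeping of §11; no division in the group is needed). [folklore] -/
theorem kernelCancellation_betaKernel_succ_right {a b : ℚ} (ha : 0 < a) (hb : 0 < b)
    (h : KernelCancellation (betaKernel a b)) : KernelCancellation (betaKernel a (b + 1)) := by
  intro n m r r' q q' hq hq' hqq'
  have hb1 : 0 < b + 1 := by linarith
  have hab : IsAlgebraic ℚ ((a:ℝ) + b) := by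
    have := isAlgebraic_algebraMap (R := ℚ) (A := ℝ) (a + b)
    simpa using this
  have hbalg : IsAlgebraic ℚ ((b:ℚ):ℝ) := isAlgebraic_algebraMap b
  have hb0 : ((b:ℚ):ℝ) ≠ 0 := by exact_mod_cast hb.ne'
  set ρ := (betaIooRep a (b + 1) ha hb1).constMul ((a:ℝ) + b) hab with hρ
  set ρ' := (betaIooRep a b ha hb).constMul ((b:ℚ):ℝ) hbalg with hρ'
  have hρρ' : Equivalent ρ ρ' := by
    refine betaTranslation a b ha hb ρ ρ' rfl (fun x _ => ?_) rfl (fun x _ => ?_)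
    · simp only [hρ, IntegralRep.integrand_constMul, betaIooRep_integrand, betaKernel, Rat.cast_add,
        Rat.cast_one, add_sub_cancel_right]
    · simp only [hρ', IntegralRep.integrand_constMul, betaIooRep_integrand, betaKernel]
  have chain : ∀ {k : ℕ} (σ : IntegralRep k) (p : IntegralRep (1 + k)),
      IsPinned (betaKernel a (b + 1)) σ p →
      Equivalent (p.constMul ((a:ℝ) + b) hab)
        (((betaIooRep a b ha hb).prod σ).constMul ((b:ℚ):ℝ) hbalg) := by
    intro k σ p hp
    have e1 := (equivalent_of_isPinned_of_isPinned hp (isPinned_betaIooRep_prod a (b + 1) ha hb1 σ)).constMul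
      ((a:ℝ) + b) hab
    rw [← constMul_prod_eq] at e1
    have e2 : Equivalent (ρ.prod σ) (ρ'.prod σ) := Equivalent.prod hρρ' (Equivalent.refl σ)
    rw [hρ', constMul_prod_eq (betaIooRep a b ha hb) σ hbalg] at e2
    exact e1.trans e2
  have h1 := ((chain r q hq).symm.trans (hqq'.constMul _ hab)).trans (chain r' q' hq')
  have h2 := equivalent_of_equivalent_constMul hbalg hb0 h1
  exact h r r' _ _ (isPinned_betaIooRep_prod a b ha hb r) (isPinned_betaIooRep_prod a b ha hb r') h2

/-- **`BetaCancellation` HOLDS at `(a, B+1)`** for every rational `a > 0` and `B ∈ ℕ`. [folklore] -/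
theorem kernelCancellation_betaKernel_nat_right {a : ℚ} (ha : 0 < a) (B : ℕ) :
    KernelCancellation (betaKernel a ((B:ℚ) + 1)) := by
  induction B with
  | zero => simpa using kernelCancellation_betaKernel_right_one ha
  | succ B ih =>
    have h := kernelCancellation_betaKernel_succ_right ha (by positivity) ih
    push_cast at h ⊢
    exact h

/-- **`BetaCancellation` HOLDS at `(A+1, b)`** for every rational `b > 0` and `A ∈ ℕ`. [folklore] -/
theorem kernelCancellation_betaKernel_nat_left {b : ℚ} (hb : 0 < b) (A : ℕ) :
    KernelCancellation (betaKernel ((A:ℚ) + 1) b) :=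
  kernelCancellation_betaKernel_swap hb (by positivity) (kernelCancellation_betaKernel_nat_right hb A)

/-- **ONE INTEGER EXPONENT SUFFICES**: if `a` or `b` is a positive integer (the other any positive
rational), `KernelCancellation (β(a,b))` holds. The open core of the crux is `a ∉ ℤ ∧ b ∉ ℤ`.
[folklore] -/
theorem kernelCancellation_betaKernel_of_int_or_int {a b : ℚ} (ha : 0 < a) (hb : 0 < b)
    (h : (∃ A : ℕ, a = A + 1) ∨ (∃ B : ℕ, b = B + 1)) : KernelCancellation (betaKernel a b) := by
  rcases h with ⟨A, rfl⟩ | ⟨B, rfl⟩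
  · exact kernelCancellation_betaKernel_nat_left hb A
  · exact kernelCancellation_betaKernel_nat_right ha B

/-- The same in the crux's literal shape: `BetaCancellation` restricted to parameters one of which
is a positive integer is a THEOREM. [folklore] -/
theorem betaCancellation_of_int_or_int (a b : ℚ) (ha : 0 < a) (hb : 0 < b)
    (h : (∃ A : ℕ, a = A + 1) ∨ (∃ B : ℕ, b = B + 1)) :
    ∀ ⦃n m : ℕ⦄ (r : IntegralRep n) (r' : IntegralRep m) (q : IntegralRep (1 + n))
      (q' : IntegralRep (1 + m)),
    q.domain = {z | z (Fin.castAdd n 0) ∈ Set.Ioo (0:ℝ) 1 ∧ (fun j => z (Fin.natAdd 1 j)) ∈ r.domain} →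
    Set.EqOn q.integrand (fun z => (z (Fin.castAdd n 0)) ^ ((a:ℝ) - 1) *
      (1 - z (Fin.castAdd n 0)) ^ ((b:ℝ) - 1) * r.integrand (fun j => z (Fin.natAdd 1 j))) q.domain →
    q'.domain = {z | z (Fin.castAdd m 0) ∈ Set.Ioo (0:ℝ) 1 ∧ (fun j => z (Fin.natAdd 1 j)) ∈ r'.domain} →
    Set.EqOn q'.integrand (fun z => (z (Fin.castAdd m 0)) ^ ((a:ℝ) - 1) *
      (1 - z (Fin.castAdd m 0)) ^ ((b:ℝ) - 1) * r'.integrand (fun j => z (Fin.natAdd 1 j))) q'.domain →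
    Equivalent q q' → Equivalent r r' :=
  fun _ _ r r' q q' hd hi hd' hi' hqq' =>
    kernelCancellation_betaKernel_of_int_or_int ha hb h r r' q q' ⟨hd, hi⟩ ⟨hd', hi'⟩ hqq'

/-- **Parameters reduce to their fractional parts, UNCONDITIONALLY in `b`**:
`KernelCancellation (β(a,b₀)) → KernelCancellation (β(a, b₀ + k))`. With the swap, the crux for
all `(a,b)` follows from the instances `(a₀,b₀) ∈ (0,1]²`; no torsion hypothesis intervenes
(correcting gen 1's briefing). [folklore] -/
theorem kernelCancellation_betaKernel_add_nat {a b : ℚ} (ha : 0 < a) (hb : 0 < b)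
    (h : KernelCancellation (betaKernel a b)) (k : ℕ) : KernelCancellation (betaKernel a (b + k)) := by
  induction k with
  | zero => simpa using h
  | succ k ih =>
    have := kernelCancellation_betaKernel_succ_right ha (by positivity) ih
    push_cast
    rwa [← add_assoc]


/-- **Translation is an EQUIVALENCE**: `KernelCancellation (β(a,b)) ↔ KernelCancellation (β(a,b+1))`
(the converse transports through `b·[β(a,b)] ∼ (a+b)·[β(a,b+1)]` the same way). So the truth value
of the crux is constant on `(a + ℕ) × (b + ℕ)`. [folklore] -/
theorem kernelCancellation_betaKernel_succ_right_iff {a b : ℚ} (ha : 0 < a) (hb : 0 < b) :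
    KernelCancellation (betaKernel a b) ↔ KernelCancellation (betaKernel a (b + 1)) := by
  refine ⟨kernelCancellation_betaKernel_succ_right ha hb, fun h => ?_⟩
  intro n m r r' q q' hq hq' hqq'
  have hb1 : 0 < b + 1 := by linarith
  have hab : IsAlgebraic ℚ ((a:ℝ) + b) := by
    have := isAlgebraic_algebraMap (R := ℚ) (A := ℝ) (a + b)
    simpa using this
  have hab0 : (a:ℝ) + b ≠ 0 := by positivity
  have hbalg : IsAlgebraic ℚ ((b:ℚ):ℝ) := isAlgebraic_algebraMap b
  set ρ := (betaIooRep a (b + 1) ha hb1).constMul ((a:ℝ) + b) hab with hρ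
  set ρ' := (betaIooRep a b ha hb).constMul ((b:ℚ):ℝ) hbalg with hρ'
  have hρρ' : Equivalent ρ ρ' := by
    refine betaTranslation a b ha hb ρ ρ' rfl (fun x _ => ?_) rfl (fun x _ => ?_)
    · simp only [hρ, IntegralRep.integrand_constMul, betaIooRep_integrand, betaKernel, Rat.cast_add,
        Rat.cast_one, add_sub_cancel_right]
    · simp only [hρ', IntegralRep.integrand_constMul, betaIooRep_integrand, betaKernel]
  -- from (a,b)-pinned data to (a,b+1)-products, scaled
  have chain : ∀ {k : ℕ} (σ : IntegralRep k) (p : IntegralRep (1 + k)),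
      IsPinned (betaKernel a b) σ p →
      Equivalent (p.constMul ((b:ℚ):ℝ) hbalg)
        (((betaIooRep a (b + 1) ha hb1).prod σ).constMul ((a:ℝ) + b) hab) := by
    intro k σ p hp
    have e1 := (equivalent_of_isPinned_of_isPinned hp (isPinned_betaIooRep_prod a b ha hb σ)).constMul
      ((b:ℚ):ℝ) hbalg
    rw [← constMul_prod_eq] at e1
    have e2 : Equivalent (ρ'.prod σ) (ρ.prod σ) := Equivalent.prod hρρ'.symm (Equivalent.refl σ)
    rw [hρ, constMul_prod_eq (betaIooRep a (b + 1) ha hb1) σ hab] at e2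
    exact e1.trans e2
  have h1 := ((chain r q hq).symm.trans (hqq'.constMul _ hbalg)).trans (chain r' q' hq')
  have h2 := equivalent_of_equivalent_constMul hab hab0 h1
  exact h r r' _ _ (isPinned_betaIooRep_prod a (b + 1) ha hb1 r)
    (isPinned_betaIooRep_prod a (b + 1) ha hb1 r') h2

/-- Every positive rational is `b₀ + k` with `b₀ ∈ (0,1]` and `k ∈ ℕ`. [folklore] -/
theorem exists_frac_add_nat {b : ℚ} (hb : 0 < b) :
    ∃ (b₀ : ℚ) (k : ℕ), 0 < b₀ ∧ b₀ ≤ 1 ∧ b = b₀ + k := by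
  have h1 : (1:ℤ) ≤ ⌈b⌉ := Int.one_le_ceil_iff.2 hb
  have h2 : (((⌈b⌉ - 1).toNat : ℕ) : ℚ) = ((⌈b⌉ : ℤ) : ℚ) - 1 := by
    have := Int.toNat_of_nonneg (sub_nonneg.2 h1)
    exact_mod_cast this
  refine ⟨b - ((⌈b⌉ - 1).toNat : ℕ), (⌈b⌉ - 1).toNat, ?_, ?_, by ring⟩
  · rw [h2]
    have := Int.ceil_lt_add_one b
    linarith
  · rw [h2]
    have := Int.le_ceil b
    linarith

/-- **REDUCTION TO THE UNIT SQUARE, UNCONDITIONAL**: `BetaCancellation` holds iff it holds for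
all `(a,b) ∈ ((0,1] ∩ ℚ)²` (translations in `b`, the swap, translations in `a`, the swap). With
§13–§14 the boundary `a = 1 ∨ b = 1` of that square is PROVED, so the crux is exactly its open
interior `(0,1)²`, on whose anti-diagonal it is `PiCancellation` (§17). [folklore] -/
theorem betaCancellation_iff_unitSquare :
    BetaCancellation ↔ ∀ a b : ℚ, 0 < a → a ≤ 1 → 0 < b → b ≤ 1 → KernelCancellation (betaKernel a b) := by
  rw [betaCancellation_iff]
  refine ⟨fun h a b ha _ hb _ => h a b ha hb, fun h a b ha hb => ?_⟩
  obtain ⟨a₀, A, ha0, ha1, rfl⟩ := exists_frac_add_nat ha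
  obtain ⟨b₀, B, hb0, hb1, rfl⟩ := exists_frac_add_nat hb
  have h1 : KernelCancellation (betaKernel a₀ (b₀ + B)) :=
    kernelCancellation_betaKernel_add_nat ha0 hb0 (h a₀ b₀ ha0 ha1 hb0 hb1) B
  have h2 : KernelCancellation (betaKernel (b₀ + B) (a₀ + A)) :=
    kernelCancellation_betaKernel_add_nat (by positivity) ha0 (kernelCancellation_betaKernel_swap ha0 (by positivity) h1) A
  exact kernelCancellation_betaKernel_swap (by positivity) (by positivity) h2

end Translation


/-! ## §15 THE TWO DIRICHLET CHARTS of line dirichlet-companion-to-pi (targets `stub_dirichletLinear`, `stub_dirichletPolar`): single rule-(2) moves, PROVED -/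

section DirichletCharts

/-- The open unit box `(0,1)²`, in the stubs' spelling. [folklore] -/
def box2 : Set (Fin 2 → ℝ) := {z | z 0 ∈ Set.Ioo (0:ℝ) 1 ∧ z 1 ∈ Set.Ioo (0:ℝ) 1}

/-- The open standard simplex `{x > 0, y > 0, x + y < 1}`, in the stubs' spelling. [folklore] -/
def simplex2 : Set (Fin 2 → ℝ) := {z | 0 < z 0 ∧ 0 < z 1 ∧ z 0 + z 1 < 1}

/-- The box is the open unit box `{x | ∀ i, x i ∈ (0,1)}`. [folklore] -/
theorem box2_eq : box2 = {x : Fin 2 → ℝ | ∀ j, x j ∈ Set.Ioo (0:ℝ) 1} := by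
  ext x
  simp only [box2, mem_setOf_eq, Fin.forall_fin_two]

/-- The describing polynomials of the simplex. [folklore] -/
def simplexPolys : Fin 3 → MvPolynomial (Fin 2) ℚ := ![X 0, X 1, 1 - X 0 - X 1]

/-- The simplex is cut out by `simplexPolys > 0`. [folklore] -/
theorem simplex2_eq : simplex2 = {x | ∀ l, 0 < aeval x (simplexPolys l)} := by
  ext x
  simp only [simplex2, mem_setOf_eq, Fin.forall_fin_succ, simplexPolys, Matrix.cons_val_zero,
    Matrix.cons_val_succ, map_sub, map_one, MvPolynomial.aeval_X]
  constructor
  · rintro ⟨h0, h1, h2⟩; exact ⟨h0, h1, by linarith, fun i => Fin.elim0 i⟩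
  · rintro ⟨h0, h1, h2, -⟩; exact ⟨h0, h1, by linarith⟩

/-- The box is `ℚ`-semialgebraic. [folklore] -/
theorem isSemialgebraic_box2 : IsSemialgebraic ℚ box2 := by
  rw [box2_eq]; exact KZ.isSemialgebraic_box 2

/-- The simplex is `ℚ`-semialgebraic. [folklore] -/
theorem isSemialgebraic_simplex2 : IsSemialgebraic ℚ simplex2 := by
  rw [simplex2_eq]; exact isSemialgebraic_setOf_forall_aeval_pos _

/-- The box is measurable. [folklore] -/
theorem measurableSet_box2 : MeasurableSet box2 :=
  Literature.ModelTheory.ExponentialFields.IsSemialgebraic.measurableSet_holds isSemialgebraic_box2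

/-! ### The linear chart `Ψ(t,x) = (x, (1-x)t)` of the simplex by the box -/

/-- The linear chart `Ψ(t, x) = (x, (1 - x)t)` (affine in each fibre). [folklore] -/
def Ψ (z : Fin 2 → ℝ) : Fin 2 → ℝ := ![z 1, (1 - z 1) * z 0]

/-- First component. [folklore] -/
@[simp] theorem Ψ_apply_zero (z : Fin 2 → ℝ) : Ψ z 0 = z 1 := rfl

/-- Second component. [folklore] -/
@[simp] theorem Ψ_apply_one (z : Fin 2 → ℝ) : Ψ z 1 = (1 - z 1) * z 0 := rfl

/-- The Jacobian matrix of `Ψ`. [folklore] -/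
def jacΨ (z : Fin 2 → ℝ) : Matrix (Fin 2) (Fin 2) ℝ := !![0, 1; 1 - z 1, -(z 0)]

/-- The derivative of `Ψ`. [folklore] -/
def Ψ' (z : Fin 2 → ℝ) : (Fin 2 → ℝ) →L[ℝ] (Fin 2 → ℝ) :=
  LinearMap.toContinuousLinearMap (Matrix.toLin' (jacΨ z))

/-- The derivative applied to a vector, first component. [folklore] -/
@[simp] theorem Ψ'_apply_zero (z v : Fin 2 → ℝ) : Ψ' z v 0 = v 1 := by
  change Matrix.toLin' (jacΨ z) v 0 = _
  rw [Matrix.toLin'_apply]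
  simp [jacΨ, Matrix.mulVec, dotProduct, Fin.sum_univ_two]

/-- The derivative applied to a vector, second component. [folklore] -/
@[simp] theorem Ψ'_apply_one (z v : Fin 2 → ℝ) : Ψ' z v 1 = (1 - z 1) * v 0 + -(z 0) * v 1 := by
  change Matrix.toLin' (jacΨ z) v 1 = _
  rw [Matrix.toLin'_apply]
  simp [jacΨ, Matrix.mulVec, dotProduct, Fin.sum_univ_two]

/-- `det DΨ = -(1 - x)`. [folklore] -/
theorem det_Ψ' (z : Fin 2 → ℝ) : (Ψ' z).det = -(1 - z 1) := by
  change LinearMap.det (Matrix.toLin' (jacΨ z)) = _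
  rw [LinearMap.det_toLin', Matrix.det_fin_two]
  simp [jacΨ]

/-- `|det DΨ| = 1 - x` on the box. [folklore] -/
theorem abs_det_Ψ' {z : Fin 2 → ℝ} (hz : z ∈ box2) : |(Ψ' z).det| = 1 - z 1 := by
  rw [det_Ψ', abs_neg, abs_of_pos (sub_pos.2 hz.2.2)]

/-- `Ψ` is differentiable with derivative `Ψ'`. [folklore] -/
theorem hasFDerivAt_Ψ (z : Fin 2 → ℝ) : HasFDerivAt Ψ (Ψ' z) z := by
  have h0 : HasFDerivAt (fun y : Fin 2 → ℝ => y 0)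
      (ContinuousLinearMap.proj (R := ℝ) (φ := fun _ : Fin 2 => ℝ) 0) z := hasFDerivAt_apply 0 z
  have h1 : HasFDerivAt (fun y : Fin 2 → ℝ => y 1)
      (ContinuousLinearMap.proj (R := ℝ) (φ := fun _ : Fin 2 => ℝ) 1) z := hasFDerivAt_apply 1 z
  rw [hasFDerivAt_pi']
  refine Fin.forall_fin_two.mpr ⟨?_, ?_⟩
  · have hf : (fun y : Fin 2 → ℝ => Ψ y 0) = fun y => y 1 := funext fun y => rfl
    rw [hf]
    refine h1.congr_fderiv (ContinuousLinearMap.ext fun v => ?_)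
    simp
  · have hf : (fun y : Fin 2 → ℝ => Ψ y 1) = fun y => (1 - y 1) * y 0 := funext fun y => rfl
    rw [hf]
    refine ((h1.const_sub 1).mul h0).congr_fderiv (ContinuousLinearMap.ext fun v => ?_)
    simp

/-- `Ψ` is injective on the box. [folklore] -/
theorem injOn_Ψ : InjOn Ψ box2 := by
  intro x hx y hy hxy
  have h1 : x 1 = y 1 := by
    have := congrFun hxy 0
    simpa using this
  have h0 : x 0 = y 0 := by
    have := congrFun hxy 1
    simp only [Ψ_apply_one, h1] at this
    have hne : (1 - y 1 : ℝ) ≠ 0 := (sub_pos.2 hy.2.2).ne'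
    exact mul_left_cancel₀ hne this
  funext i
  fin_cases i
  · exact h0
  · exact h1

/-- `Ψ` maps the box ONTO the simplex. [folklore] -/
theorem image_Ψ_box2 : Ψ '' box2 = simplex2 := by
  ext y
  constructor
  · rintro ⟨z, ⟨h0, h1⟩, rfl⟩
    refine ⟨by simpa using h1.1, by simpa using mul_pos (sub_pos.2 h1.2) h0.1, ?_⟩
    simp only [Ψ_apply_zero, Ψ_apply_one]
    nlinarith [h0.2, sub_pos.2 h1.2]
  · rintro ⟨hy0, hy1, hy2⟩
    have h3 : 0 < 1 - y 0 := by linarith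
    refine ⟨![y 1 / (1 - y 0), y 0], ⟨?_, ?_⟩, ?_⟩
    · change y 1 / (1 - y 0) ∈ Ioo (0:ℝ) 1
      exact ⟨div_pos hy1 h3, by rw [div_lt_one h3]; linarith⟩
    · change y 0 ∈ Ioo (0:ℝ) 1
      exact ⟨hy0, by linarith⟩
    · funext i
      fin_cases i
      · rfl
      · change (1 - y 0) * (y 1 / (1 - y 0)) = y 1
        field_simp

/-- The substitution polynomials of `Ψ`. [folklore] -/
def substΨ : Fin 2 → MvPolynomial (Fin 2) ℚ := ![X 1, (1 - X 1) * X 0]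

/-- Evaluating the substitution is the chart. [folklore] -/
theorem aeval_substΨ (z : Fin 2 → ℝ) : (fun i => aeval z (substΨ i)) = Ψ z := by
  funext i
  fin_cases i
  · simp [substΨ]
  · simp [substΨ]

/-- `Ψ` is a `ℚ`-semialgebraic map on the box (a polynomial map). [folklore] -/
theorem isSemialgebraicMapOn_Ψ : IsSemialgebraicMapOn ℚ box2 Ψ := by
  convert isSemialgebraicMapOn_aeval isSemialgebraic_box2 substΨ using 2 with z
  exact (aeval_substΨ z).symm

/-- **The pull-back identity of the linear chart**: on the box,
`(x^{ℓ-1} y^{m-1} (1-x-y)^{-m}) ∘ Ψ · |det DΨ| = t^{m-1}(1-t)^{-m} x^{ℓ-1}`. [folklore] -/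
theorem pullback_Ψ (ℓ m : ℚ) {z : Fin 2 → ℝ} (hz : z ∈ box2) :
    (Ψ z 0) ^ ((ℓ:ℝ) - 1) * (Ψ z 1) ^ ((m:ℝ) - 1) * (1 - Ψ z 0 - Ψ z 1) ^ (-(m:ℝ)) * |(Ψ' z).det| =
      (z 0) ^ ((m:ℝ) - 1) * (1 - z 0) ^ (-(m:ℝ)) * (z 1) ^ ((ℓ:ℝ) - 1) := by
  have ht0 : 0 < z 0 := hz.1.1
  have ht1 : 0 < 1 - z 0 := sub_pos.2 hz.1.2
  have hx1 : 0 < 1 - z 1 := sub_pos.2 hz.2.2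
  rw [abs_det_Ψ' hz]
  simp only [Ψ_apply_zero, Ψ_apply_one]
  have hfac : 1 - z 1 - (1 - z 1) * z 0 = (1 - z 1) * (1 - z 0) := by ring
  rw [hfac, Real.mul_rpow hx1.le ht0.le, Real.mul_rpow hx1.le ht1.le]
  have key : (1 - z 1) ^ ((m:ℝ) - 1) * (1 - z 1) ^ (-(m:ℝ)) * (1 - z 1) = 1 := by
    rw [← Real.rpow_add hx1, show (m:ℝ) - 1 + -(m:ℝ) = -1 by ring, Real.rpow_neg_one,
      inv_mul_cancel₀ hx1.ne']
  calc (z 1) ^ ((ℓ:ℝ) - 1) * ((1 - z 1) ^ ((m:ℝ) - 1) * (z 0) ^ ((m:ℝ) - 1)) *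
        ((1 - z 1) ^ (-(m:ℝ)) * (1 - z 0) ^ (-(m:ℝ))) * (1 - z 1)
      = (z 0) ^ ((m:ℝ) - 1) * (1 - z 0) ^ (-(m:ℝ)) * (z 1) ^ ((ℓ:ℝ) - 1) *
          ((1 - z 1) ^ ((m:ℝ) - 1) * (1 - z 1) ^ (-(m:ℝ)) * (1 - z 1)) := by ring
    _ = (z 0) ^ ((m:ℝ) - 1) * (1 - z 0) ^ (-(m:ℝ)) * (z 1) ^ ((ℓ:ℝ) - 1) := by rw [key, mul_one]

/-- **The lead's `stub_dirichletLinear`, PROVED**: the linear chart is ONE rule-(2) move,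
`[simplex, x^{ℓ-1} y^{m-1} (1-x-y)^{-m}] ∼ [box, t^{m-1}(1-t)^{-m} x^{ℓ-1}]`. [folklore] -/
theorem dirichletLinear (ℓ m : ℚ) (hℓ : 0 < ℓ) (hm : 0 < m) (hm1 : m < 1)
    (S B : IntegralRep 2)
    (hSd : S.domain = {z | 0 < z 0 ∧ 0 < z 1 ∧ z 0 + z 1 < 1})
    (hSi : Set.EqOn S.integrand (fun z => (z 0) ^ ((ℓ:ℝ) - 1) * (z 1) ^ ((m:ℝ) - 1) *
      (1 - z 0 - z 1) ^ (-(m:ℝ))) S.domain)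
    (hBd : B.domain = {z | z 0 ∈ Set.Ioo (0:ℝ) 1 ∧ z 1 ∈ Set.Ioo (0:ℝ) 1})
    (hBi : Set.EqOn B.integrand (fun z => (z 0) ^ ((m:ℝ) - 1) * (1 - z 0) ^ (-(m:ℝ)) *
      (z 1) ^ ((ℓ:ℝ) - 1)) B.domain) :
    Equivalent S B := by
  have _hℓ := hℓ; have _hm := hm; have _hm1 := hm1
  have hBd' : B.domain = box2 := hBd
  have hSd' : S.domain = simplex2 := hSd
  have hmem : of B - of S ∈ changeOfVariablesRel := by
    refine ⟨2, B, S, Ψ, Ψ', by rw [hBd']; exact isSemialgebraicMapOn_Ψ,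
      fun x _ => (hasFDerivAt_Ψ x).hasFDerivWithinAt, by rw [hBd']; exact injOn_Ψ,
      by rw [hBd', hSd', image_Ψ_box2], fun z hz => ?_, rfl⟩
    have hz' : z ∈ box2 := by rw [hBd'] at hz; exact hz
    have hΨz : Ψ z ∈ S.domain := by
      rw [hSd', ← image_Ψ_box2]
      exact mem_image_of_mem Ψ hz'
    rw [hBi hz, hSi hΨz]
    show (z 0) ^ ((m:ℝ) - 1) * (1 - z 0) ^ (-(m:ℝ)) * (z 1) ^ ((ℓ:ℝ) - 1) =
      (Ψ z 0) ^ ((ℓ:ℝ) - 1) * (Ψ z 1) ^ ((m:ℝ) - 1) * (1 - Ψ z 0 - Ψ z 1) ^ (-(m:ℝ)) * |(Ψ' z).det|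
    rw [pullback_Ψ ℓ m hz']
  exact Equivalent.symm (changeOfVariablesRel_subset_relations hmem)

/-! ### The polar chart `Θ(u,v) = (uv, u(1-v))` of the simplex by the box -/

/-- The polar (Dirichlet) chart `Θ(u, v) = (uv, u(1 - v))`. [folklore] -/
def Θ (z : Fin 2 → ℝ) : Fin 2 → ℝ := ![z 0 * z 1, z 0 * (1 - z 1)]

/-- First component. [folklore] -/
@[simp] theorem Θ_apply_zero (z : Fin 2 → ℝ) : Θ z 0 = z 0 * z 1 := rfl

/-- Second component. [folklore] -/
@[simp] theorem Θ_apply_one (z : Fin 2 → ℝ) : Θ z 1 = z 0 * (1 - z 1) := rfl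

/-- The Jacobian matrix of `Θ`. [folklore] -/
def jacΘ (z : Fin 2 → ℝ) : Matrix (Fin 2) (Fin 2) ℝ := !![z 1, z 0; 1 - z 1, -(z 0)]

/-- The derivative of `Θ`. [folklore] -/
def Θ' (z : Fin 2 → ℝ) : (Fin 2 → ℝ) →L[ℝ] (Fin 2 → ℝ) :=
  LinearMap.toContinuousLinearMap (Matrix.toLin' (jacΘ z))

/-- The derivative applied to a vector, first component. [folklore] -/
@[simp] theorem Θ'_apply_zero (z v : Fin 2 → ℝ) : Θ' z v 0 = z 1 * v 0 + z 0 * v 1 := by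
  change Matrix.toLin' (jacΘ z) v 0 = _
  rw [Matrix.toLin'_apply]
  simp [jacΘ, Matrix.mulVec, dotProduct, Fin.sum_univ_two]

/-- The derivative applied to a vector, second component. [folklore] -/
@[simp] theorem Θ'_apply_one (z v : Fin 2 → ℝ) : Θ' z v 1 = (1 - z 1) * v 0 + -(z 0) * v 1 := by
  change Matrix.toLin' (jacΘ z) v 1 = _
  rw [Matrix.toLin'_apply]
  simp [jacΘ, Matrix.mulVec, dotProduct, Fin.sum_univ_two]

/-- `det DΘ = -u`. [folklore] -/
theorem det_Θ' (z : Fin 2 → ℝ) : (Θ' z).det = -(z 0) := by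
  change LinearMap.det (Matrix.toLin' (jacΘ z)) = _
  rw [LinearMap.det_toLin', Matrix.det_fin_two]
  simp [jacΘ]
  ring

/-- `|det DΘ| = u` on the box. [folklore] -/
theorem abs_det_Θ' {z : Fin 2 → ℝ} (hz : z ∈ box2) : |(Θ' z).det| = z 0 := by
  rw [det_Θ', abs_neg, abs_of_pos hz.1.1]

/-- `Θ` is differentiable with derivative `Θ'`. [folklore] -/
theorem hasFDerivAt_Θ (z : Fin 2 → ℝ) : HasFDerivAt Θ (Θ' z) z := by
  have h0 : HasFDerivAt (fun y : Fin 2 → ℝ => y 0)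
      (ContinuousLinearMap.proj (R := ℝ) (φ := fun _ : Fin 2 => ℝ) 0) z := hasFDerivAt_apply 0 z
  have h1 : HasFDerivAt (fun y : Fin 2 → ℝ => y 1)
      (ContinuousLinearMap.proj (R := ℝ) (φ := fun _ : Fin 2 => ℝ) 1) z := hasFDerivAt_apply 1 z
  rw [hasFDerivAt_pi']
  refine Fin.forall_fin_two.mpr ⟨?_, ?_⟩
  · have hf : (fun y : Fin 2 → ℝ => Θ y 0) = fun y => y 0 * y 1 := funext fun y => rfl
    rw [hf]
    refine (h0.mul h1).congr_fderiv (ContinuousLinearMap.ext fun v => ?_)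
    simp
    ring
  · have hf : (fun y : Fin 2 → ℝ => Θ y 1) = fun y => y 0 * (1 - y 1) := funext fun y => rfl
    rw [hf]
    refine (h0.mul (h1.const_sub 1)).congr_fderiv (ContinuousLinearMap.ext fun v => ?_)
    simp
    ring

/-- `Θ` is injective on the box. [folklore] -/
theorem injOn_Θ : InjOn Θ box2 := by
  intro x hx y hy hxy
  have e0 := congrFun hxy 0
  have e1 := congrFun hxy 1
  simp only [Θ_apply_zero, Θ_apply_one] at e0 e1
  have h0 : x 0 = y 0 := by linarith
  have h1 : x 1 = y 1 := by
    rw [h0] at e0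
    exact mul_left_cancel₀ hy.1.1.ne' e0
  funext i
  fin_cases i
  · exact h0
  · exact h1

/-- `Θ` maps the box ONTO the simplex. [folklore] -/
theorem image_Θ_box2 : Θ '' box2 = simplex2 := by
  ext y
  constructor
  · rintro ⟨z, ⟨h0, h1⟩, rfl⟩
    refine ⟨by simpa using mul_pos h0.1 h1.1, by simpa using mul_pos h0.1 (sub_pos.2 h1.2), ?_⟩
    simp only [Θ_apply_zero, Θ_apply_one]
    nlinarith [h0.2]
  · rintro ⟨hy0, hy1, hy2⟩
    have hs : 0 < y 0 + y 1 := by linarith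
    refine ⟨![y 0 + y 1, y 0 / (y 0 + y 1)], ⟨?_, ?_⟩, ?_⟩
    · change y 0 + y 1 ∈ Ioo (0:ℝ) 1
      exact ⟨hs, hy2⟩
    · change y 0 / (y 0 + y 1) ∈ Ioo (0:ℝ) 1
      exact ⟨div_pos hy0 hs, by rw [div_lt_one hs]; linarith⟩
    · funext i
      fin_cases i
      · change (y 0 + y 1) * (y 0 / (y 0 + y 1)) = y 0
        field_simp
      · change (y 0 + y 1) * (1 - y 0 / (y 0 + y 1)) = y 1
        field_simp
        ring

/-- The substitution polynomials of `Θ`. [folklore] -/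
def substΘ : Fin 2 → MvPolynomial (Fin 2) ℚ := ![X 0 * X 1, X 0 * (1 - X 1)]

/-- Evaluating the substitution is the chart. [folklore] -/
theorem aeval_substΘ (z : Fin 2 → ℝ) : (fun i => aeval z (substΘ i)) = Θ z := by
  funext i
  fin_cases i
  · simp [substΘ]
  · simp [substΘ]

/-- `Θ` is a `ℚ`-semialgebraic map on the box (a polynomial map). [folklore] -/
theorem isSemialgebraicMapOn_Θ : IsSemialgebraicMapOn ℚ box2 Θ := by
  convert isSemialgebraicMapOn_aeval isSemialgebraic_box2 substΘ using 2 with z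
  exact (aeval_substΘ z).symm

/-- The simplex kernel `x^{ℓ-1} y^{m-1} (1-x-y)^{-m}`. [folklore] -/
def simplexKernel (ℓ m : ℚ) : (Fin 2 → ℝ) → ℝ :=
  fun z => (z 0) ^ ((ℓ:ℝ) - 1) * (z 1) ^ ((m:ℝ) - 1) * (1 - z 0 - z 1) ^ (-(m:ℝ))

/-- The simplex kernel is `ℚ`-semialgebraic on the simplex (Euler–Mellin, three factors).
[folklore] -/
theorem isSemialgebraicFunOn_simplexKernel (ℓ m : ℚ) :
    IsSemialgebraicFunOn ℚ simplex2 (simplexKernel ℓ m) := by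
  refine (isSemialgebraicFunOn_mellinIntegrand isSemialgebraic_simplex2
    ![MvPolynomial.X 0, MvPolynomial.X 1, 1 - MvPolynomial.X 0 - MvPolynomial.X 1]
    ![ℓ - 1, m - 1, -m] 1 (fun x hx k => ?_)).congr fun x _ => ?_
  · obtain ⟨h0, h1, h2⟩ := hx
    fin_cases k
    · simpa using h0
    · simpa using h1
    · simp only [Fin.reduceFinMk, Matrix.cons_val, map_sub, map_one, MvPolynomial.aeval_X]
      linarith
  · simp [mellinIntegrand_apply, simplexKernel, Fin.prod_univ_three]

/-- **The pull-back identity of the polar chart**: on the box,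
`(x^{ℓ-1} y^{m-1} (1-x-y)^{-m}) ∘ Θ · |det DΘ| = u^{ℓ+m-1}(1-u)^{-m} v^{ℓ-1}(1-v)^{m-1}`. [folklore] -/
theorem pullback_Θ (ℓ m : ℚ) {z : Fin 2 → ℝ} (hz : z ∈ box2) :
    simplexKernel ℓ m (Θ z) * |(Θ' z).det| =
      (z 0) ^ ((ℓ:ℝ) + m - 1) * (1 - z 0) ^ (-(m:ℝ)) * ((z 1) ^ ((ℓ:ℝ) - 1) * (1 - z 1) ^ ((m:ℝ) - 1)) := by
  have hu0 : 0 < z 0 := hz.1.1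
  have hv0 : 0 < z 1 := hz.2.1
  have hv1 : 0 < 1 - z 1 := sub_pos.2 hz.2.2
  rw [abs_det_Θ' hz]
  simp only [simplexKernel, Θ_apply_zero, Θ_apply_one]
  have hfac : 1 - z 0 * z 1 - z 0 * (1 - z 1) = 1 - z 0 := by ring
  rw [hfac, Real.mul_rpow hu0.le hv0.le, Real.mul_rpow hu0.le hv1.le]
  have key : (z 0) ^ ((ℓ:ℝ) - 1) * (z 0) ^ ((m:ℝ) - 1) * z 0 = (z 0) ^ ((ℓ:ℝ) + m - 1) := by
    rw [← Real.rpow_add hu0, ← Real.rpow_add_one hu0.ne']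
    congr 1
    ring
  calc (z 0) ^ ((ℓ:ℝ) - 1) * (z 1) ^ ((ℓ:ℝ) - 1) * ((z 0) ^ ((m:ℝ) - 1) * (1 - z 1) ^ ((m:ℝ) - 1)) *
        (1 - z 0) ^ (-(m:ℝ)) * z 0
      = ((z 0) ^ ((ℓ:ℝ) - 1) * (z 0) ^ ((m:ℝ) - 1) * z 0) * (1 - z 0) ^ (-(m:ℝ)) *
          ((z 1) ^ ((ℓ:ℝ) - 1) * (1 - z 1) ^ ((m:ℝ) - 1)) := by ring
    _ = _ := by rw [key]

/-- **The lead's `stub_dirichletPolar`, PROVED**: the simplex representation EXISTS (semialgebraic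
by Euler–Mellin; integrable by the chart and Mathlib's Jacobian criterion from the integrability of
the given box representation) and the polar chart is ONE rule-(2) move onto it. [folklore] -/
theorem dirichletPolar (ℓ m : ℚ) (hℓ : 0 < ℓ) (hm : 0 < m) (hm1 : m < 1)
    (P : IntegralRep 2)
    (hPd : P.domain = {z | z 0 ∈ Set.Ioo (0:ℝ) 1 ∧ z 1 ∈ Set.Ioo (0:ℝ) 1})
    (hPi : Set.EqOn P.integrand (fun z => (z 0) ^ ((ℓ:ℝ) + m - 1) * (1 - z 0) ^ (-(m:ℝ)) *
      ((z 1) ^ ((ℓ:ℝ) - 1) * (1 - z 1) ^ ((m:ℝ) - 1))) P.domain) :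
    ∃ S : IntegralRep 2,
      S.domain = {z | 0 < z 0 ∧ 0 < z 1 ∧ z 0 + z 1 < 1} ∧
      Set.EqOn S.integrand (fun z => (z 0) ^ ((ℓ:ℝ) - 1) * (z 1) ^ ((m:ℝ) - 1) *
        (1 - z 0 - z 1) ^ (-(m:ℝ))) S.domain ∧
      Equivalent P S := by
  have _hℓ := hℓ; have _hm := hm; have _hm1 := hm1
  have hPd' : P.domain = box2 := hPd
  -- integrability of the simplex kernel, pulled back through Θ to the given P
  have hbox : IntegrableOn (fun z => |(Θ' z).det| • simplexKernel ℓ m (Θ z)) box2 := by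
    have h1 : IntegrableOn P.integrand box2 := hPd' ▸ P.integrableOn
    refine (h1.congr_fun (fun z hz => ?_) measurableSet_box2)
    rw [hPi (by rw [hPd']; exact hz), smul_eq_mul, mul_comm, pullback_Θ ℓ m hz]
  have hint : IntegrableOn (simplexKernel ℓ m) simplex2 := by
    rw [← image_Θ_box2, integrableOn_image_iff_integrableOn_abs_det_fderiv_smul volume
      measurableSet_box2 (fun x _ => (hasFDerivAt_Θ x).hasFDerivWithinAt) injOn_Θ]
    exact hbox
  let S : IntegralRep 2 := ⟨simplex2, simplexKernel ℓ m, isSemialgebraic_simplex2,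
    isSemialgebraicFunOn_simplexKernel ℓ m, hint⟩
  refine ⟨S, rfl, fun _ _ => rfl, ?_⟩
  refine changeOfVariablesRel_subset_relations
    ⟨2, P, S, Θ, Θ', by rw [hPd']; exact isSemialgebraicMapOn_Θ,
      fun x _ => (hasFDerivAt_Θ x).hasFDerivWithinAt, by rw [hPd']; exact injOn_Θ,
      by rw [hPd', image_Θ_box2], fun z hz => ?_, rfl⟩
  have hz' : z ∈ box2 := by rw [hPd'] at hz; exact hz
  rw [hPi hz]
  show (z 0) ^ ((ℓ:ℝ) + m - 1) * (1 - z 0) ^ (-(m:ℝ)) * ((z 1) ^ ((ℓ:ℝ) - 1) * (1 - z 1) ^ ((m:ℝ) - 1)) =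
    simplexKernel ℓ m (Θ z) * |(Θ' z).det|
  rw [pullback_Θ ℓ m hz']

end DirichletCharts


/-! ## §16 TARGETS — the stubs of line `dirichlet-companion-to-pi` (skeleton ce846a0b)

* `stub_piCancellation` (= `KZ.PiCancellation`, item 0540): OPEN; NECESSARY for the crux
  (gen 1 §9 `piCancellation_of_betaCancellation`) and summit-implied; no kill possible short of
  `¬ KontsevichZagierPeriods`.
* `stub_eulerReflection` (= `EulerReflectionRational`, item 3383): summit-implied (value identity
  `sin(πb)·B(b,1−b) = π`); open item of route CompiledSubstitutions; not attacked here.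
* `stub_betaTranslation`: PROVED (`betaTranslation`, §14).
* `stub_integrateOut`: PROVED (`integrateOut`, below; one Newton–Leibniz move along the last
  coordinate over the base `(0,1)`).
* `stub_dirichletLinear`, `stub_dirichletPolar`: PROVED (`dirichletLinear`, `dirichletPolar`, §15;
  single rule-(2) moves with `|det| = 1 − x`, resp. `u`; the simplex representation of
  `dirichletPolar` is integrable by the chart and the Jacobian criterion from the given box rep).
0 of 6 targets broken; 4 of 6 PROVED. THE LINE IS REDUCED TO EXACTLY ITS TWO OPEN ITEMS 3383 AND
0540: `EulerReflectionRational → KZ.PiCancellation → BetaCancellation` (and conversely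
`BetaCancellation → KZ.PiCancellation`, gen 1 §9). -/

section Targets

-- (the four `stub_*_holds` wrappers in the registered signatures live in `Negative/LineStubs.lean`)

/-- `Fin.castAdd 1 0 = 0` in `Fin (1+1)`. [folklore] -/
theorem castAdd_one_zero : (Fin.castAdd 1 (0 : Fin 1) : Fin (1 + 1)) = 0 := rfl

/-- `Fin.natAdd 1 0 = 1` in `Fin (1+1)`. [folklore] -/
theorem natAdd_one_zero : (Fin.natAdd 1 (0 : Fin 1) : Fin (1 + 1)) = 1 := rfl

/-- `((1 - m : ℚ) : ℝ) - 1 = -m`. [folklore] -/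
theorem cast_one_sub_sub_one (m : ℚ) : (((1 - m : ℚ) : ℝ) - 1) = -(m:ℝ) := by push_cast; ring

/-- **The lead's `stub_integrateOut`, PROVED**: `[(0,1)², t^{m-1}(1-t)^{-m} x^{ℓ-1}] ∼
[(0,1), ℓ⁻¹ t^{m-1}(1-t)^{-m}]` for `0 < ℓ`, `0 < m < 1` — one Newton–Leibniz move along `x` over
the base `(0,1)` (primitive `x^ℓ/ℓ`, §13's `powPrim`), a null boundary and two congruences.
[folklore] -/
theorem integrateOut (ℓ m : ℚ) (hℓ : 0 < ℓ) (hm : 0 < m) (hm1 : m < 1)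
    (B : IntegralRep 2) (R : IntegralRep 1)
    (hBd : B.domain = {z | z 0 ∈ Set.Ioo (0:ℝ) 1 ∧ z 1 ∈ Set.Ioo (0:ℝ) 1})
    (hBi : Set.EqOn B.integrand (fun z => (z 0) ^ ((m:ℝ) - 1) * (1 - z 0) ^ (-(m:ℝ)) *
      (z 1) ^ ((ℓ:ℝ) - 1)) B.domain)
    (hRd : R.domain = {x | x 0 ∈ Set.Ioo (0:ℝ) 1})
    (hRi : Set.EqOn R.integrand (fun x => (ℓ:ℝ)⁻¹ * ((x 0) ^ ((m:ℝ) - 1) * (1 - x 0) ^ (-(m:ℝ))))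
      R.domain) :
    Equivalent B R := by
  have h1m : 0 < 1 - m := by linarith
  set r₀ := betaIooRep m (1 - m) hm h1m with hr₀
  set κ := iccRep (powKernel ℓ) (isSemialgebraicFunOn_powKernel ℓ) (integrableOn_powKernel hℓ) with hκ
  set κ₀ := κ.restrict unitIoo isSemialgebraic_unitIoo unitIoo_subset_unitIcc with hκ₀
  have hr₀i : ∀ x : Fin 1 → ℝ, r₀.integrand x = (x 0) ^ ((m:ℝ) - 1) * (1 - x 0) ^ (-(m:ℝ)) := by
    intro x
    simp only [hr₀, betaIooRep_integrand, betaKernel, cast_one_sub_sub_one]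
  -- B ∼ r₀ × κ₀ (same domain, same integrand on it)
  have e1 : Equivalent B (r₀.prod κ₀) := by
    refine of_sub_of_mem_relations_of_eqOn ?_ fun z hz => ?_
    · rw [hBd]
      ext z
      exact Iff.rfl
    · have hz' : z 0 ∈ Ioo (0:ℝ) 1 ∧ z 1 ∈ Ioo (0:ℝ) 1 := by rw [hBd] at hz; exact hz
      rw [hBi hz, IntegralRep.prod_integrand_eq]
      simp only [IntegralRep.prodFun, hr₀i, hκ₀, IntegralRep.integrand_restrict, hκ, iccRep_integrand,
        castAdd_one_zero, natAdd_one_zero, powKernel_of_mem hz'.2]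
  -- r₀ × κ₀ ∼ r₀ × κ (null boundary)
  have e2 : Equivalent (r₀.prod κ₀) (r₀.prod κ) := by
    refine Equivalent.prod (Equivalent.refl r₀) (Equivalent.symm ?_)
    exact κ.of_sub_of_restrict_mem_relations isSemialgebraic_unitIoo unitIoo_subset_unitIcc
      volume_unitIcc_diff_unitIoo
  -- r₀ × κ ∼ [σ, (K 1 − K 0)·f]  (the Newton–Leibniz move)
  have e3 : Equivalent (r₀.prod κ) (r₀.constMul (powPrim ℓ 1 - powPrim ℓ 0) (isAlgebraic_powPrim_diff hℓ)) :=
    newtonLeibnizRel_subset_relations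
      (prod_iccRep_sub_constMul_mem_newtonLeibnizRel r₀ (isSemialgebraicFunOn_powKernel ℓ)
        (integrableOn_powKernel hℓ) (isSemialgebraicFunOn_powPrim hℓ) (continuousOn_powPrim hℓ)
        (fun t ht => hasDerivAt_powPrim hℓ ht) (isAlgebraic_powPrim_diff hℓ))
  -- … ∼ R (same domain, same integrand on it)
  have e4 : Equivalent (r₀.constMul (powPrim ℓ 1 - powPrim ℓ 0) (isAlgebraic_powPrim_diff hℓ)) R := by
    refine of_sub_of_mem_relations_of_eqOn (by rw [hRd]; rfl) fun x hx => ?_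
    have hxR : x ∈ R.domain := by rw [hRd]; exact hx
    rw [hRi hxR]
    simp only [IntegralRep.integrand_constMul, powPrim_one_sub_powPrim_zero hℓ, hr₀i, Rat.cast_inv]
  exact ((e1.trans e2).trans e3).trans e4

end Targets



/-! ## §17 WHY IT RESISTS, III: on the anti-diagonal `a + b = 1` the crux IS `PiCancellation`, pointwise

Given Euler reflection at `b` inside the calculus (`EulerReflectionAt b`, the instance of item 3383
`EulerReflectionRational` at `b`: `[sin(πb)·β(b,1−b)] ∼ [π]`), cancellation by `β(b,1−b)` is
EQUIVALENT to `KZ.PiCancellation` (item 0540) — at every single `b ∈ (0,1) ∩ ℚ`. (Gen 1 §9 is the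
case `b = 1/2`, where the reflection is an explicit four-move chain.) So no anti-diagonal instance
is easier than 0540, and a kill of any of them kills 0540 and the summit. -/

section AntiDiagonal

/-- Euler reflection at `b` inside the calculus — the instance of item 3383
(`CompiledSubstitutions.EulerReflectionRational`) at `b`: `[(0,1), sin(πb) x^{b-1}(1-x)^{-b}] ∼
[closed unit disc, 1]`. [folklore] -/
def EulerReflectionAt (b : ℚ) : Prop :=
  ∀ (r : IntegralRep 1) (p : IntegralRep 2), r.domain = {x | x 0 ∈ Set.Ioo (0:ℝ) 1} →
    Set.EqOn r.integrand (fun x => Real.sin (Real.pi * b) * (x 0) ^ ((b : ℝ) - 1) *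
      (1 - x 0) ^ (-(b : ℝ))) r.domain →
    p.domain = {z | z 0 ^ 2 + z 1 ^ 2 ≤ 1} → Set.EqOn p.integrand (fun _ => 1) p.domain →
    Equivalent r p

/-- `0 < sin(πb)` for `0 < b < 1`. [folklore] -/
theorem sin_pi_mul_pos {b : ℚ} (hb : 0 < b) (hb1 : b < 1) : 0 < Real.sin (Real.pi * b) := by
  have hb' : (0:ℝ) < b := by exact_mod_cast hb
  have hb1' : (b:ℝ) < 1 := by exact_mod_cast hb1
  refine Real.sin_pos_of_pos_of_lt_pi (by positivity) ?_
  nlinarith [Real.pi_pos]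

/-- `sin(πb)` is algebraic for rational `b > 0`. [folklore] -/
theorem isAlgebraic_sin_pi_mul {b : ℚ} (hb : 0 < b) : IsAlgebraic ℚ (Real.sin (Real.pi * b)) := by
  have h := KoblitzOgus.isAlgebraic_sin_rat_mul_pi b.num.toNat b.den_pos
  have hn : ((b.num.toNat : ℕ) : ℝ) = ((b.num : ℤ) : ℝ) := by
    have := Int.toNat_of_nonneg (Rat.num_nonneg.2 hb.le)
    exact_mod_cast this
  have hcast : (Real.pi * (b.num.toNat : ℕ) / (b.den : ℕ) : ℝ) = Real.pi * b := by
    rw [mul_div_assoc, hn, ← Rat.cast_def]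
  rwa [hcast] at h

/-- The reflection representation `[sin(πb)·β(b,1−b)]` on `(0,1)`. [folklore] -/
def reflRep (b : ℚ) (hb : 0 < b) (hb1 : b < 1) : IntegralRep 1 :=
  (betaIooRep b (1 - b) hb (by linarith)).constMul (Real.sin (Real.pi * b)) (isAlgebraic_sin_pi_mul hb)

/-- Euler reflection at `b` makes `[sin(πb)·β(b,1−b)] ∼ [π]`. [folklore] -/
theorem equivalent_reflRep_piRep {b : ℚ} (hb : 0 < b) (hb1 : b < 1) (hE : EulerReflectionAt b) :
    Equivalent (reflRep b hb hb1) piRep := by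
  refine hE (reflRep b hb hb1) piRep rfl (fun x _ => ?_) rfl (fun _ _ => rfl)
  simp only [reflRep, IntegralRep.integrand_constMul, betaIooRep_integrand, betaKernel,
    Rat.cast_sub, Rat.cast_one, sub_sub_cancel_left, mul_assoc]

/-- `[sin(πb)·β] × ρ ∼ [π] × ρ` and hence `[β] × r ∼ [β] × r' ↔ [π] × r ∼ [π] × r'`, given Euler
reflection at `b`. [folklore] -/
theorem equivalent_betaIooRep_prod_iff_piRep_prod {b : ℚ} (hb : 0 < b) (hb1 : b < 1)
    (hE : EulerReflectionAt b) {n m : ℕ} (r : IntegralRep n) (r' : IntegralRep m) :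
    Equivalent ((betaIooRep b (1 - b) hb (by linarith)).prod r)
        ((betaIooRep b (1 - b) hb (by linarith)).prod r') ↔
      Equivalent (piRep.prod r) (piRep.prod r') := by
  have hs0 : Real.sin (Real.pi * b) ≠ 0 := (sin_pi_mul_pos hb hb1).ne'
  have hsa := isAlgebraic_sin_pi_mul hb
  have hR : ∀ {k : ℕ} (ρ : IntegralRep k), Equivalent ((reflRep b hb hb1).prod ρ) (piRep.prod ρ) :=
    fun ρ => Equivalent.prod (equivalent_reflRep_piRep hb hb1 hE) (Equivalent.refl ρ)
  constructor
  · intro h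
    have h1 := h.constMul (Real.sin (Real.pi * b)) hsa
    rw [← constMul_prod_eq, ← constMul_prod_eq] at h1
    exact ((hR r).symm.trans h1).trans (hR r')
  · intro h
    have h1 : Equivalent ((reflRep b hb hb1).prod r) ((reflRep b hb hb1).prod r') :=
      ((hR r).trans h).trans (hR r').symm
    refine equivalent_of_equivalent_constMul hsa hs0 ?_
    rw [← constMul_prod_eq, ← constMul_prod_eq]
    exact h1

/-- **Anti-diagonal cancellation ⇒ `PiCancellation`** (given Euler reflection at `b`).
[folklore] -/
theorem piCancellation_of_kernelCancellation_antidiagonal {b : ℚ} (hb : 0 < b) (hb1 : b < 1)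
    (hE : EulerReflectionAt b) (hK : KernelCancellation (betaKernel b (1 - b))) :
    KZ.PiCancellation := by
  intro c hc
  obtain ⟨n, m, r, r', hrel⟩ := exists_integralRep_sub_holds c
  have h1 : of piRep * (of r - of r') ∈ relations := by
    have h2 := of_mul_mem_relations piRep hrel
    have : of piRep * (of r - of r') = of piRep * c - of piRep * (c - (of r - of r')) := by
      rw [mul_sub, mul_sub, mul_sub]; abel
    rw [this]
    exact relations.sub_mem hc h2
  have h3 : Equivalent (piRep.prod r) (piRep.prod r') := by
    have : of piRep * (of r - of r') = of (piRep.prod r) - of (piRep.prod r') := by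
      rw [mul_sub, of_mul_of, of_mul_of]
    rw [this] at h1
    exact h1
  have h4 := (equivalent_betaIooRep_prod_iff_piRep_prod hb hb1 hE r r').2 h3
  have h5 : Equivalent r r' := hK r r' _ _ (isPinned_betaIooRep_prod b (1 - b) hb (by linarith) r)
    (isPinned_betaIooRep_prod b (1 - b) hb (by linarith) r') h4
  have : c = (c - (of r - of r')) + (of r - of r') := by abel
  rw [this]
  exact relations.add_mem hrel h5

/-- **`PiCancellation` ⇒ anti-diagonal cancellation** (given Euler reflection at `b`).
[folklore] -/
theorem kernelCancellation_antidiagonal_of_piCancellation {b : ℚ} (hb : 0 < b) (hb1 : b < 1)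
    (hE : EulerReflectionAt b) (hP : KZ.PiCancellation) : KernelCancellation (betaKernel b (1 - b)) := by
  intro n m r r' q q' hq hq' hqq'
  have h1b : 0 < 1 - b := by linarith
  have h1 : Equivalent ((betaIooRep b (1 - b) hb h1b).prod r) ((betaIooRep b (1 - b) hb h1b).prod r') :=
    ((equivalent_of_isPinned_of_isPinned (isPinned_betaIooRep_prod b (1 - b) hb h1b r) hq).trans
      hqq').trans (equivalent_of_isPinned_of_isPinned hq' (isPinned_betaIooRep_prod b (1 - b) hb h1b r'))
  have h2 := (equivalent_betaIooRep_prod_iff_piRep_prod hb hb1 hE r r').1 h1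
  have h3 : of piRep * (of r - of r') ∈ relations := by
    rw [mul_sub, of_mul_of, of_mul_of]
    exact h2
  exact hP _ h3

/-- **ON THE ANTI-DIAGONAL THE CRUX IS `PiCancellation`, POINTWISE**: for every rational
`b ∈ (0,1)` with Euler reflection at `b` available inside the calculus,
`KernelCancellation (β(b,1−b)) ↔ KZ.PiCancellation`. [folklore] -/
theorem kernelCancellation_antidiagonal_iff_piCancellation {b : ℚ} (hb : 0 < b) (hb1 : b < 1)
    (hE : EulerReflectionAt b) : KernelCancellation (betaKernel b (1 - b)) ↔ KZ.PiCancellation :=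
  ⟨piCancellation_of_kernelCancellation_antidiagonal hb hb1 hE,
    kernelCancellation_antidiagonal_of_piCancellation hb hb1 hE⟩

end AntiDiagonal

/-! ## §18 THE VERDICT: modulo Euler reflection (item 3383) the crux IS `PiCancellation` (item 0540)

With §15 (`dirichletPolar`, `dirichletLinear`), §16 (`integrateOut`), §14 (`betaTranslation`,
`_add_nat`, the swap) and §13 (`β(1,b)`), the lead's line dirichlet-companion-to-pi is assembled
here in full: `EulerReflectionRational → KZ.PiCancellation → BetaCancellation`; conversely
`BetaCancellation → KZ.PiCancellation` (§17 at `b = 1/2`, or gen 1 §9 unconditionally). Hence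
`betaCancellation_iff_piCancellation : EulerReflectionRational → (BetaCancellation ↔ KZ.PiCancellation)`.
The crux carries no content beyond items 3383 and 0540 of the tree. -/

section Verdict

/-- Item 3383 `CompiledSubstitutions.EulerReflectionRational`, restated as the conjunction of its
instances `EulerReflectionAt b` (the two are equal by `Iff.rfl`: `Negative/Verdict.lean`,
`eulerReflectionRational_iff`; restated here so that this work file does not import a second route
file). [folklore] -/
def EulerReflectionRational : Prop := ∀ b : ℚ, 0 < b → b < 1 → EulerReflectionAt b

/-- `((a + b : ℚ) : ℝ) - 1 = a + b - 1`. [folklore] -/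
theorem cast_add_sub_one (a b : ℚ) : (((a + b : ℚ) : ℝ) - 1) = (a:ℝ) + b - 1 := by push_cast; ring

/-- `((1 : ℚ) : ℝ) - 1 = 0`. [folklore] -/
theorem cast_one_sub_one : (((1 : ℚ) : ℝ) - 1) = (0:ℝ) := by push_cast; ring

/-- The domain of a product of two `(0,1)`-representations is the open box. [folklore] -/
theorem prod_domain_eq_box2 (κ β : IntegralRep 1) (hκ : κ.domain = unitIoo) (hβ : β.domain = unitIoo) :
    (κ.prod β).domain = {z : Fin 2 → ℝ | z 0 ∈ Set.Ioo (0:ℝ) 1 ∧ z 1 ∈ Set.Ioo (0:ℝ) 1} := by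
  ext z
  simp only [IntegralRep.prod_domain, IntegralRep.mem_prodDomain, hκ, hβ, mem_unitIoo, mem_setOf_eq,
    castAdd_one_zero, natAdd_one_zero]

/-- The integrand of a product of two Beta representations, coordinatewise. [folklore] -/
theorem betaIooRep_prod_betaIooRep_integrand (a b a' b' : ℚ) (ha : 0 < a) (hb : 0 < b) (ha' : 0 < a')
    (hb' : 0 < b') (z : Fin (1 + 1) → ℝ) :
    ((betaIooRep a b ha hb).prod (betaIooRep a' b' ha' hb')).integrand z =
      betaKernel a b (z 0) * betaKernel a' b' (z 1) := by
  rw [IntegralRep.prod_integrand_eq]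
  simp only [IntegralRep.prodFun, betaIooRep_integrand, castAdd_one_zero, natAdd_one_zero]

/-- **THE COMPANION COLLAPSE, PROVED**: for `0 < a`, `0 < b < 1`,
`[β(a+b,1−b)] × [β(a,b)] ∼ [(0,1), a⁻¹ · t^{b-1}(1-t)^{-b}]` (polar chart, linear chart,
integrating out — §15, §16). [folklore] -/
theorem companion_collapse {a b : ℚ} (ha : 0 < a) (hb : 0 < b) (hb1 : b < 1) (hab : 0 < a + b)
    (h1b : 0 < 1 - b) :
    Equivalent ((betaIooRep (a + b) (1 - b) hab h1b).prod (betaIooRep a b ha hb))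
      ((betaIooRep b (1 - b) hb h1b).constMul (((a:ℚ):ℝ)⁻¹) (isAlgebraic_algebraMap a).inv) := by
  set P := (betaIooRep (a + b) (1 - b) hab h1b).prod (betaIooRep a b ha hb) with hP
  have hPd : P.domain = {z : Fin 2 → ℝ | z 0 ∈ Set.Ioo (0:ℝ) 1 ∧ z 1 ∈ Set.Ioo (0:ℝ) 1} :=
    prod_domain_eq_box2 _ _ rfl rfl
  have hPi : Set.EqOn P.integrand (fun z => (z 0) ^ ((a:ℝ) + b - 1) * (1 - z 0) ^ (-(b:ℝ)) *
      ((z 1) ^ ((a:ℝ) - 1) * (1 - z 1) ^ ((b:ℝ) - 1))) P.domain := by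
    intro z _
    rw [hP, betaIooRep_prod_betaIooRep_integrand]
    simp only [betaKernel, cast_add_sub_one, cast_one_sub_sub_one]
  obtain ⟨S, hSd, hSi, hPS⟩ := dirichletPolar a b ha hb hb1 P hPd hPi
  set B := (betaIooRep b (1 - b) hb h1b).prod (betaIooRep a 1 ha one_pos) with hB
  have hBd : B.domain = {z : Fin 2 → ℝ | z 0 ∈ Set.Ioo (0:ℝ) 1 ∧ z 1 ∈ Set.Ioo (0:ℝ) 1} :=
    prod_domain_eq_box2 _ _ rfl rfl
  have hBi : Set.EqOn B.integrand (fun z => (z 0) ^ ((b:ℝ) - 1) * (1 - z 0) ^ (-(b:ℝ)) *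
      (z 1) ^ ((a:ℝ) - 1)) B.domain := by
    intro z _
    rw [hB, betaIooRep_prod_betaIooRep_integrand]
    simp only [betaKernel, cast_one_sub_sub_one, cast_one_sub_one, Real.rpow_zero, mul_one]
  have hSB := dirichletLinear a b ha hb hb1 S B hSd hSi hBd hBi
  set R := (betaIooRep b (1 - b) hb h1b).constMul (((a:ℚ):ℝ)⁻¹) (isAlgebraic_algebraMap a).inv with hR
  have hRd : R.domain = {x : Fin 1 → ℝ | x 0 ∈ Set.Ioo (0:ℝ) 1} := rfl
  have hRi : Set.EqOn R.integrand
      (fun x => ((a:ℚ):ℝ)⁻¹ * ((x 0) ^ ((b:ℝ) - 1) * (1 - x 0) ^ (-(b:ℝ)))) R.domain := by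
    intro x _
    simp only [hR, IntegralRep.integrand_constMul, betaIooRep_integrand, betaKernel, cast_one_sub_sub_one]
  have hBR := integrateOut a b ha hb hb1 B R hBd hBi hRd hRi
  exact hPS.trans (hSB.trans hBR)

/-- `t × (s × r) ∼ (t × s) × r` (a coordinate relabelling, `KZ.of_sub_of_reindex_mem_relations`).
[folklore] -/
theorem equivalent_prod_assoc {l m n : ℕ} (t : IntegralRep l) (s : IntegralRep m) (r : IntegralRep n) :
    Equivalent (t.prod (s.prod r)) ((t.prod s).prod r) := by
  let e : Fin (l + m + n) ≃ Fin (l + (m + n)) := finCongr (Nat.add_assoc l m n)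
  have key : t.prod (s.prod r) = ((t.prod s).prod r).reindex e := by
    have h1 : ∀ (w : Fin (l + (m + n)) → ℝ) (i : Fin l),
        w (e (Fin.castAdd n (Fin.castAdd m i))) = w (Fin.castAdd (m + n) i) := by
      intro w i; congr 1
    have h2 : ∀ (w : Fin (l + (m + n)) → ℝ) (j : Fin m),
        w (e (Fin.castAdd n (Fin.natAdd l j))) = w (Fin.natAdd l (Fin.castAdd n j)) := by
      intro w j; congr 1
    have h3 : ∀ (w : Fin (l + (m + n)) → ℝ) (j : Fin n),
        w (e (Fin.natAdd (l + m) j)) = w (Fin.natAdd l (Fin.natAdd m j)) := by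
      intro w j; congr 1; ext; simp [e, Nat.add_assoc]
    refine IntegralRep.ext' ?_ ?_
    · ext w
      simp only [IntegralRep.prod_domain, IntegralRep.mem_prodDomain, IntegralRep.reindex_domain,
        mem_setOf_eq, h1, h2, h3]
      exact and_assoc.symm
    · rw [IntegralRep.reindex_integrand, IntegralRep.prod_integrand_eq, IntegralRep.prod_integrand_eq]
      funext w
      simp only [IntegralRep.prodFun, IntegralRep.prod_integrand_eq, h1, h2, h3, mul_assoc]
  rw [key]
  have h := of_sub_of_reindex_mem_relations ((t.prod s).prod r) e
  have h' := relations.neg_mem h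
  simpa [Equivalent] using h'

/-- **The non-integer regime `0 < b < 1`**: companion collapse + Euler reflection at `b` +
`PiCancellation` give `KernelCancellation (β(a,b))` for every `a > 0`. [folklore] -/
theorem kernelCancellation_betaKernel_of_lt_one {a b : ℚ} (ha : 0 < a) (hb : 0 < b) (hb1 : b < 1)
    (hE : EulerReflectionAt b) (hP : KZ.PiCancellation) : KernelCancellation (betaKernel a b) := by
  intro n m r r' q q' hq hq' hqq'
  have hab : 0 < a + b := by linarith
  have h1b : 0 < 1 - b := by linarith
  have ha0 : ((a:ℚ):ℝ) ≠ 0 := by exact_mod_cast ha.ne'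
  set κ := betaIooRep (a + b) (1 - b) hab h1b with hκ
  set β := betaIooRep a b ha hb with hβ
  set γ := betaIooRep b (1 - b) hb h1b with hγ
  have hcoll : Equivalent (κ.prod β) (γ.constMul (((a:ℚ):ℝ)⁻¹) (isAlgebraic_algebraMap a).inv) :=
    companion_collapse ha hb hb1 hab h1b
  have chain : ∀ {k : ℕ} (ρ : IntegralRep k) (p : IntegralRep (1 + k)),
      IsPinned (betaKernel a b) ρ p →
      Equivalent (κ.prod p) ((γ.prod ρ).constMul (((a:ℚ):ℝ)⁻¹) (isAlgebraic_algebraMap a).inv) := by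
    intro k ρ p hp
    have e1 : Equivalent (κ.prod p) (κ.prod (β.prod ρ)) :=
      Equivalent.prod (Equivalent.refl κ) (equivalent_of_isPinned_of_isPinned hp (isPinned_betaIooRep_prod a b ha hb ρ))
    have e2 : Equivalent (κ.prod (β.prod ρ)) ((κ.prod β).prod ρ) := equivalent_prod_assoc κ β ρ
    have e3 : Equivalent ((κ.prod β).prod ρ) ((γ.constMul (((a:ℚ):ℝ)⁻¹) (isAlgebraic_algebraMap a).inv).prod ρ) :=
      Equivalent.prod hcoll (Equivalent.refl ρ)
    rw [constMul_prod_eq] at e3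
    exact (e1.trans e2).trans e3
  have h1 : Equivalent ((γ.prod r).constMul (((a:ℚ):ℝ)⁻¹) (isAlgebraic_algebraMap a).inv)
      ((γ.prod r').constMul (((a:ℚ):ℝ)⁻¹) (isAlgebraic_algebraMap a).inv) :=
    ((chain r q hq).symm.trans (Equivalent.prod (Equivalent.refl κ) hqq')).trans (chain r' q' hq')
  have h2 : Equivalent (γ.prod r) (γ.prod r') :=
    equivalent_of_equivalent_constMul (isAlgebraic_algebraMap a).inv (inv_ne_zero ha0) h1
  exact kernelCancellation_antidiagonal_of_piCancellation hb hb1 hE hP r r' _ _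
    (isPinned_betaIooRep_prod b (1 - b) hb h1b r) (isPinned_betaIooRep_prod b (1 - b) hb h1b r') h2

/-- **`EulerReflectionRational → KZ.PiCancellation → BetaCancellation`**: the lead's line, assembled
in full from the theorems of this dossier. [folklore] -/
theorem betaCancellation_of_piCancellation (hE : EulerReflectionRational) (hP : KZ.PiCancellation) :
    BetaCancellation := by
  rw [betaCancellation_iff_unitSquare]
  intro a b ha _ hb hb1
  rcases hb1.lt_or_eq with hb1 | rfl
  · exact kernelCancellation_betaKernel_of_lt_one ha hb hb1 (hE b hb hb1) hP
  · exact kernelCancellation_betaKernel_right_one ha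

/-- **THE VERDICT.** Modulo Euler reflection inside the calculus (item 3383 of route
CompiledSubstitutions), the crux `BetaCancellation` IS the `π`-cancellation crux (item 0540 of route
AyoubSpecialisation): `EulerReflectionRational → (BetaCancellation ↔ KZ.PiCancellation)`.
[folklore] -/
theorem betaCancellation_iff_piCancellation (hE : EulerReflectionRational) :
    BetaCancellation ↔ KZ.PiCancellation := by
  refine ⟨fun h => ?_, betaCancellation_of_piCancellation hE⟩
  have h2 : (0:ℚ) < 1 / 2 := by norm_num
  have h2' : (1:ℚ) / 2 < 1 := by norm_num
  have hK : KernelCancellation (betaKernel (1 / 2) (1 - 1 / 2)) := (betaCancellation_iff.1 h) _ _ h2 (by norm_num)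
  exact piCancellation_of_kernelCancellation_antidiagonal h2 h2' (hE _ h2 h2') hK

end Verdict

end Summit.KontsevichZagierPeriods.KontsevichZagierPeriods.Cruxes.BetaCancellation.Disproof
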